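/-
Copyright: statement-level skeleton of a published paper (lit-balaban cell, Phase-2 proof seat p32 gen 31). No proof claims
beyond what the kernel checks below.
-/
import Literature.MathematicalPhysics.QuantumFieldTheory.Balaban1983to89.B3Eq326ZeroLattice
import Literature.MathematicalPhysics.QuantumFieldTheory.Balaban1983to89.B3Eq337ZeroLattice
import Literature.MathematicalPhysics.QuantumFieldTheory.Balaban1983to89.B3Eq322ZeroLattice
import Literature.MathematicalPhysics.QuantumFieldTheory.Balaban1983to89.B3CxiPropagator
import Literature.MathematicalPhysics.QuantumFieldTheory.Balaban1983to89.B3Eq334ZeroLattice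

/-!
# Bałaban, *(Higgs)₂,₃ quantum fields in a finite volume. III*, CMP 88 (1983), p. 444 ¶2: the factor
# `Σ_{x,x″} η^{2d} Γ′_μ(x,x′,x″)` of (3.36) VANISHES for the classes (2.21b)+(2.21g), (2.18) and (2.21c) — the three-point kernels
# `Γ′_μ` WITH BODIES on the zero-field infinite lattice `ηℤ^{d+1}` and the three vanishing sentences PROVED

[cite: Balaban1983Higgs3, (3.36) p.444 (PDF 34); graphs (2.18), (2.21) pp.429–430 (PDF 19–20); (3.7)/(3.9) p.435 (PDF 25)].
Unit `lit-balaban-p32` (Phase-2 proof seat p32, gen 31; TAKING line gen 30 2026-08-23T03:21:38Z), fold row **B3.Eq3.33-3.38** (owner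
r15) — the owner's residual **(c)** (ROWS-B3 v1.253: *"p. 444 ¶2 as typed kernel statements — (c1) … (2.21b) and (2.21g) with the
proper renormalization mass counterterm, (c2) … (2.18) … opposite signs, (c3) the graph (2.21c) itself … the (2.21c) three-point
kernel not typed"*).  statement-level skeleton of published theorems with citation tags; proofs where landed; nothing here is a claim
about the Yang–Mills mass gap.

PDF held: `paper:balaban1983-higgs-2-3-quantum-fields-finite-volume` (journal page = PDF page + 410); pp. 413, 429–430, 434–436,
442–444 read on the ×2 renders `run/shared/lean/pub/pub-balaban/b2b-balaban-ref1/pages/1983-cmp88-higgs23-III/1983-cmp88-higgs23-III-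
p003, p019, p020, p024–p026, p032–p034-x2.png`.

THE PRINTED TEXT (verbatim).  p. 443: *"Thus we have to consider the graphs (2.18)–(2.20), (2.21b), and the counterterms (2.21g) and
(2.21c). … Generally an expression corresponding to these graphs has the form Σ_{x,x′,x″} η^{3d} Σ_{μ=1}^d g(x)A_μ(x)φ′(x′)·Γ_μ(x,x′,x″)
φ″(x″) (3.33)"*.  p. 444: *"This gives us a convergent expression plus the expression Σ_{x′} η^d Σ_{μ=1}^d g(x′)A_μ(x′)φ′(x′)·(a product
of the values of all the localization functions at the point x′)(Σ_{x,x″} η^{2d}Γ′_μ(x,x′,x″)) φ″(x′), (3.36) where Γ′_μ is given by the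
same formula as before, but with the summations unrestricted. … Now we can analyze the factor Σ_{x,x″} η^{2d}Γ′_μ(x,x′,x″) for all the
renormalized classes. It is easily seen that it vanishes for the graphs (2.21b) and (2.21g) with the proper renormalization mass
counterterm. It vanishes also for the graphs (2.18) because they correspond to the same expressions but with the opposite signs. To
analyze the remaining graphs we have to transform it further. … Now we replace the propagators G^η_{j₀}(0), G^η_{j₀} by C^ξ in the way
described several times. We get a convergent expression plus Σ_{y,y″} ξ^{2d}Γ″_μ(y,y′,y″) defined with the help of the propagator C^ξ.
… For the graph (2.21c) it equals 0 also because by translation invariance it can be written as a derivative of a constant."*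
p. 429: *"the classes G_ren are defined as the smallest sets of graphs, symmetric with respect to permutation of external scalar field
legs and with each divergent subgraph renormalized, e.g. each pair of graphs below form one class: [(2.18)], [(2.19)], [(2.20)]"*;
p. 430: *"adding one-vertex graphs of the form —•— δm²_k(G) with mass renormalization counterterms corresponding to the previous graphs,
so we take one counterterm for each graph"*; p. 435 (3.7): the counterterm of the lowest-order self-energy graph is `(−1)·`[the graph
with both legs at one vertex], (3.9): the two terms differ only in the leg `φ′(x′) ↦ φ′(x)`.

THE GRAPHS AS KERNELS (the reading, legend (1.17) p. 415 / vertices (1.8) p. 413; cf. p18's `B3Sect2ThreeLegGraphs` for the same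
pictures as combinatorial graphs).  Zero background field (the §3 setting, p. 433), carrier `ηℤ^{d+1}` (sites `Fin (d+1) → ℤ`; p26's
two-point kernels `B3Ineq313Lattice.KernelZ`, `dKernelZ` = `(∂^η_μG∂^{η*}_μ)`, p39's `B3Eq326ZeroLattice.dAdjKernelZ` = `(G∂^{η*}_μ)`,
`d2KernelZ` = `(∂^η_{μ′}G∂^{η*}_μ)`, this file's `dFstKernelZ` = `(∂^η_μG)`).  A vertex (1.8) sits on a bond `b = (x, μ)`: all its vector
legs carry the direction `μ` of `b` and its one differentiation `D^η_b` acts in that direction; the internal vector line is read as a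
scalar-type kernel diagonal in the direction (print's own `C^ξ(y − y′)` for the wavy lines of (3.37)/(3.38); p39 g10's `tri19`/`tri20`),
so the two vertices it joins share the direction index.  The internal-index structure (a word in the charge matrix `q` times couplings)
is ONE linear map `Q : W →ₗ W` outside a SCALAR three-point kernel `γ_μ(x,x′,x″)` (slots: vector-leg vertex `x`, `φ′`-vertex `x′`,
`φ″`-vertex `x″`); a graph whose vector leg sits at the vertex of a scalar leg has `γ = η^{−d}δ·s` with a two-point kernel `s`
(`atFirst`, and `atSecond` for the permuted graph of the class).
* (2.21b) p. 430: `s_μ(x′,x″) = Σ_z η^d (∂^η_μG₁)(x′,z)·B(z,x″)`, the bubble `B(z,x″) = Σ_ν(∂^η_νG₂∂^{η*}_ν)(z,x″)G₃(z,x″)` = the lowest-order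
  self-energy graph (3.6) (= p26's bracket `coeff39Z η G₂ G₃ 1 1`, `bubbleZ_eq_coeff39Z`) ↦ `ker221b`, `gamma221b`, `gamma221bPerm`.
* (2.21g) p. 430: `s_μ(x′,x″) = −(∂^η_μG₁)(x′,x″)·δm²(x″)`, `δm²(z) = Σ_{x″}η^dB(z,x″)` — *"the proper renormalization mass counterterm"*
  ((3.7)/(3.9)) ↦ `massCT`, `ker221g`, `gamma221g`, `gamma221gPerm`.
* (2.18) p. 429: `K_μ(a,b) = (∂^η_μG_s∂^{η*}_μ)(a,b)·G_v(a,b)` ↦ `ker218`, `gamma218` (vector leg at the `φ′`-vertex), `gamma218Perm`.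
* (2.21c) p. 430: `s_μ(x′,x″) = Σ_z η^d Σ_ν(∂^η_μG₁∂^{η*}_ν)(x′,z)(G₂∂^{η*}_ν)(z,x″)G₃(z,x″)` ↦ `ker221c`, `gamma221c`, `gamma221cPerm`;
  its undifferentiated companion `inner221c` (the "constant").
* The factor of (3.36), summations unrestricted (both over ALL of `ℤ^{d+1}`) ↦ **`coeff336Z η γ μ x′ = Σ'_x Σ'_{x″} η^{2(d+1)} γ_μ(x,x′,x″)`**;
  (3.36) itself with that coefficient ↦ `local336U` (p39 g18's `B3Eq334ZeroLattice.local336Z` is the same display over FINITE sets).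

SENTENCE ↦ THEOREM (the owner's audit table).
* (c1) *"it vanishes for the graphs (2.21b) and (2.21g) with the proper renormalization mass counterterm"* ↦
  **`coeff336Z_221b_add_221g`**: `coeff(Γ′_{(2.21b)}) + coeff(Γ′_{(2.21g)}) = 0` for ARBITRARY kernels `G₁, G₂, G₃`, `η ≠ 0`, under the
  summability of the double family `(z,x″) ↦ (∂^η_μG₁)(x′,z)B(z,x″)` (the two coefficients are the two iterated sums of it, Mathlib's
  `Summable.tsum_comm`); the permuted graphs of the class vanish INDIVIDUALLY (`coeff336Z_221bPerm_eq_zero`, `coeff336Z_221gPerm_eq_zero`: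
  the differentiation falls on the summed vertex — r15's `B3Sect3TriangleGraphs.tsum_pdiffZ_translate_eq_zero` BY NAME).  Hypothesis-free
  instances: every line `C^ξ` on `ξℤ^{d+1}` (`coeff336Z_221b_add_221g_Cxi`, `coeff336Z_221bgPerm_Cxi_eq_zero`; r15's `summable_Cxi`) and —
  the print's stage BEFORE the replacement — the lines `G^ξ_k(0)` on `ξℤ³` (`coeff336Z_221b_add_221g_GxiL`, `coeff336Z_221bgPerm_GxiL_eq_zero`;
  the Fubini summability from p39 g9's p. 437 kernel laws `B3Eq316DifferenceKernelBounds.exists_laws`).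
* (c2) *"It vanishes also for the graphs (2.18) because they correspond to the same expressions but with the opposite signs"* ↦
  **`coeff336Z_218Perm_eq`** (the two pictures of the class have the SAME coefficient `η^dΣ_{x″}K_μ(x′,x″)` — `K_μ` is symmetric for
  symmetric `G_s`, `G_v`, `ker218_symm`), **`local336U_218Perm_eq_neg`** (their (3.36) terms are OPPOSITE: the permuted picture pairs
  `φ″(x′)·Qφ′(x′)`, and `Q` — print's `e³q³ = −e³q` — is skew, `⟪Qu,v⟫ = −⟪u,Qv⟫`, the hypothesis of r15's torus `expr39_symm`), hence
  **`local336U_218_class_eq_zero`**; no convergence hypothesis.  Instances: `C^ξ`-lines (`local336U_218_class_Cxi_eq_zero`, r15's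
  `Cxi_neg`) and the zero-field propagators `G_k(ηℤ^{d+1},0)` of p26 (`local336U_218_class_GkLat_eq_zero`, `B3GkZeroLattice.GkLat_comm`).
* (c3) *"For the graph (2.21c) it equals 0 also because by translation invariance it can be written as a derivative of a constant"* ↦
  **`coeff336Z_221c_eq_zero`**: for translation-invariant `G₁, G₂, G₃` (`G(a+t,b+t) = G(a,b)`), `η ≠ 0`, under the convergence of the
  inner and outer sums, `coeff = η^d·∂^η_μ[a ↦ Σ_{x″}I(a,x″)](x′)` (`ker221c_eq_pdiffZ`) and the bracket is constant
  (`tsum_inner221c_transl`); the permuted graph by the summed difference (`coeff336Z_221cPerm_eq_zero`, no translation invariance).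
  Hypothesis-free at `C^ξ` on `ξℤ^{d+1}`, any dimension: **`coeff336Z_221c_Cxi_eq_zero`**, `coeff336Z_221cPerm_Cxi_eq_zero`.
* §4: for convolution kernels `K(a,b) = C(a − b)` (`convKer`; translation invariance automatic, symmetry = evenness of `C`) every
  summability hypothesis above reduces to `Summable C₁, C₂, C₃` (`…_convKer` corollaries; the shear `(z,x″) ↦ (a − z, z − x″)` of
  `ℤ^{d+1} × ℤ^{d+1}` and `ℓ¹ × ℓ¹ ⊂ ℓ¹(ℤ^{d+1} × ℤ^{d+1})`, Mathlib's `summable_mul_of_summable_norm`).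

HONEST SCOPE / DECLARED DIVERGENCES (F7).  (i) Zero external field, scalar legs in a real inner-product space `W` (print `ℝ²`), the
internal-index word of each class as one map `Q` (its skewness, used only for (2.18), is print's `q^⊤ = −q`); overall numerical
prefactors of the vertices ((1.8): `(e(L^kε))^{n+n′}(−1)^{n+n′}η^{n+n′−1}/n!n′!`) are NOT tracked — only the two RELATIVE signs that the
sentences use: graph vs. counterterm (= the `(−1)` of (3.7)) and picture vs. permuted picture (= `q^⊤ = −q`).  (ii) The internal vector
line is a scalar-type kernel diagonal in the direction index (as print's (3.37)/(3.38) and the row's files `tri19`/`tri20`); a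
direction-dependent or non-diagonal vector propagator is not treated.  (iii) *"with the summations unrestricted"* = `tsum`s over
`ℤ^{d+1}`; the convergence hypotheses of the model-free theorems are explicit and are DISCHARGED at `C^ξ` (all classes, any `d + 1 ≥ 1`,
`ξ > 0`) and at `G^ξ_k(0)` on `ξℤ³` ((2.21b)/(2.21g); (2.18) needs none); (c3) at `G_{j₀}(0)` is not claimed (that kernel is invariant
under BLOCK translations only — the print states (c3) after the replacement by `C^ξ`, and so does this file).  (iv) Which scalar leg sits
at the vector-leg vertex: both members of each class are treated (`atFirst`/`atSecond`); the gathering vertex of (3.34)/(3.36) is the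
`φ′`-vertex `x′` as displayed (*"For example, if φ′ is such a leg"*).  (v) NOT here: (2.19)/(3.37) and (2.20)/(3.38) (r15
`B3Sect3TriangleGraphs`, p39 g10 `B3Eq337ZeroLattice`/`B3Eq338ZeroLattice`), the pictures (3.35), the degree-0 rescaling `η → ξ` of the
coefficient (p39 g18 FILE 3), the orderings/`j`-resummation bookkeeping (row B3.Eq2.7; p39 `local336Z_resum`), `d = 2`-specific
statements; p39 g18's `B3Eq334ZeroLattice` (pending at the time of writing) is not imported — its `local336Z` is the finite-set display,
this file's `local336U` the unrestricted one, and `γ • Q` embeds `SKernel3Z` into its `Kernel3Z`.  Definitions with bodies and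
theorems only; no Literature fact (`def … : Prop`) introduced, no `sorry`; standard axioms.  Value = the three vanishing sentences of
p. 444 as kernel theorems on the printed carrier, NOT summit progress.  HOME `run/shared/lean/pub/lit-balaban/` (row B3.Eq3.33-3.38,
FILED.md, STATUS.md), 2026-08-23.
-/

/-!
# PART II (p32 gen 30, p351979; MERGED HERE) — the factor `Σ_{x,x″} η^{2d} Γ′_μ` in the vertex-delta normal form, `C^ξ` in every
# dimension, the bridge to p39's `B3Eq334ZeroLattice`, and the resummed `G^η_{j₀}(0)` instances

MERGE NOTE (2026-08-23).  Two generations of the seat `lit-balaban-p32` served r15's residual (c) concurrently: gen 31 filed PART I above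
(p351864, ACCEPTED commit c18431eff6fd, the MEMBER OF RECORD of row B3.Eq3.33-3.38 in `ROWS-B3.md` v1.260) and gen 30 — resumed by the
infrastructure after an interruption, unaware of gen 31 — filed an independent whole file under the same name (p351979, ACCEPTED commit
6e2a2a194744), which REPLACED PART I in the tree.  This merged file RESTORES PART I VERBATIM (every declaration of p351864, bodies
byte-identical) and keeps PART II (every declaration of p351979; its `SKernel3Z` is PART I's, its `locFactorZ` is an abbreviation of
PART I's `coeff336Z` — the same double sum), so that both announced name sets elaborate.  PART II's own description follows.

# Bałaban, *(Higgs)₂,₃ quantum fields in a finite volume. III. Renormalization*, CMP **88** (1983) 411–445 [Balaban1983Higgs3]: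
# p. 444 ¶2 — the factor `Σ_{x,x″} η^{2d} Γ′_μ(x,x′,x″)` of (3.36) VANISHES for the classes (2.18), (2.21b)+(2.21g), (2.21c)

[cite: Balaban1983Higgs3, p.444 (PDF 34) ¶2; graphs (2.18) p.429, (2.21) p.430; (3.33)–(3.36) pp.443–444; the counterterm sentence
p.438 (before (3.19)); vertices (1.6)–(1.10) p.413 and their pictures (1.17) p.415].  Unit `lit-balaban-p32` (Phase-2 proof seat
p32, gen 30); fold row **B3.Eq3.33-3.38** of `HOME/lit-balaban-r15/ROWS-B3.md` (owner r15), the owner's residual **(c)** (r15 g14,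
03:17Z: *"p. 444 ¶2 as TYPED KERNEL STATEMENTS: the three-point kernels Γ′_μ(x,x′,x″) … WITH BODIES for the classes (2.18),
(2.21b)+(2.21g), (2.21c), and the three vanishing theorems print asserts for Σ_{x,x″}η^{2d}Γ′_μ(x,x′,x″)"*).
statement-level skeleton of published theorems with citation tags; proofs where landed; nothing here is a claim about the
Yang–Mills mass gap

SOURCES READ (first hand).  PDF held: `paper:balaban1983-higgs-2-3-quantum-fields-finite-volume` (journal page = PDF page + 410);
the ×2 renders `run/shared/lean/pub/pub-balaban/b2b-balaban-ref1/pages/1983-cmp88-higgs23-III/…-p034-x2.png` (p. 444), `p033` (p. 443: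
(3.33)–(3.35)), `p032` (p. 442: the sentences introducing the class), `p019`/`p020` (pp. 429–430: the pictures (2.18)–(2.22), read on
strip crops for the arrowheads), `p003`/`p005` (pp. 413, 415: the vertices (1.6)–(1.10) and their pictures (1.17)), `p028` (p. 438: the
mass counterterm of a self-energy graph).

THE PRINTED TEXT (verbatim).  p. 442 bottom – p. 443 top: *"Our last class of graphs is the class of graphs with two external scalar
field legs and one vector field leg. They were described graphically in (2.18)–(2.21). … At first let us recall that the expression
corresponding to the graph (2.21a) vanishes. Graph (2.21e) has an additional power of η, so we can treat it like the graph (2.4)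
multiplied by a finite expression. The graphs (2.21d) and (2.21f) are cancelled by the corresponding counterterms in (2.21g). Thus we
have to consider the graphs (2.18)–(2.20), (2.21b), and the counterterms (2.21g) and (2.21c). Only the first three classes are
primitively divergent. Generally an expression corresponding to these graphs has the form
Σ_{x,x′,x″} η^{3d} Σ_{μ=1}^d g(x)A_μ(x)φ′(x′)·Γ_μ(x,x′,x″)φ″(x″) (3.33) and the degree is 0."*  p. 444: *"This gives us a convergent
expression plus the expression Σ_{x′} η^d Σ_{μ=1}^d g(x′)A_μ(x′)φ′(x′)·(a product of the values of all the localization functions at the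
point x′)(Σ_{x,x″} η^{2d}Γ′_μ(x,x′,x″)) φ″(x′), (3.36) where Γ′_μ is given by the same formula as before, but with the summations
unrestricted. Next we sum the expressions (3.36) over admissible orderings and indices and we get the expressions of the same type but
with propagators G^η_{j₀}(0), G^η_{j₀}, where j₀ is the lowest index of the external legs.  Now we can analyze the factor
Σ_{x,x″} η^{2d}Γ′_μ(x,x′,x″) for all the renormalized classes. It is easily seen that it vanishes for the graphs (2.21b) and (2.21g) with
the proper renormalization mass counterterm. It vanishes also for the graphs (2.18) because they correspond to the same expressions
but with the opposite signs. To analyze the remaining graphs we have to transform it further. The expression Σ_{x,x″} η^{2d}Γ′_μ(x,x′,x″)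
is of degree 0, so it is equal to the same expression but on the scale ξ instead of η, ξ = L^{−j₀}. Now we replace the propagators
G^η_{j₀}(0), G^η_{j₀} by C^ξ in the way described several times. We get a convergent expression plus Σ_{y,y″} ξ^{2d}Γ″_μ(y,y′,y″) defined
with the help of the propagator C^ξ. This expression for the graphs (2.19) equals … = 0. (3.37)  For the graph (2.21c) it equals 0
also because by translation invariance it can be written as a derivative of a constant."*  p. 438: *"If Σ(x,x′) is an expression
corresponding to any such graph, then we have a graph with mass renormalization counterterm of the form −Σ_{x′}η^dΣ(x,x′)"*; p. 430:
*"… adding one-vertex graphs of the form —●— [δm²_k(G)] with mass renormalization counterterms corresponding to the previous graphs, so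
we take one counterterm for each graph."*  p. 429: *"the classes G_ren are defined as the smallest sets of graphs, symmetric with
respect to permutation of external scalar field legs and with each divergent subgraph renormalized, e.g. each pair of graphs below form
one class: [(2.18)], [(2.19)], [(2.20)]"*.

READING OF THE PICTURES (transcript notes; the print gives no formula for Γ_μ of these graphs — the bodies below are read off the
drawings with the Feynman rules of Sect. 1–2).
* T1 (vertices). The open-circle vertex with an arrowhead on one scalar leg is the derivative vertex (1.8) — its arrowed leg is the
  differentiated leg `(D^η φ′)(b)`, the other scalar leg `q^{n+n′}φ′(b_−)`, its `n + n′` vector legs all on the bond `b` (one direction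
  `μ`); the open circle without arrow is (1.10); `—●—` is the mass counterterm (1.7) ((1.17) p. 415).
* T2 (lines). At zero external field the scalar line is a scalar kernel `G_s(x,x′)` times the identity of the internal indices; the
  vector line is read DIAGONALLY in the direction index, `δ_{νν′}G_v(x,x′)`, as in every printed formula of Sect. 3 ((3.9):
  `Σ_ν(∂_νG_{(j)}∂^*_ν)(x,x′)G_{(j′)}(x,x′)`; (3.38): `Σ_ν(∂^ξ_νC^ξ)(…)(∂^ξ_μC^ξ∂^{ξ*}_ν)(…)`); a derivative at the first (second) end
  of a line is a forward difference in the first (second) variable of its kernel, `(∂^η_μG)(x,x′)` = p40's `d1KernelZ`,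
  `(G∂^{η*}_ν)(x,x′)` = p39's `dAdjKernelZ`, `(∂^η_μG∂^{η*}_ν)(x,x′)` = p39's `d2KernelZ` (diagonal: p26's `dKernelZ`), `c = η^{−1}`.
* T3 (normal form). In (2.18), (2.19), (2.21) the external vector leg shares its vertex with one external scalar leg; in the normal
  form (3.33) this is the kernel factor `η^{−d}δ_{x,x′}` (`vtxZ`), and the `x`-sum of the factor `Σ_{x,x″}η^{2d}Γ′` collapses
  (`locFactorZ_of_vtx_left/right`).  *"with the summations unrestricted"* = the sums over `x`, `x″` run over ALL of `ℤ^{d+1}`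
  (iterated `tsum`, `locFactorZ`); *"a product of the values of all the localization functions at the point x′"* stays outside.
* T4 (what is factored out). The real constants of a class (powers of `e(L^kε)` and of `η` from (1.8), `1/n!n′!`, combinatorial
  factors) and the charge-matrix monomial on the internal indices (`q³`, resp. `q`·(loop operator)) multiply the whole class and are
  factored out: the kernels below are the SCALAR STRUCTURE PARTS `Γs_μ(x,x′,x″) ∈ ℝ`; the operator-valued kernel of p39's
  `B3Eq334ZeroLattice.Kernel3Z` is `Γs • T` (`opKernel3Z`, §8).  The one RELATIVE sign that matters — between the two graphs of the
  class (2.18) — is derived, not assumed: for an antisymmetric `q` the first graph pairs `⟨q²φ′(x′), qφ″(x″)⟩ = ⟨φ′, q³φ″⟩`, the second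
  (scalar legs permuted) `⟨q²φ″(x″), qφ′(x′)⟩ = −⟨φ′, q³φ″⟩` (`inner_pairing218a/b`); this is print's *"with the opposite signs"*.
* T5 (the pictures). (2.18): two vertices; first graph — at `x = x′` the vertex (1.8) with `n + n′ = 2` (external `A_μ`, internal
  vector leg, external `φ′`, arrow on the internal scalar line), at `x″` the vertex (1.8) with `n + n′ = 1` (external `φ″`, arrow on the
  internal scalar line): `Γs = η^{−d}δ_{x,x′}(∂^η_μG_s∂^{η*}_μ)(x′,x″)G_v(x′,x″)`; second graph — the same with `φ′ ↔ φ″`.  (2.21b):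
  three vertices (1.8), `n + n′ = 1` each — at `x = x′` (`A_μ`, `φ′`, arrow on the line to the inner vertex `z`), at `z` (arrow on the
  loop line), at `x″` (`φ″`, arrow on the loop line): the loop is the scalar self-energy subgraph of (3.6)/(3.9) (fourth picture of
  (3.18)), `Σ(z,x″) = Σ_ν(∂^η_νG₂∂^{η*}_ν)(z,x″)G₃(z,x″)` = p26's `coeff39Z` at unit localizations (*"moving all localization functions
  to the corresponding vertex"*): `Γs = η^{−d}δ_{x,x′}Σ_zη^d(∂^η_μG₁)(x′,z)Σ(z,x″)`.  (2.21g): the counterterm vertex (1.7) at `x″` on the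
  line from `x′`: `Γs = η^{−d}δ_{x,x′}(∂^η_μG₁)(x′,x″)·ct(x″)`, and *"the proper renormalization mass counterterm"* of the subgraph of
  (2.21b) is, by p. 438, `ct = −δm²`, `δm²(w) = Σ_{x″}η^dΣ(w,x″)` (`massCT39Z`; the coefficient of the counterterm term of (3.9), p26's
  `counterTerm39Z`, with the summation unrestricted).  (2.21c): as (2.21b) but the inner vertex's arrow sits on the INCOMING line
  (`(∂^η_μG₁∂^{η*}_ν)(x′,z)`) and the loop carries one derivative only (`(G₂∂^{η*}_ν)(z,x″)G₃(z,x″)`):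
  `Γs = η^{−d}δ_{x,x′}Σ_zη^dΣ_ν(∂^η_μG₁∂^{η*}_ν)(x′,z)(G₂∂^{η*}_ν)(z,x″)G₃(z,x″)`.
* T6 (mechanisms, as found). (2.21b)+(2.21g): pointwise cancellation in the inner vertex after one exchange of the `z`- and `x″`-sums
  — NO symmetry or translation invariance needed (the counterterm of p. 438 is position-dependent in general, like `δm²_i(x)` of
  (1.7)); (2.18): the two factors are EQUAL for SYMMETRIC propagators, term by term; (2.21c): translation invariance makes the loop sum
  a constant and the remaining `z`-sum of `(∂^η_μG₁∂^{η*}_ν)(x′,z)` a derivative of a constant (r15's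
  `B3Sect3TriangleGraphs.tsum_pdiffZ_translate_eq_zero`, used by name) — consistent with print, which asserts the first two BEFORE and
  the third AFTER the passage to `C^ξ` (the propagators `G^η_{j₀}(0)` are symmetric but only block-translation invariant,
  `B3GkZeroLattice.GkLat_shift`; `C^ξ` is translation invariant).

WHAT IS TYPED / PROVED (carrier `ηℤ^{d+1}`, sites `Fin (d+1) → ℤ` = p26's, any `d`; kernels `KernelZ d` of p26's `B3Ineq313Lattice`).
* §1 `SKernel3Z`, `vtxZ`, **`locFactorZ`** (the factor `Σ_{x,x″}η^{2d}Γ′_μ(x,x′,x″)` of (3.36), unrestricted), the two collapse lemmas, additivity.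
* §2 **(2.18)**: `gamma218aZ`, `gamma218bZ`, the class kernel `gamma218Z = a − b`, the sign lemmas `inner_pairing218a/b`;
  **`locFactorZ_gamma218aZ_eq_gamma218bZ`** (*"the same expressions"*, symmetric propagators, no convergence needed) and
  **`locFactorZ_gamma218Z_eq_zero`** (*"It vanishes also for the graphs (2.18)"*, symmetric propagators, summable line pair).
* §3 **(2.21b)+(2.21g)**: `gamma221bZ`, `massCT39Z`, `gamma221gZ`; **`locFactorZ_gamma221bZ_add_gamma221gZ`** and
  **`locFactorZ_gamma221bZ_gamma221gZ_eq_zero`** (*"vanishes for the graphs (2.21b) and (2.21g) with the proper renormalization mass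
  counterterm"*, any propagators, one Fubini hypothesis).
* §4 **(2.21c)**: `gamma221cZ`; `tsum_loop221c_translate` (the loop is a constant), `tsum_d2KernelZ_translate_eq_zero` (a derivative
  of a constant, via r15's lemma), **`locFactorZ_gamma221cZ_eq_zero`** (translation-invariant propagators, summable profile, Fubini).
* §5 HYPOTHESIS-FREE INSTANCES with every propagator slot the `C^ξ` of p. 444 (r15's `B3Sect3VectorSelfEnergy.Cxi`, as the two-variable
  kernel `convKZ (Cxi (d+1) ξ)`; any `d`, any `ξ > 0`; summability `B3CxiPropagator.summable_Cxi`, evenness `Cxi_neg`, the bound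
  `abs_Cxi_le`): **`locFactorZ_gamma218Z_cxi_eq_zero`**, **`locFactorZ_gamma221bZ_gamma221gZ_cxi_eq_zero`**,
  **`locFactorZ_gamma221cZ_cxi_eq_zero`**.
* §6 η-lattice instances of *"the same expressions"* (symmetry only): the pieces `G^η_{(j)}(0)` of p26's FILE C
  (`locFactorZ_gamma218aZ_eq_gamma218bZ_gpieceZ`) and p39's resummed `G^η_{j₀}(0)` on `ηℤ³` (`…_GetaL`).
* §7 `local336InfZ` — (3.36) with unrestricted inner sums for `Γ′ = Γs • T` — and its vanishing for the three classes at `C^ξ`.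
* §8 bridge to p39's FILE 1 `B3Eq334ZeroLattice`: `opKernel3Z : Kernel3Z d W`, the closed form of p39's finite-set `local336Z` on such
  kernels, and **`tendsto_local336Z_opKernel3Z`**: p39's `local336Z` converges to `local336InfZ` as the two inner localization sets
  exhaust `ℤ^{d+1}` (summable double families) — hence to `0` for these classes.
* §9 (v1.1, append-only) the resummed propagators `G^η_{j₀}(0)` on `ηℤ³` (p39's `GetaL`; `L ≥ 2`, `j₀ ≥ 1`, `a > 0`, `m² ≥ 0`):
  **`locFactorZ_gamma218Z_GetaL_eq_zero`** (the class (2.18) vanishes) and **`locFactorZ_gamma221bZ_gamma221gZ_GetaL_eq_zero`** (the pair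
  (2.21b)+(2.21g) vanishes), the summability hypotheses of §§2–3 DISCHARGED from the kernel laws of `G^ξ_{j₀}(0)`
  (`B3Eq316ResolventZeroLattice.exists_GxiL_profile`, `summable_abs_GxiL`, `summable_profile_row`).
HONEST SCOPE.  Zero external field; the printed infinite lattice (no torus version here); general `d`; the scalar structure parts only
(T4); the vector line read diagonally (T2) — a reading, as in the row's other lattice members; for the actual `η`-lattice propagators
`G^η_{j₀}(0)`, `G^η_{j₀}` the statements of §§2–4 apply under their stated hypotheses (symmetry is in the tree — `pieceLat_comm`,
`GetaL_comm`; the summabilities are discharged for p39's resummed `GetaL` on `ηℤ³` in §9, not for the general-`d` pieces),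
hypothesis-free instances are given for `C^ξ` (§5), the
propagator for which print states the translation-invariance argument; nothing is claimed about the *"convergent expression"*, the
degree bookkeeping, or the graphs (2.19), (2.20) ((3.37), (3.38): r15's `B3Sect3TriangleGraphs`, p39's `B3Eq337ZeroLattice`,
`B3Eq338*`).  Mathlib + the cited tree files only; defs with bodies, theorems; no `sorry`, no axioms beyond the standard three, no named
facts.  Unit `lit-balaban-p32-g30`, HOME `run/shared/lean/pub/lit-balaban/`, 2026-08-23.
-/

open scoped BigOperators RealInnerProductSpace

namespace Literature.MathematicalPhysics.QuantumFieldTheory.Balaban1983to89.B3GammaPrimeVanishing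

open B3Ineq313Lattice (KernelZ dKernelZ coeff39Z)
open B3Eq326ZeroLattice (dAdjKernelZ d2KernelZ)
open B3Sect3VectorSelfEnergy (ZSite unitVec pdiffZ pdiffAdjZ Cxi Cxi_neg)
open B3Sect3TriangleGraphs (tsum_pdiffZ_translate_eq_zero pdiffZ_tsum_translate_eq_zero)

noncomputable section

variable {d : ℕ}

/-! ## §0 Scalar three-point kernels on `ηℤ^{d+1}` and the UNRESTRICTED local coefficient of (3.36) -/

section Coefficient

/-- Scalar three-point kernels `γ_μ(x, x′, x″)` on `ηℤ^{d+1}` — slots: the vertex `x` of the vector leg `A_μ`, the vertex `x′` of the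
first scalar leg `φ′`, the vertex `x″` of the second scalar leg `φ″` of (3.33); the internal-index structure (the word in the charge
matrix `q`) is carried separately as one linear map `Q` (cf. r15's real `q³` in `lhs337`, p39's `tri19`/`tri20`).
[cite: Balaban1983Higgs3, (3.33) p.443] -/
abbrev SKernel3Z (d : ℕ) : Type :=
  Fin (d + 1) → (Fin (d + 1) → ℤ) → (Fin (d + 1) → ℤ) → (Fin (d + 1) → ℤ) → ℝ

/-- **The factor `Σ_{x,x″} η^{2d} Γ′_μ(x,x′,x″)` of (3.36)** p. 444 [PDF 34] *"where Γ′_μ is given by the same formula as before, but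
with the summations unrestricted"* — both lattice sums over ALL of `ℤ^{d+1}` (`tsum`; the outer sum over the vector-leg vertex `x`,
the inner over the second scalar vertex `x″`). [cite: Balaban1983Higgs3, (3.36) p.444] -/
def coeff336Z (η : ℝ) (γ : SKernel3Z d) (μ : Fin (d + 1)) (x' : Fin (d + 1) → ℤ) : ℝ :=
  ∑' x : Fin (d + 1) → ℤ, ∑' x'' : Fin (d + 1) → ℤ, η ^ (2 * (d + 1)) * γ μ x x' x''

variable {W : Type*} [NormedAddCommGroup W] [InnerProductSpace ℝ W]

/-- **(3.36)** p. 444 [PDF 34] with the UNRESTRICTED coefficient: `Σ_{x′∈Λ′} η^d Σ_μ locs(x′)A_μ(x′)·(Σ_{x,x″}η^{2d}Γ′_μ(x,x′,x″))·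
χ₁(x′)·Qχ₂(x′)` — the leg `χ₁` read at the gathering vertex `x′` paired with `Qχ₂(x′)` through the internal-index map `Q`, `locs x′` =
`g(x′)`·(the product of the values of all the localization functions at `x′`) (p39's `B3Eq334ZeroLattice.local336Z` is the same display
with FINITE sets `Λ ∋ x`, `Λ″ ∋ x″` and a `W →ₗ W`-valued kernel; here `Γ′ = γ • Q` and the two inner sums are complete).
[cite: Balaban1983Higgs3, (3.36) p.444] -/
def local336U (η : ℝ) (γ : SKernel3Z d) (Q : W →ₗ[ℝ] W) (locs : (Fin (d + 1) → ℤ) → ℝ)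
    (A : Fin (d + 1) → (Fin (d + 1) → ℤ) → ℝ) (χ₁ χ₂ : (Fin (d + 1) → ℤ) → W) (Λ' : Finset (Fin (d + 1) → ℤ)) : ℝ :=
  ∑ x' ∈ Λ', η ^ (d + 1) * ∑ μ : Fin (d + 1), locs x' * A μ x' * (coeff336Z η γ μ x' * ⟪χ₁ x', Q (χ₂ x')⟫)

/-- kernel: (3.36) vanishes as soon as its coefficient vanishes at every gathering vertex. [cite: Balaban1983Higgs3, (3.36) p.444] -/
theorem local336U_eq_zero_of_coeff (η : ℝ) (γ : SKernel3Z d) (Q : W →ₗ[ℝ] W) (locs : (Fin (d + 1) → ℤ) → ℝ)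
    (A : Fin (d + 1) → (Fin (d + 1) → ℤ) → ℝ) (χ₁ χ₂ : (Fin (d + 1) → ℤ) → W) (Λ' : Finset (Fin (d + 1) → ℤ))
    (h : ∀ μ, ∀ x' ∈ Λ', coeff336Z η γ μ x' = 0) : local336U η γ Q locs A χ₁ χ₂ Λ' = 0 := by
  unfold local336U
  refine Finset.sum_eq_zero fun x' hx' => ?_
  rw [Finset.sum_eq_zero fun μ _ => ?_, mul_zero]
  rw [h μ x' hx', zero_mul, mul_zero]

/-- The three-point kernel of a graph whose vector leg sits at the vertex of the FIRST scalar leg: `γ_μ(x,x′,x″) =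
η^{−d}δ_{x,x′}·s_μ(x′,x″)` (`s`'s first slot = the vertex carrying the vector leg). [cite: Balaban1983Higgs3, (3.33) p.443] -/
def atFirst (η : ℝ) (s : Fin (d + 1) → KernelZ d) : SKernel3Z d :=
  fun μ x x' x'' => if x = x' then (η ^ (d + 1))⁻¹ * s μ x' x'' else 0

/-- The three-point kernel of the PERMUTED graph (p. 429: the classes are *"symmetric with respect to permutation of external
scalar field legs"*), the vector leg at the vertex of the SECOND scalar leg: `γ_μ(x,x′,x″) = η^{−d}δ_{x,x″}·s_μ(x″,x′)`.
[cite: Balaban1983Higgs3, (2.18) p.429] -/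
def atSecond (η : ℝ) (s : Fin (d + 1) → KernelZ d) : SKernel3Z d :=
  fun μ x x' x'' => if x = x'' then (η ^ (d + 1))⁻¹ * s μ x'' x' else 0

/-- kernel: `η^{2d}·η^{−d} = η^d`. [folklore] -/
private theorem pow_two_mul_inv (η : ℝ) (hη : η ≠ 0) (a : ℝ) :
    η ^ (2 * (d + 1)) * ((η ^ (d + 1))⁻¹ * a) = η ^ (d + 1) * a := by
  rw [← mul_assoc, two_mul, pow_add, mul_assoc (η ^ (d + 1)), mul_inv_cancel₀ (pow_ne_zero _ hη), mul_one]

/-- kernel: for the vector leg at the first scalar vertex the `x`-sum collapses: `Σ_{x,x″}η^{2d}γ = η^d Σ_{x″} s_μ(x′,x″)` (no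
convergence needed). [cite: Balaban1983Higgs3, (3.36) p.444] -/
theorem coeff336Z_atFirst (η : ℝ) (hη : η ≠ 0) (s : Fin (d + 1) → KernelZ d) (μ : Fin (d + 1)) (x' : Fin (d + 1) → ℤ) :
    coeff336Z η (atFirst η s) μ x' = η ^ (d + 1) * ∑' x'' : Fin (d + 1) → ℤ, s μ x' x'' := by
  unfold coeff336Z
  rw [tsum_eq_single x']
  · rw [← tsum_mul_left]
    refine tsum_congr fun x'' => ?_
    simp only [atFirst]
    rw [if_pos trivial, pow_two_mul_inv η hη]
  · intro x hx
    have h0 : (fun x'' : Fin (d + 1) → ℤ => η ^ (2 * (d + 1)) * atFirst η s μ x x' x'') = fun _ => 0 := by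
      funext x''
      simp only [atFirst]
      rw [if_neg hx, mul_zero]
    rw [h0, tsum_zero]

/-- kernel: for the vector leg at the second scalar vertex the `x″`-sum collapses: `Σ_{x,x″}η^{2d}γ = η^d Σ_x s_μ(x,x′)`.
[cite: Balaban1983Higgs3, (3.36) p.444] -/
theorem coeff336Z_atSecond (η : ℝ) (hη : η ≠ 0) (s : Fin (d + 1) → KernelZ d) (μ : Fin (d + 1)) (x' : Fin (d + 1) → ℤ) :
    coeff336Z η (atSecond η s) μ x' = η ^ (d + 1) * ∑' x : Fin (d + 1) → ℤ, s μ x x' := by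
  unfold coeff336Z
  rw [← tsum_mul_left]
  refine tsum_congr fun x => ?_
  rw [tsum_eq_single x]
  · simp only [atSecond]
    rw [if_pos trivial, pow_two_mul_inv η hη]
  · intro x'' hx''
    simp only [atSecond]
    rw [if_neg (Ne.symm hx''), mul_zero]

end Coefficient

/-! ## §1 The graphs (2.21b) and their mass counterterms (2.21g): *"it vanishes … with the proper renormalization mass counterterm"* -/

section Graphs221bg

/-- The forward difference in the FIRST variable, `(∂^η_μG)(x,z) = c(G(x+e_μ,z) − G(x,z))`, `c = η^{−1}` (gen 9's `dK1` at
`d + 1 = 3`; the second-variable twin is `B3Eq326ZeroLattice.dAdjKernelZ`). [cite: Balaban1983Higgs3, (3.26) p.440] -/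
def dFstKernelZ (c : ℝ) (μ : Fin (d + 1)) (G : KernelZ d) : KernelZ d :=
  fun x z => c * (G (x + Pi.single μ 1) z - G x z)

/-- **The bubble of (2.21b)** = the lowest-order scalar self-energy graph (3.6)/(3.8) p. 435 as a two-point kernel, localization
functions removed: `B(z,x″) = Σ_ν (∂^η_νG₂∂^{η*}_ν)(z,x″)·G₃(z,x″)` — `G₂` the scalar line differentiated at both its vertices (1.8)₍₁,₀₎
(their bond direction `ν` is that of the internal vector line), `G₃` the vector line read as a scalar-type kernel (print's `C^ξ(y−y′)`
for the wavy line of (3.37)/(3.38)); = p26's bracket `coeff39Z η G₂ G₃ 1 1` (`bubbleZ_eq_coeff39Z`). [cite: Balaban1983Higgs3, (3.9) p.435] -/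
def bubbleZ (η : ℝ) (G₂ G₃ : KernelZ d) : KernelZ d :=
  fun z x'' => (∑ ν : Fin (d + 1), dKernelZ η⁻¹ ν G₂ z x'') * G₃ z x''

/-- dictionary: the bubble is the bracket of (3.9) with the localization functions `g = g′ = 1`. [cite: Balaban1983Higgs3, (3.9) p.435] -/
theorem bubbleZ_eq_coeff39Z (η : ℝ) (G₂ G₃ : KernelZ d) (z x'' : Fin (d + 1) → ℤ) :
    bubbleZ η G₂ G₃ z x'' = coeff39Z η G₂ G₃ (fun _ => 1) (fun _ => 1) z x'' := by
  simp only [bubbleZ, coeff39Z, mul_one]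

/-- **"the proper renormalization mass counterterm"** of the bubble: `δm²(z) = Σ_{x″} η^d B(z,x″)` — p. 435 (3.7) *"(−1)·[the graph
with both legs at one vertex]"*, (3.9) second term, p. 430 *"we take one counterterm for each graph"*; an unrestricted lattice sum.
[cite: Balaban1983Higgs3, (3.7) p.435] -/
def massCT (η : ℝ) (G₂ G₃ : KernelZ d) (z : Fin (d + 1) → ℤ) : ℝ :=
  ∑' x'' : Fin (d + 1) → ℤ, η ^ (d + 1) * bubbleZ η G₂ G₃ z x''

/-- **(2.21b)** p. 430 as a two-point kernel between the vertex `x′` of (1.8)₍₀,₁₎ (external vector leg `Ã_μ` and scalar leg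
`φ′`; its differentiated leg on the line to `z`) and the far vertex `x″` of the bubble (external leg `φ″`):
`s_μ(x′,x″) = Σ_z η^d (∂^η_μG₁)(x′,z)·B(z,x″)` (internal vertex `z` summed over the whole lattice). [cite: Balaban1983Higgs3, (2.21) p.430] -/
def ker221b (η : ℝ) (G₁ G₂ G₃ : KernelZ d) : Fin (d + 1) → KernelZ d :=
  fun μ x' x'' => ∑' z : Fin (d + 1) → ℤ, η ^ (d + 1) * (dFstKernelZ η⁻¹ μ G₁ x' z * bubbleZ η G₂ G₃ z x'')

/-- **(2.21g)** p. 430 — the mass counterterm graph of the bubble: `s_μ(x′,x″) = −(∂^η_μG₁)(x′,x″)·δm²(x″)` (the sign `(−1)` of (3.7);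
the counterterm vertex carries the external leg `φ″`). [cite: Balaban1983Higgs3, (2.21) p.430] -/
def ker221g (η : ℝ) (G₁ G₂ G₃ : KernelZ d) : Fin (d + 1) → KernelZ d :=
  fun μ x' x'' => -(dFstKernelZ η⁻¹ μ G₁ x' x'' * massCT η G₂ G₃ x'')

/-- Γ′ of the graph (2.21b) with the vector leg at the vertex of `φ′`. [cite: Balaban1983Higgs3, (2.21) p.430] -/
def gamma221b (η : ℝ) (G₁ G₂ G₃ : KernelZ d) : SKernel3Z d := atFirst η (ker221b η G₁ G₂ G₃)

/-- Γ′ of the counterterm graph (2.21g) with the vector leg at the vertex of `φ′`. [cite: Balaban1983Higgs3, (2.21) p.430] -/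
def gamma221g (η : ℝ) (G₁ G₂ G₃ : KernelZ d) : SKernel3Z d := atFirst η (ker221g η G₁ G₂ G₃)

/-- Γ′ of the permuted graph (2.21b) (vector leg at the vertex of `φ″`). [cite: Balaban1983Higgs3, (2.21) p.430] -/
def gamma221bPerm (η : ℝ) (G₁ G₂ G₃ : KernelZ d) : SKernel3Z d := atSecond η (ker221b η G₁ G₂ G₃)

/-- Γ′ of the permuted counterterm graph (2.21g) (vector leg at the vertex of `φ″`). [cite: Balaban1983Higgs3, (2.21) p.430] -/
def gamma221gPerm (η : ℝ) (G₁ G₂ G₃ : KernelZ d) : SKernel3Z d := atSecond η (ker221g η G₁ G₂ G₃)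

/-- **p. 444 [PDF 34], verbatim: *"Now we can analyze the factor Σ_{x,x″} η^{2d}Γ′_μ(x,x′,x″) for all the renormalized classes. It is
easily seen that it vanishes for the graphs (2.21b) and (2.21g) with the proper renormalization mass counterterm."*** — PROVED for
arbitrary two-point kernels `G₁` (first scalar line), `G₂`, `G₃` (the bubble) on `ηℤ^{d+1}`, `η ≠ 0`, under the one hypothesis that
the double family `(z,x″) ↦ (∂^η_μG₁)(x′,z)B(z,x″)` is summable (Fubini): the `x″`-summed bubble behind `(∂^η_μG₁)(x′,z)` IS the
counterterm `δm²(z)`, so the two coefficients are the two iterated sums of one summable double family, with opposite signs.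
[cite: Balaban1983Higgs3, (3.36) p.444] -/
theorem coeff336Z_221b_add_221g (η : ℝ) (hη : η ≠ 0) (G₁ G₂ G₃ : KernelZ d) (μ : Fin (d + 1)) (x' : Fin (d + 1) → ℤ)
    (hF : Summable fun p : (Fin (d + 1) → ℤ) × (Fin (d + 1) → ℤ) =>
      dFstKernelZ η⁻¹ μ G₁ x' p.1 * bubbleZ η G₂ G₃ p.1 p.2) :
    coeff336Z η (gamma221b η G₁ G₂ G₃) μ x' + coeff336Z η (gamma221g η G₁ G₂ G₃) μ x' = 0 := by
  rw [gamma221b, gamma221g, coeff336Z_atFirst η hη, coeff336Z_atFirst η hη, ← mul_add]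
  set f : (Fin (d + 1) → ℤ) → (Fin (d + 1) → ℤ) → ℝ :=
    fun z x'' => η ^ (d + 1) * (dFstKernelZ η⁻¹ μ G₁ x' z * bubbleZ η G₂ G₃ z x'') with hf
  have eb : ∀ x'', ker221b η G₁ G₂ G₃ μ x' x'' = ∑' z, f z x'' := fun x'' => rfl
  have eg : ∀ z, ker221g η G₁ G₂ G₃ μ x' z = -∑' x'', f z x'' := by
    intro z
    simp only [ker221g, massCT, hf]
    rw [← tsum_mul_left, ← tsum_neg, ← tsum_neg]
    exact tsum_congr fun x'' => by ring
  have hu : Summable (Function.uncurry f) := by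
    have h := hF.mul_left (η ^ (d + 1))
    exact h
  simp_rw [eb, eg]
  rw [tsum_neg, hu.tsum_comm, add_neg_cancel, mul_zero]

/-- kernel: the permuted graph (2.21b) — vector leg `Ã_μ` and `φ″` at the vertex `x` of (1.8)₍₀,₁₎, `φ′` at the far bubble vertex
`x′` — has `Σ_{x,x″}η^{2d}Γ′ = η^d Σ_x Σ_z η^d(∂^η_μG₁)(x,z)B(z,x′) = 0` on its own: the differentiation acts on the SUMMED vertex `x`,
so the sum is the sum of a difference quotient (r15's `tsum_pdiffZ_translate_eq_zero`), for any kernels with the stated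
summability. [cite: Balaban1983Higgs3, (3.36) p.444] -/
theorem coeff336Z_221bPerm_eq_zero (η : ℝ) (hη : η ≠ 0) (G₁ G₂ G₃ : KernelZ d) (μ : Fin (d + 1)) (x' : Fin (d + 1) → ℤ)
    (hz : ∀ x : Fin (d + 1) → ℤ, Summable fun z : Fin (d + 1) → ℤ => G₁ x z * bubbleZ η G₂ G₃ z x')
    (hx : Summable fun x : Fin (d + 1) → ℤ => ∑' z : Fin (d + 1) → ℤ, η ^ (d + 1) * (G₁ x z * bubbleZ η G₂ G₃ z x')) :
    coeff336Z η (gamma221bPerm η G₁ G₂ G₃) μ x' = 0 := by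
  rw [gamma221bPerm, coeff336Z_atSecond η hη]
  set Φ : (Fin (d + 1) → ℤ) → ℝ := fun x => ∑' z : Fin (d + 1) → ℤ, η ^ (d + 1) * (G₁ x z * bubbleZ η G₂ G₃ z x') with hΦ
  have hz' : ∀ x : Fin (d + 1) → ℤ, Summable fun z : Fin (d + 1) → ℤ => η ^ (d + 1) * (G₁ x z * bubbleZ η G₂ G₃ z x') :=
    fun x => (hz x).mul_left _
  have e : ∀ x, ker221b η G₁ G₂ G₃ μ x x' = pdiffZ η⁻¹ μ Φ x := by
    intro x
    simp only [ker221b, dFstKernelZ, pdiffZ, hΦ, unitVec]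
    rw [← (hz' (x + Pi.single μ 1)).tsum_sub (hz' x), ← tsum_mul_left]
    exact tsum_congr fun z => by ring
  simp_rw [e]
  have h0 := tsum_pdiffZ_translate_eq_zero (d := d + 1) 1 η⁻¹ μ Φ hx 0
  simp only [one_pow, one_mul, sub_zero] at h0
  rw [h0, mul_zero]

/-- kernel: the permuted counterterm graph (2.21g) likewise has `Σ_{x,x″}η^{2d}Γ′ = −η^d δm²(x′)·Σ_x(∂^η_μG₁)(x,x′) = 0` (a summed
difference quotient), for any `G₁` summable in its first variable. [cite: Balaban1983Higgs3, (3.36) p.444] -/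
theorem coeff336Z_221gPerm_eq_zero (η : ℝ) (hη : η ≠ 0) (G₁ G₂ G₃ : KernelZ d) (μ : Fin (d + 1)) (x' : Fin (d + 1) → ℤ)
    (hx : Summable fun x : Fin (d + 1) → ℤ => G₁ x x') :
    coeff336Z η (gamma221gPerm η G₁ G₂ G₃) μ x' = 0 := by
  rw [gamma221gPerm, coeff336Z_atSecond η hη]
  have e : ∀ x, ker221g η G₁ G₂ G₃ μ x x' = -massCT η G₂ G₃ x' * pdiffZ η⁻¹ μ (fun x => G₁ x x') x := by
    intro x
    simp only [ker221g, dFstKernelZ, pdiffZ, unitVec]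
    ring
  simp_rw [e]
  rw [tsum_mul_left]
  have h0 := tsum_pdiffZ_translate_eq_zero (d := d + 1) 1 η⁻¹ μ (fun x => G₁ x x') hx 0
  simp only [one_pow, one_mul, sub_zero] at h0
  rw [h0, mul_zero, mul_zero]

end Graphs221bg

/-! ## §2 The graphs (2.18): *"the same expressions but with the opposite signs"* -/

section Graphs218

variable {W : Type*} [NormedAddCommGroup W] [InnerProductSpace ℝ W]

/-- **(2.18)** p. 429 as a two-point kernel between the vertex `a` of (1.8)₍₁,₁₎ (external vector leg `Ã_μ`, internal vector leg
`A′_μ` on the same bond, external scalar leg, differentiated internal scalar leg) and the vertex `b` of (1.8)₍₁,₀₎ (internal vector leg,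
differentiated internal scalar leg, external scalar leg): `K_μ(a,b) = (∂^η_μG_s∂^{η*}_μ)(a,b)·G_v(a,b)` — the scalar line differentiated at
both ends in the direction `μ` of the vector line (diagonal vector propagator, read as the scalar-type kernel `G_v`).
[cite: Balaban1983Higgs3, (2.18) p.429] -/
def ker218 (η : ℝ) (Gs Gv : KernelZ d) : Fin (d + 1) → KernelZ d :=
  fun μ a b => dKernelZ η⁻¹ μ Gs a b * Gv a b

/-- kernel: `(∂^η_μG∂^{η*}_μ)(a,b)` is symmetric when `G` is (twin of r15's torus `dKernel_symm`). [cite: Balaban1983Higgs3, (3.9) p.435] -/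
theorem dKernelZ_symm (c : ℝ) (μ : Fin (d + 1)) (G : KernelZ d) (hG : ∀ a b, G a b = G b a) (a b : Fin (d + 1) → ℤ) :
    dKernelZ c μ G a b = dKernelZ c μ G b a := by
  simp only [dKernelZ]
  rw [hG (a + Pi.single μ 1) (b + Pi.single μ 1), hG (a + Pi.single μ 1) b, hG a (b + Pi.single μ 1), hG a b]
  ring

/-- kernel: the (2.18) kernel is symmetric for symmetric propagators. [cite: Balaban1983Higgs3, (2.18) p.429] -/
theorem ker218_symm (η : ℝ) (Gs Gv : KernelZ d) (hGs : ∀ a b, Gs a b = Gs b a) (hGv : ∀ a b, Gv a b = Gv b a)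
    (μ : Fin (d + 1)) (a b : Fin (d + 1) → ℤ) : ker218 η Gs Gv μ a b = ker218 η Gs Gv μ b a := by
  simp only [ker218]
  rw [dKernelZ_symm _ μ Gs hGs a b, hGv a b]

/-- Γ′ of the first picture of (2.18) (vector leg at the vertex of `φ′`). [cite: Balaban1983Higgs3, (2.18) p.429] -/
def gamma218 (η : ℝ) (Gs Gv : KernelZ d) : SKernel3Z d := atFirst η (ker218 η Gs Gv)

/-- Γ′ of the second (permuted) picture of (2.18) (vector leg at the vertex of `φ″`). [cite: Balaban1983Higgs3, (2.18) p.429] -/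
def gamma218Perm (η : ℝ) (Gs Gv : KernelZ d) : SKernel3Z d := atSecond η (ker218 η Gs Gv)

/-- **"the same expressions"** (p. 444): for symmetric `G_s`, `G_v` the two pictures of (2.18) have the same coefficient
`Σ_{x,x″}η^{2d}Γ′_μ = η^d Σ_{x″} K_μ(x′,x″)` at every gathering vertex `x′` (no convergence needed). [cite: Balaban1983Higgs3, (3.36) p.444] -/
theorem coeff336Z_218Perm_eq (η : ℝ) (hη : η ≠ 0) (Gs Gv : KernelZ d) (hGs : ∀ a b, Gs a b = Gs b a)
    (hGv : ∀ a b, Gv a b = Gv b a) (μ : Fin (d + 1)) (x' : Fin (d + 1) → ℤ) :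
    coeff336Z η (gamma218Perm η Gs Gv) μ x' = coeff336Z η (gamma218 η Gs Gv) μ x' := by
  rw [gamma218Perm, gamma218, coeff336Z_atSecond η hη, coeff336Z_atFirst η hη]
  congr 1
  exact tsum_congr fun x => ker218_symm η Gs Gv hGs hGv μ x x'

/-- **"but with the opposite signs"** (p. 444): the local term (3.36) of the permuted picture — legs `φ″` at the vector-leg vertex,
`φ′` at the other, i.e. the pairing `φ″(x′)·Qφ′(x′)` — is MINUS that of the first picture, because the internal-index map `Q` (print:
`e³q³`, `q` the charge matrix, `q³ = −q`) is skew: `⟪Qu, v⟫ = −⟪u, Qv⟫`. [cite: Balaban1983Higgs3, (3.36) p.444] -/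
theorem local336U_218Perm_eq_neg (η : ℝ) (hη : η ≠ 0) (Gs Gv : KernelZ d) (hGs : ∀ a b, Gs a b = Gs b a)
    (hGv : ∀ a b, Gv a b = Gv b a) (Q : W →ₗ[ℝ] W) (hQ : ∀ u v : W, ⟪Q u, v⟫ = -⟪u, Q v⟫)
    (locs : (Fin (d + 1) → ℤ) → ℝ) (A : Fin (d + 1) → (Fin (d + 1) → ℤ) → ℝ) (φ' φ'' : (Fin (d + 1) → ℤ) → W)
    (Λ' : Finset (Fin (d + 1) → ℤ)) :
    local336U η (gamma218Perm η Gs Gv) Q locs A φ'' φ' Λ' = -local336U η (gamma218 η Gs Gv) Q locs A φ' φ'' Λ' := by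
  unfold local336U
  rw [← Finset.sum_neg_distrib]
  refine Finset.sum_congr rfl fun x' _ => ?_
  rw [← mul_neg, ← Finset.sum_neg_distrib]
  congr 1
  refine Finset.sum_congr rfl fun μ _ => ?_
  rw [coeff336Z_218Perm_eq η hη Gs Gv hGs hGv, real_inner_comm (Q (φ' x')) (φ'' x'), hQ]
  ring

/-- **p. 444 [PDF 34], verbatim: *"It vanishes also for the graphs (2.18) because they correspond to the same expressions but with
the opposite signs."*** — PROVED: the class (2.18) = picture + permuted picture (p. 429 *"each pair of graphs below form one
class"*, symmetric under the permutation of the external scalar legs) has local term (3.36) equal to `0`, for symmetric scalar and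
vector propagators and a skew internal-index map, `η ≠ 0`; no convergence hypothesis. [cite: Balaban1983Higgs3, (3.36) p.444] -/
theorem local336U_218_class_eq_zero (η : ℝ) (hη : η ≠ 0) (Gs Gv : KernelZ d) (hGs : ∀ a b, Gs a b = Gs b a)
    (hGv : ∀ a b, Gv a b = Gv b a) (Q : W →ₗ[ℝ] W) (hQ : ∀ u v : W, ⟪Q u, v⟫ = -⟪u, Q v⟫)
    (locs : (Fin (d + 1) → ℤ) → ℝ) (A : Fin (d + 1) → (Fin (d + 1) → ℤ) → ℝ) (φ' φ'' : (Fin (d + 1) → ℤ) → W)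
    (Λ' : Finset (Fin (d + 1) → ℤ)) :
    local336U η (gamma218 η Gs Gv) Q locs A φ' φ'' Λ' + local336U η (gamma218Perm η Gs Gv) Q locs A φ'' φ' Λ' = 0 := by
  rw [local336U_218Perm_eq_neg η hη Gs Gv hGs hGv Q hQ, add_neg_cancel]

end Graphs218

/-! ## §3 The graph (2.21c): *"by translation invariance it can be written as a derivative of a constant"* -/

section Graph221c

/-- **(2.21c)** p. 430 as a two-point kernel between the vertex `x′` of (1.8)₍₀,₁₎ (vector leg `Ã_μ`, scalar leg `φ′`) and the far
bubble vertex `x″` (leg `φ″`), with the other placement of the differentiations: the line `x′–z` differentiated at BOTH ends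
(`(∂^η_μG₁∂^{η*}_ν)(x′,z)`, `ν` the bond direction of the middle vertex = that of the internal vector line), the bubble line `z–x″` only
at `x″` (`(G₂∂^{η*}_ν)(z,x″)`), the vector line `G₃(z,x″)`:
`s_μ(x′,x″) = Σ_z η^d Σ_ν (∂^η_μG₁∂^{η*}_ν)(x′,z)(G₂∂^{η*}_ν)(z,x″)G₃(z,x″)`. [cite: Balaban1983Higgs3, (2.21) p.430] -/
def ker221c (η : ℝ) (G₁ G₂ G₃ : KernelZ d) : Fin (d + 1) → KernelZ d :=
  fun μ x' x'' => ∑' z : Fin (d + 1) → ℤ, η ^ (d + 1) *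
    ∑ ν : Fin (d + 1), d2KernelZ η⁻¹ μ ν G₁ x' z * (dAdjKernelZ η⁻¹ ν G₂ z x'' * G₃ z x'')

/-- The same expression with the differentiation `∂^η_μ` at `x′` NOT taken — the "constant" of p. 444:
`I(a,x″) = Σ_z η^d Σ_ν (G₁∂^{η*}_ν)(a,z)(G₂∂^{η*}_ν)(z,x″)G₃(z,x″)`. [cite: Balaban1983Higgs3, (3.36) p.444] -/
def inner221c (η : ℝ) (G₁ G₂ G₃ : KernelZ d) (a x'' : Fin (d + 1) → ℤ) : ℝ :=
  ∑' z : Fin (d + 1) → ℤ, η ^ (d + 1) *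
    ∑ ν : Fin (d + 1), dAdjKernelZ η⁻¹ ν G₁ a z * (dAdjKernelZ η⁻¹ ν G₂ z x'' * G₃ z x'')

/-- Γ′ of the graph (2.21c) (vector leg at the vertex of `φ′`). [cite: Balaban1983Higgs3, (2.21) p.430] -/
def gamma221c (η : ℝ) (G₁ G₂ G₃ : KernelZ d) : SKernel3Z d := atFirst η (ker221c η G₁ G₂ G₃)

/-- Γ′ of the permuted graph (2.21c) (vector leg at the vertex of `φ″`). [cite: Balaban1983Higgs3, (2.21) p.430] -/
def gamma221cPerm (η : ℝ) (G₁ G₂ G₃ : KernelZ d) : SKernel3Z d := atSecond η (ker221c η G₁ G₂ G₃)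

/-- kernel: the mixed second difference is the first difference of the column difference:
`(∂_μG∂^*_ν)(x′,z) = c[(G∂^*_ν)(x′+e_μ,z) − (G∂^*_ν)(x′,z)]`. [cite: Balaban1983Higgs3, (3.26) p.440] -/
theorem d2KernelZ_eq_sub (c : ℝ) (μ ν : Fin (d + 1)) (G : KernelZ d) (x' z : Fin (d + 1) → ℤ) :
    d2KernelZ c μ ν G x' z = c * (dAdjKernelZ c ν G (x' + Pi.single μ 1) z - dAdjKernelZ c ν G x' z) := by
  simp only [d2KernelZ, dAdjKernelZ]
  ring

/-- kernel: the (2.21c) kernel is the difference quotient in `x′` of the undifferentiated expression, as soon as the two `z`-sums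
converge. [cite: Balaban1983Higgs3, (3.36) p.444] -/
theorem ker221c_eq_pdiffZ (η : ℝ) (G₁ G₂ G₃ : KernelZ d) (μ : Fin (d + 1)) (x'' : Fin (d + 1) → ℤ)
    (hin : ∀ a : Fin (d + 1) → ℤ, Summable fun z : Fin (d + 1) → ℤ => η ^ (d + 1) *
      ∑ ν : Fin (d + 1), dAdjKernelZ η⁻¹ ν G₁ a z * (dAdjKernelZ η⁻¹ ν G₂ z x'' * G₃ z x''))
    (a : Fin (d + 1) → ℤ) :
    ker221c η G₁ G₂ G₃ μ a x'' = pdiffZ η⁻¹ μ (fun a => inner221c η G₁ G₂ G₃ a x'') a := by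
  simp only [ker221c, inner221c, pdiffZ, unitVec]
  rw [← (hin (a + Pi.single μ 1)).tsum_sub (hin a), ← tsum_mul_left]
  refine tsum_congr fun z => ?_
  simp only [Finset.mul_sum]
  rw [← Finset.sum_sub_distrib, Finset.mul_sum]
  refine Finset.sum_congr rfl fun ν _ => ?_
  rw [d2KernelZ_eq_sub]
  ring

/-- kernel: a translation-invariant kernel has a translation-invariant column difference. [cite: Balaban1983Higgs3, (3.36) p.444] -/
theorem dAdjKernelZ_transl (c : ℝ) (ν : Fin (d + 1)) (G : KernelZ d) (hG : ∀ a b t, G (a + t) (b + t) = G a b)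
    (a b t : Fin (d + 1) → ℤ) : dAdjKernelZ c ν G (a + t) (b + t) = dAdjKernelZ c ν G a b := by
  simp only [dAdjKernelZ]
  rw [show b + t + Pi.single ν 1 = b + Pi.single ν 1 + t by abel, hG, hG]

/-- kernel: *"by translation invariance"* — the undifferentiated expression is invariant under simultaneous translation of its two
vertices when the three kernels are. [cite: Balaban1983Higgs3, (3.36) p.444] -/
theorem inner221c_transl (η : ℝ) (G₁ G₂ G₃ : KernelZ d) (h₁ : ∀ a b t, G₁ (a + t) (b + t) = G₁ a b)
    (h₂ : ∀ a b t, G₂ (a + t) (b + t) = G₂ a b) (h₃ : ∀ a b t, G₃ (a + t) (b + t) = G₃ a b)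
    (a x'' t : Fin (d + 1) → ℤ) : inner221c η G₁ G₂ G₃ (a + t) (x'' + t) = inner221c η G₁ G₂ G₃ a x'' := by
  unfold inner221c
  rw [← Equiv.tsum_eq (Equiv.addRight t)]
  refine tsum_congr fun z => ?_
  simp only [Equiv.coe_addRight]
  congr 1
  refine Finset.sum_congr rfl fun ν _ => ?_
  rw [dAdjKernelZ_transl _ ν G₁ h₁, dAdjKernelZ_transl _ ν G₂ h₂, h₃]

/-- kernel: *"a constant"* — hence its `x″`-sum does not depend on the position `a` of the first vertex (relative translation).
[cite: Balaban1983Higgs3, (3.36) p.444] -/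
theorem tsum_inner221c_transl (η : ℝ) (G₁ G₂ G₃ : KernelZ d) (h₁ : ∀ a b t, G₁ (a + t) (b + t) = G₁ a b)
    (h₂ : ∀ a b t, G₂ (a + t) (b + t) = G₂ a b) (h₃ : ∀ a b t, G₃ (a + t) (b + t) = G₃ a b)
    (a t : Fin (d + 1) → ℤ) :
    ∑' x'' : Fin (d + 1) → ℤ, inner221c η G₁ G₂ G₃ (a + t) x'' = ∑' x'' : Fin (d + 1) → ℤ, inner221c η G₁ G₂ G₃ a x'' := by
  rw [← Equiv.tsum_eq (Equiv.addRight t) (fun x'' => inner221c η G₁ G₂ G₃ (a + t) x'')]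
  exact tsum_congr fun x'' => by
    simp only [Equiv.coe_addRight]
    exact inner221c_transl η G₁ G₂ G₃ h₁ h₂ h₃ a x'' t

/-- **p. 444 [PDF 34], verbatim: *"For the graph (2.21c) it equals 0 also because by translation invariance it can be written as a
derivative of a constant."*** — PROVED for translation-invariant two-point kernels `G₁, G₂, G₃` on `ηℤ^{d+1}` (print: the propagator
`C^ξ` of the `ξ`-lattice after the replacement of p. 444), `η ≠ 0`, under the convergence of the inner (`z`) and outer (`x″`) sums:
`Σ_{x,x″}η^{2d}Γ′_μ(x,x′,x″) = η^d·∂^η_μ[a ↦ Σ_{x″}I(a,x″)](x′)` and the bracket is constant in `a`. [cite: Balaban1983Higgs3, (3.36) p.444] -/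
theorem coeff336Z_221c_eq_zero (η : ℝ) (hη : η ≠ 0) (G₁ G₂ G₃ : KernelZ d) (h₁ : ∀ a b t, G₁ (a + t) (b + t) = G₁ a b)
    (h₂ : ∀ a b t, G₂ (a + t) (b + t) = G₂ a b) (h₃ : ∀ a b t, G₃ (a + t) (b + t) = G₃ a b)
    (hin : ∀ a x'' : Fin (d + 1) → ℤ, Summable fun z : Fin (d + 1) → ℤ => η ^ (d + 1) *
      ∑ ν : Fin (d + 1), dAdjKernelZ η⁻¹ ν G₁ a z * (dAdjKernelZ η⁻¹ ν G₂ z x'' * G₃ z x''))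
    (hout : ∀ a : Fin (d + 1) → ℤ, Summable fun x'' : Fin (d + 1) → ℤ => inner221c η G₁ G₂ G₃ a x'')
    (μ : Fin (d + 1)) (x' : Fin (d + 1) → ℤ) :
    coeff336Z η (gamma221c η G₁ G₂ G₃) μ x' = 0 := by
  rw [gamma221c, coeff336Z_atFirst η hη]
  have e : ∀ x'', ker221c η G₁ G₂ G₃ μ x' x'' =
      η⁻¹ * (inner221c η G₁ G₂ G₃ (x' + Pi.single μ 1) x'' - inner221c η G₁ G₂ G₃ x' x'') := by
    intro x''
    rw [ker221c_eq_pdiffZ η G₁ G₂ G₃ μ x'' (fun a => hin a x'') x']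
    simp only [pdiffZ, unitVec]
  simp_rw [e]
  rw [tsum_mul_left, (hout _).tsum_sub (hout _), tsum_inner221c_transl η G₁ G₂ G₃ h₁ h₂ h₃ x' (Pi.single μ 1), sub_self,
    mul_zero, mul_zero]

/-- kernel: the permuted graph (2.21c) (vector leg and `φ″` at the doubly-differentiating vertex `x`, `φ′` at the far bubble vertex `x′`)
has `Σ_{x,x″}η^{2d}Γ′ = η^d Σ_x ∂^η_μ[I(·,x′)](x) = 0` — a summed difference quotient; NO translation invariance needed, only the
convergence of the sums. [cite: Balaban1983Higgs3, (3.36) p.444] -/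
theorem coeff336Z_221cPerm_eq_zero (η : ℝ) (hη : η ≠ 0) (G₁ G₂ G₃ : KernelZ d) (μ : Fin (d + 1)) (x' : Fin (d + 1) → ℤ)
    (hin : ∀ a : Fin (d + 1) → ℤ, Summable fun z : Fin (d + 1) → ℤ => η ^ (d + 1) *
      ∑ ν : Fin (d + 1), dAdjKernelZ η⁻¹ ν G₁ a z * (dAdjKernelZ η⁻¹ ν G₂ z x' * G₃ z x'))
    (hout : Summable fun a : Fin (d + 1) → ℤ => inner221c η G₁ G₂ G₃ a x') :
    coeff336Z η (gamma221cPerm η G₁ G₂ G₃) μ x' = 0 := by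
  rw [gamma221cPerm, coeff336Z_atSecond η hη]
  have e : ∀ a, ker221c η G₁ G₂ G₃ μ a x' = pdiffZ η⁻¹ μ (fun a => inner221c η G₁ G₂ G₃ a x') a :=
    fun a => ker221c_eq_pdiffZ η G₁ G₂ G₃ μ x' hin a
  simp_rw [e]
  have h0 := tsum_pdiffZ_translate_eq_zero (d := d + 1) 1 η⁻¹ μ (fun a => inner221c η G₁ G₂ G₃ a x') hout 0
  simp only [one_pow, one_mul, sub_zero] at h0
  rw [h0, mul_zero]

end Graph221c

/-! ## §4 Translation-invariant (convolution) kernels `K(a,b) = C(a − b)`: the hypotheses reduce to `Summable C` -/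

section ConvolutionKernels

/-- The translation-invariant two-point kernel `(a,b) ↦ C(a − b)` of a lattice function `C` (the propagator `C^ξ` of the `ξ`-lattice
enters (3.37)/(3.38) this way; gen 10's `B3Eq337ZeroLattice.convK` at `d + 1 = 3`). [cite: Balaban1983Higgs3, (3.37) p.444] -/
def convKer (C : (Fin (d + 1) → ℤ) → ℝ) : KernelZ d := fun a b => C (a - b)

/-- kernel: `convKer C` is translation invariant. [cite: Balaban1983Higgs3, (3.37) p.444] -/
theorem convKer_transl (C : (Fin (d + 1) → ℤ) → ℝ) (a b t : Fin (d + 1) → ℤ) : convKer C (a + t) (b + t) = convKer C a b := by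
  simp only [convKer, add_sub_add_right_eq_sub]

/-- kernel: `convKer C` is symmetric for an even `C` (p. 441 *"C^ξ(−y′) = C^ξ(y′)"*). [cite: Balaban1983Higgs3, (3.27) p.441] -/
theorem convKer_symm (C : (Fin (d + 1) → ℤ) → ℝ) (hC : ∀ u, C (-u) = C u) (a b : Fin (d + 1) → ℤ) :
    convKer C a b = convKer C b a := by
  simp only [convKer]
  rw [← neg_sub b a, hC]

/-- kernel: the first-variable difference of a convolution kernel is the forward difference quotient of `C`.
[cite: Balaban1983Higgs3, (3.37) p.444] -/
theorem dFstKernelZ_convKer (c : ℝ) (μ : Fin (d + 1)) (C : (Fin (d + 1) → ℤ) → ℝ) (a b : Fin (d + 1) → ℤ) :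
    dFstKernelZ c μ (convKer C) a b = pdiffZ c μ C (a - b) := by
  simp only [dFstKernelZ, convKer, pdiffZ, unitVec, add_sub_right_comm]

/-- kernel: the second-variable difference of a convolution kernel is the backward difference quotient of `C`
(`(C∂^{ξ*}_ν)(u) = (∂^{ξ*}_νC)(u)`, as in r15's `lhs337`). [cite: Balaban1983Higgs3, (3.37) p.444] -/
theorem dAdjKernelZ_convKer (c : ℝ) (ν : Fin (d + 1)) (C : (Fin (d + 1) → ℤ) → ℝ) (a b : Fin (d + 1) → ℤ) :
    dAdjKernelZ c ν (convKer C) a b = pdiffAdjZ c ν C (a - b) := by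
  simp only [dAdjKernelZ, convKer, pdiffAdjZ, unitVec, sub_add_eq_sub_sub]

/-- kernel: the bubble of convolution kernels is translation invariant. [cite: Balaban1983Higgs3, (3.9) p.435] -/
theorem bubbleZ_convKer_transl (η : ℝ) (C₂ C₃ : (Fin (d + 1) → ℤ) → ℝ) (a b t : Fin (d + 1) → ℤ) :
    bubbleZ η (convKer C₂) (convKer C₃) (a + t) (b + t) = bubbleZ η (convKer C₂) (convKer C₃) a b := by
  simp only [bubbleZ, dKernelZ, convKer]
  have e : ∀ u v : Fin (d + 1) → ℤ, a + t + u - (b + t + v) = a + u - (b + v) := fun u v => by abel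
  have e1 : ∀ u : Fin (d + 1) → ℤ, a + t + u - (b + t) = a + u - b := fun u => by
    have := e u 0; simpa using this
  have e2 : ∀ v : Fin (d + 1) → ℤ, a + t - (b + t + v) = a - (b + v) := fun v => by
    have := e 0 v; simpa using this
  simp only [e, e1, e2, add_sub_add_right_eq_sub]

/-- kernel: hence the bubble is the convolution kernel of the lattice function `u ↦ B(u, 0)`. [cite: Balaban1983Higgs3, (3.9) p.435] -/
theorem bubbleZ_convKer_eq (η : ℝ) (C₂ C₃ : (Fin (d + 1) → ℤ) → ℝ) (a b : Fin (d + 1) → ℤ) :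
    bubbleZ η (convKer C₂) (convKer C₃) a b = bubbleZ η (convKer C₂) (convKer C₃) (a - b) 0 := by
  have h := bubbleZ_convKer_transl η C₂ C₃ (a - b) 0 b
  rw [sub_add_cancel, zero_add] at h
  exact h

/-- kernel: a summable real lattice function is bounded by the sum of its absolute values. [folklore] -/
private theorem abs_le_tsum_of_summable {C : (Fin (d + 1) → ℤ) → ℝ} (hC : Summable C) (u : Fin (d + 1) → ℤ) :
    |C u| ≤ ∑' v, |C v| :=
  (summable_abs_iff.mpr hC).le_tsum u fun _ _ => abs_nonneg _

/-- kernel: (bounded) × (summable) is summable. [folklore] -/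
private theorem summable_of_bdd_mul {ι : Type*} {b s : ι → ℝ} (M : ℝ) (hb : ∀ i, |b i| ≤ M) (hs : Summable s) :
    Summable fun i => b i * s i := by
  refine Summable.of_norm_bounded ((summable_abs_iff.mpr hs).mul_left M) fun i => ?_
  rw [Real.norm_eq_abs, abs_mul]
  exact mul_le_mul_of_nonneg_right (hb i) (abs_nonneg _)

/-- kernel: (summable) × (bounded) is summable. [folklore] -/
private theorem summable_of_mul_bdd {ι : Type*} {s b : ι → ℝ} (M : ℝ) (hs : Summable s) (hb : ∀ i, |b i| ≤ M) :
    Summable fun i => s i * b i := by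
  have h := summable_of_bdd_mul M hb hs
  simpa only [mul_comm] using h

/-- kernel: a translate / reflection of a summable lattice function is summable. [folklore] -/
private theorem summable_comp_sub_left {C : (Fin (d + 1) → ℤ) → ℝ} (hC : Summable C) (a : Fin (d + 1) → ℤ) :
    Summable fun z : Fin (d + 1) → ℤ => C (a - z) :=
  (Equiv.subLeft a).summable_iff.mpr hC

/-- kernel: a translate of a summable lattice function is summable. [folklore] -/
private theorem summable_comp_sub_right {C : (Fin (d + 1) → ℤ) → ℝ} (hC : Summable C) (a : Fin (d + 1) → ℤ) :
    Summable fun z : Fin (d + 1) → ℤ => C (z - a) :=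
  (Equiv.subRight a).summable_iff.mpr hC

/-- kernel: the difference quotients of a summable lattice function are summable. [folklore] -/
private theorem summable_pdiffZ {C : (Fin (d + 1) → ℤ) → ℝ} (hC : Summable C) (c : ℝ) (μ : Fin (d + 1)) :
    Summable (pdiffZ c μ C) := by
  have h1 : Summable fun u : Fin (d + 1) → ℤ => C (u + unitVec μ) := (Equiv.addRight (unitVec μ)).summable_iff.mpr hC
  exact (h1.sub hC).mul_left c

/-- kernel: the backward difference quotients of a summable lattice function are summable. [folklore] -/
private theorem summable_pdiffAdjZ {C : (Fin (d + 1) → ℤ) → ℝ} (hC : Summable C) (c : ℝ) (μ : Fin (d + 1)) :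
    Summable (pdiffAdjZ c μ C) := by
  have h1 : Summable fun u : Fin (d + 1) → ℤ => C (u - unitVec μ) := (Equiv.subRight (unitVec μ)).summable_iff.mpr hC
  exact (h1.sub hC).mul_left c

/-- kernel: the backward difference quotient of a bounded lattice function is bounded. [folklore] -/
private theorem abs_pdiffAdjZ_le {C : (Fin (d + 1) → ℤ) → ℝ} {M : ℝ} (hM : ∀ u, |C u| ≤ M) (c : ℝ) (μ : Fin (d + 1))
    (u : Fin (d + 1) → ℤ) : |pdiffAdjZ c μ C u| ≤ |c| * (M + M) := by
  simp only [pdiffAdjZ]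
  rw [abs_mul]
  exact mul_le_mul_of_nonneg_left ((abs_sub _ _).trans (add_le_add (hM _) (hM _))) (abs_nonneg _)

/-- the shear `(z, x″) ↦ (a − z, z − x″)` of `ℤ^{d+1} × ℤ^{d+1}` (a bijection). [folklore] -/
private def shearEquiv (a : Fin (d + 1) → ℤ) :
    ((Fin (d + 1) → ℤ) × (Fin (d + 1) → ℤ)) ≃ ((Fin (d + 1) → ℤ) × (Fin (d + 1) → ℤ)) where
  toFun p := (a - p.1, p.1 - p.2)
  invFun q := (a - q.1, a - q.1 - q.2)
  left_inv p := by
    obtain ⟨p1, p2⟩ := p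
    simp only [Prod.mk.injEq]
    constructor <;> abel
  right_inv q := by
    obtain ⟨q1, q2⟩ := q
    simp only [Prod.mk.injEq]
    constructor <;> abel

/-- the shear `(x, z) ↦ (x − z, z − x′)` of `ℤ^{d+1} × ℤ^{d+1}` (a bijection). [folklore] -/
private def shearEquiv₂ (x' : Fin (d + 1) → ℤ) :
    ((Fin (d + 1) → ℤ) × (Fin (d + 1) → ℤ)) ≃ ((Fin (d + 1) → ℤ) × (Fin (d + 1) → ℤ)) where
  toFun p := (p.1 - p.2, p.2 - x')
  invFun q := (q.1 + q.2 + x', q.2 + x')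
  left_inv p := by
    obtain ⟨p1, p2⟩ := p
    simp only [Prod.mk.injEq]
    constructor <;> abel
  right_inv q := by
    obtain ⟨q1, q2⟩ := q
    simp only [Prod.mk.injEq]
    constructor <;> abel

/-- kernel: the product family `(u, w) ↦ f(u)·g(w)` of two summable real lattice functions is summable (`ℓ¹ × ℓ¹`). [folklore] -/
private theorem summable_prod_mul {f g : (Fin (d + 1) → ℤ) → ℝ} (hf : Summable f) (hg : Summable g) :
    Summable fun q : (Fin (d + 1) → ℤ) × (Fin (d + 1) → ℤ) => f q.1 * g q.2 :=
  summable_mul_of_summable_norm (by simpa only [Real.norm_eq_abs] using summable_abs_iff.mpr hf)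
    (by simpa only [Real.norm_eq_abs] using summable_abs_iff.mpr hg)

/-- kernel: the sheared product family `(z, x″) ↦ f(a − z)·g(z − x″)` of two summable lattice functions is summable on
`ℤ^{d+1} × ℤ^{d+1}`. [folklore] -/
private theorem summable_shear {f g : (Fin (d + 1) → ℤ) → ℝ} (hf : Summable f) (hg : Summable g) (a : Fin (d + 1) → ℤ) :
    Summable fun p : (Fin (d + 1) → ℤ) × (Fin (d + 1) → ℤ) => f (a - p.1) * g (p.1 - p.2) := by
  have h := ((shearEquiv a).summable_iff (f := fun q : (Fin (d + 1) → ℤ) × (Fin (d + 1) → ℤ) => f q.1 * g q.2)).mpr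
    (summable_prod_mul hf hg)
  exact h.congr fun p => rfl

/-- kernel: the second shear `(x, z) ↦ f(x − z)·g(z − x′)` is summable likewise. [folklore] -/
private theorem summable_shear₂ {f g : (Fin (d + 1) → ℤ) → ℝ} (hf : Summable f) (hg : Summable g) (x' : Fin (d + 1) → ℤ) :
    Summable fun p : (Fin (d + 1) → ℤ) × (Fin (d + 1) → ℤ) => f (p.1 - p.2) * g (p.2 - x') := by
  have h := ((shearEquiv₂ x').summable_iff (f := fun q : (Fin (d + 1) → ℤ) × (Fin (d + 1) → ℤ) => f q.1 * g q.2)).mpr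
    (summable_prod_mul hf hg)
  exact h.congr fun p => rfl

variable {η : ℝ} {C₁ C₂ C₃ : (Fin (d + 1) → ℤ) → ℝ}

/-- kernel: the bubble function `u ↦ B(u,0)` of summable `C₂`, `C₃` is summable (bounded second differences of `C₂` times `C₃`).
[cite: Balaban1983Higgs3, (3.9) p.435] -/
theorem summable_bubbleZ_convKer (η : ℝ) (hC₂ : Summable C₂) (hC₃ : Summable C₃) :
    Summable fun u : Fin (d + 1) → ℤ => bubbleZ η (convKer C₂) (convKer C₃) u 0 := by
  set M : ℝ := ∑' v, |C₂ v| with hM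
  have hb : ∀ u : Fin (d + 1) → ℤ, |∑ ν : Fin (d + 1), dKernelZ η⁻¹ ν (convKer C₂) u 0| ≤
      (d + 1 : ℕ) * ((η⁻¹) ^ 2 * (M + M + M + M)) := by
    intro u
    refine (Finset.abs_sum_le_sum_abs _ _).trans ?_
    have hcard : (∑ _ν : Fin (d + 1), (η⁻¹) ^ 2 * (M + M + M + M)) = (d + 1 : ℕ) * ((η⁻¹) ^ 2 * (M + M + M + M)) := by
      rw [Finset.sum_const, Finset.card_univ, Fintype.card_fin, nsmul_eq_mul]
    rw [← hcard]
    refine Finset.sum_le_sum fun ν _ => ?_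
    simp only [dKernelZ, convKer]
    rw [abs_mul, abs_of_nonneg (by positivity : (0 : ℝ) ≤ η⁻¹ ^ 2)]
    refine mul_le_mul_of_nonneg_left ?_ (by positivity)
    have h := abs_le_tsum_of_summable hC₂
    calc |C₂ (u + Pi.single ν 1 - (0 + Pi.single ν 1)) - C₂ (u + Pi.single ν 1 - 0) - C₂ (u - (0 + Pi.single ν 1)) + C₂ (u - 0)|
        ≤ |C₂ (u + Pi.single ν 1 - (0 + Pi.single ν 1)) - C₂ (u + Pi.single ν 1 - 0) - C₂ (u - (0 + Pi.single ν 1))| +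
            |C₂ (u - 0)| := abs_add_le _ _
      _ ≤ (|C₂ (u + Pi.single ν 1 - (0 + Pi.single ν 1)) - C₂ (u + Pi.single ν 1 - 0)| + |C₂ (u - (0 + Pi.single ν 1))|) +
            |C₂ (u - 0)| := by gcongr; exact abs_sub _ _
      _ ≤ ((|C₂ (u + Pi.single ν 1 - (0 + Pi.single ν 1))| + |C₂ (u + Pi.single ν 1 - 0)|) +
            |C₂ (u - (0 + Pi.single ν 1))|) + |C₂ (u - 0)| := by gcongr; exact abs_sub _ _
      _ ≤ ((M + M) + M) + M := by gcongr <;> exact h _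
      _ = M + M + M + M := by ring
  have hs : Summable fun u : Fin (d + 1) → ℤ => convKer C₃ u 0 := by
    simpa only [convKer, sub_zero] using hC₃
  exact summable_of_bdd_mul _ hb hs

/-- kernel: the bubble function is bounded. [cite: Balaban1983Higgs3, (3.9) p.435] -/
theorem abs_bubbleZ_convKer_le (η : ℝ) (hC₂ : Summable C₂) (hC₃ : Summable C₃) (a b : Fin (d + 1) → ℤ) :
    |bubbleZ η (convKer C₂) (convKer C₃) a b| ≤ ∑' u, |bubbleZ η (convKer C₂) (convKer C₃) u 0| := by
  rw [bubbleZ_convKer_eq]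
  exact abs_le_tsum_of_summable (summable_bubbleZ_convKer η hC₂ hC₃) (a - b)

/-- **(2.21b)+(2.21g) for translation-invariant kernels**: the Fubini hypothesis of `coeff336Z_221b_add_221g` holds as soon as
`C₁, C₂, C₃` are summable, so `Σ_{x,x″}η^{2d}(Γ′_{(2.21b)} + Γ′_{(2.21g)}) = 0`. [cite: Balaban1983Higgs3, (3.36) p.444] -/
theorem coeff336Z_221b_add_221g_convKer (η : ℝ) (hη : η ≠ 0) (hC₁ : Summable C₁) (hC₂ : Summable C₂) (hC₃ : Summable C₃)
    (μ : Fin (d + 1)) (x' : Fin (d + 1) → ℤ) :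
    coeff336Z η (gamma221b η (convKer C₁) (convKer C₂) (convKer C₃)) μ x' +
      coeff336Z η (gamma221g η (convKer C₁) (convKer C₂) (convKer C₃)) μ x' = 0 := by
  refine coeff336Z_221b_add_221g η hη _ _ _ μ x' ?_
  have h := summable_shear (summable_pdiffZ hC₁ η⁻¹ μ) (summable_bubbleZ_convKer η hC₂ hC₃) x'
  refine h.congr fun p => ?_
  rw [dFstKernelZ_convKer, ← bubbleZ_convKer_eq]

/-- **the permuted graph (2.21b) for translation-invariant kernels**, `C₁, C₂, C₃` summable. [cite: Balaban1983Higgs3, (3.36) p.444] -/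
theorem coeff336Z_221bPerm_convKer_eq_zero (η : ℝ) (hη : η ≠ 0) (hC₁ : Summable C₁) (hC₂ : Summable C₂) (hC₃ : Summable C₃)
    (μ : Fin (d + 1)) (x' : Fin (d + 1) → ℤ) :
    coeff336Z η (gamma221bPerm η (convKer C₁) (convKer C₂) (convKer C₃)) μ x' = 0 := by
  have hB := summable_bubbleZ_convKer η hC₂ hC₃
  -- the product family `(x, z) ↦ C₁(x − z)·B(z − x′)`
  have hF : Summable fun p : (Fin (d + 1) → ℤ) × (Fin (d + 1) → ℤ) =>
      η ^ (d + 1) * (convKer C₁ p.1 p.2 * bubbleZ η (convKer C₂) (convKer C₃) p.2 x') := by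
    have h := (summable_shear₂ hC₁ hB x').mul_left (η ^ (d + 1))
    refine h.congr fun p => ?_
    rw [convKer, ← bubbleZ_convKer_eq]
  refine coeff336Z_221bPerm_eq_zero η hη _ _ _ μ x' (fun x => ?_) hF.prod
  exact summable_of_mul_bdd _ (summable_comp_sub_left hC₁ x) fun z => abs_bubbleZ_convKer_le η hC₂ hC₃ z x'

/-- **the permuted counterterm graph (2.21g) for translation-invariant kernels**, `C₁` summable. [cite: Balaban1983Higgs3, (3.36) p.444] -/
theorem coeff336Z_221gPerm_convKer_eq_zero (η : ℝ) (hη : η ≠ 0) (hC₁ : Summable C₁) (C₂ C₃ : (Fin (d + 1) → ℤ) → ℝ)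
    (μ : Fin (d + 1)) (x' : Fin (d + 1) → ℤ) :
    coeff336Z η (gamma221gPerm η (convKer C₁) (convKer C₂) (convKer C₃)) μ x' = 0 :=
  coeff336Z_221gPerm_eq_zero η hη _ _ _ μ x' (summable_comp_sub_right hC₁ x')

/-- **(2.18) for translation-invariant kernels of even functions** (p. 441 *"C^ξ(−y′) = C^ξ(y′)"*): the class vanishes for a skew
internal-index map. [cite: Balaban1983Higgs3, (3.36) p.444] -/
theorem local336U_218_class_convKer_eq_zero {W : Type*} [NormedAddCommGroup W] [InnerProductSpace ℝ W] (η : ℝ) (hη : η ≠ 0)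
    (Cs Cv : (Fin (d + 1) → ℤ) → ℝ) (hCs : ∀ u, Cs (-u) = Cs u) (hCv : ∀ u, Cv (-u) = Cv u) (Q : W →ₗ[ℝ] W)
    (hQ : ∀ u v : W, ⟪Q u, v⟫ = -⟪u, Q v⟫) (locs : (Fin (d + 1) → ℤ) → ℝ) (A : Fin (d + 1) → (Fin (d + 1) → ℤ) → ℝ)
    (φ' φ'' : (Fin (d + 1) → ℤ) → W) (Λ' : Finset (Fin (d + 1) → ℤ)) :
    local336U η (gamma218 η (convKer Cs) (convKer Cv)) Q locs A φ' φ'' Λ' +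
      local336U η (gamma218Perm η (convKer Cs) (convKer Cv)) Q locs A φ'' φ' Λ' = 0 :=
  local336U_218_class_eq_zero η hη _ _ (convKer_symm Cs hCs) (convKer_symm Cv hCv) Q hQ locs A φ' φ'' Λ'

/-- kernel: the double family behind (2.21c) for translation-invariant kernels is summable on `ℤ^{d+1} × ℤ^{d+1}`.
[cite: Balaban1983Higgs3, (3.36) p.444] -/
theorem summable_family221c_convKer (η : ℝ) (hC₁ : Summable C₁) (hC₂ : Summable C₂) (hC₃ : Summable C₃)
    (a : Fin (d + 1) → ℤ) :
    Summable fun p : (Fin (d + 1) → ℤ) × (Fin (d + 1) → ℤ) => η ^ (d + 1) *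
      ∑ ν : Fin (d + 1), dAdjKernelZ η⁻¹ ν (convKer C₁) a p.1 *
        (dAdjKernelZ η⁻¹ ν (convKer C₂) p.1 p.2 * convKer C₃ p.1 p.2) := by
  have hg : ∀ ν : Fin (d + 1), Summable fun u : Fin (d + 1) → ℤ => pdiffAdjZ η⁻¹ ν C₂ u * C₃ u :=
    fun ν => summable_of_bdd_mul _ (abs_pdiffAdjZ_le (abs_le_tsum_of_summable hC₂) η⁻¹ ν) hC₃
  have h := (summable_sum fun ν (_ : ν ∈ (Finset.univ : Finset (Fin (d + 1)))) =>
    summable_shear (summable_pdiffAdjZ hC₁ η⁻¹ ν) (hg ν) a).mul_left (η ^ (d + 1))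
  refine h.congr fun p => ?_
  simp only [dAdjKernelZ_convKer, convKer]

/-- **(2.21c) for translation-invariant kernels**: `Σ_{x,x″}η^{2d}Γ′_{(2.21c)} = 0` as soon as `C₁, C₂, C₃` are summable (the two
convergence hypotheses of `coeff336Z_221c_eq_zero` by Fubini). [cite: Balaban1983Higgs3, (3.36) p.444] -/
theorem coeff336Z_221c_convKer_eq_zero (η : ℝ) (hη : η ≠ 0) (hC₁ : Summable C₁) (hC₂ : Summable C₂) (hC₃ : Summable C₃)
    (μ : Fin (d + 1)) (x' : Fin (d + 1) → ℤ) :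
    coeff336Z η (gamma221c η (convKer C₁) (convKer C₂) (convKer C₃)) μ x' = 0 := by
  refine coeff336Z_221c_eq_zero η hη _ _ _ (convKer_transl C₁) (convKer_transl C₂) (convKer_transl C₃)
    (fun a x'' => ?_) (fun a => ?_) μ x'
  · exact (summable_family221c_convKer η hC₁ hC₂ hC₃ a).prod_symm.prod_factor x''
  · exact (summable_family221c_convKer η hC₁ hC₂ hC₃ a).prod_symm.prod

/-- **the permuted graph (2.21c) for translation-invariant kernels**, `C₁, C₂, C₃` summable. [cite: Balaban1983Higgs3, (3.36) p.444] -/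
theorem coeff336Z_221cPerm_convKer_eq_zero (η : ℝ) (hη : η ≠ 0) (hC₁ : Summable C₁) (hC₂ : Summable C₂) (hC₃ : Summable C₃)
    (μ : Fin (d + 1)) (x' : Fin (d + 1) → ℤ) :
    coeff336Z η (gamma221cPerm η (convKer C₁) (convKer C₂) (convKer C₃)) μ x' = 0 := by
  -- the product family `(a, z) ↦ Σ_ν (∂^*_νC₁)(a − z)·[(∂^*_νC₂)C₃](z − x′)`
  have hg : ∀ ν : Fin (d + 1), Summable fun u : Fin (d + 1) → ℤ => pdiffAdjZ η⁻¹ ν C₂ u * C₃ u :=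
    fun ν => summable_of_bdd_mul _ (abs_pdiffAdjZ_le (abs_le_tsum_of_summable hC₂) η⁻¹ ν) hC₃
  have hF : Summable fun p : (Fin (d + 1) → ℤ) × (Fin (d + 1) → ℤ) => η ^ (d + 1) *
      ∑ ν : Fin (d + 1), dAdjKernelZ η⁻¹ ν (convKer C₁) p.1 p.2 *
        (dAdjKernelZ η⁻¹ ν (convKer C₂) p.2 x' * convKer C₃ p.2 x') := by
    have h := (summable_sum fun ν (_ : ν ∈ (Finset.univ : Finset (Fin (d + 1)))) =>
      summable_shear₂ (summable_pdiffAdjZ hC₁ η⁻¹ ν) (hg ν) x').mul_left (η ^ (d + 1))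
    refine h.congr fun p => ?_
    simp only [dAdjKernelZ_convKer, convKer]
  exact coeff336Z_221cPerm_eq_zero η hη _ _ _ μ x' (fun a => hF.prod_factor a) hF.prod

end ConvolutionKernels

/-! ## §5 Instances on the print's carriers: `C^ξ` on the `ξ`-lattice (any dimension) and the zero-field propagators `G_k(0)` -/

section Instances

open B3CxiPropagator (summable_Cxi)
open B3GkZeroLattice (GkLat GkLat_comm)

variable {W : Type*} [NormedAddCommGroup W] [InnerProductSpace ℝ W]

/-- **p. 444 for the graphs (2.21b)+(2.21g) with every line the propagator `C^ξ` of the `ξ`-lattice `ξℤ^{d+1}`** (`ξ > 0`; r15's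
momentum-integral `Cxi`, summable by r15's `B3CxiPropagator.summable_Cxi`): `Σ_{x,x″}ξ^{2d}(Γ″_{(2.21b)} + Γ″_{(2.21g)}) = 0`, NO
hypothesis left. [cite: Balaban1983Higgs3, (3.36) p.444] -/
theorem coeff336Z_221b_add_221g_Cxi {ξ : ℝ} (hξ : 0 < ξ) (μ : Fin (d + 1)) (x' : Fin (d + 1) → ℤ) :
    coeff336Z ξ (gamma221b ξ (convKer (Cxi (d + 1) ξ)) (convKer (Cxi (d + 1) ξ)) (convKer (Cxi (d + 1) ξ))) μ x' +
      coeff336Z ξ (gamma221g ξ (convKer (Cxi (d + 1) ξ)) (convKer (Cxi (d + 1) ξ)) (convKer (Cxi (d + 1) ξ))) μ x' = 0 :=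
  coeff336Z_221b_add_221g_convKer ξ hξ.ne' (summable_Cxi hξ) (summable_Cxi hξ) (summable_Cxi hξ) μ x'

/-- kernel: the permuted graphs (2.21b) and (2.21g) with `C^ξ`-lines vanish individually. [cite: Balaban1983Higgs3, (3.36) p.444] -/
theorem coeff336Z_221bgPerm_Cxi_eq_zero {ξ : ℝ} (hξ : 0 < ξ) (μ : Fin (d + 1)) (x' : Fin (d + 1) → ℤ) :
    coeff336Z ξ (gamma221bPerm ξ (convKer (Cxi (d + 1) ξ)) (convKer (Cxi (d + 1) ξ)) (convKer (Cxi (d + 1) ξ))) μ x' = 0 ∧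
      coeff336Z ξ (gamma221gPerm ξ (convKer (Cxi (d + 1) ξ)) (convKer (Cxi (d + 1) ξ)) (convKer (Cxi (d + 1) ξ))) μ x' = 0 :=
  ⟨coeff336Z_221bPerm_convKer_eq_zero ξ hξ.ne' (summable_Cxi hξ) (summable_Cxi hξ) (summable_Cxi hξ) μ x',
    coeff336Z_221gPerm_convKer_eq_zero ξ hξ.ne' (summable_Cxi hξ) _ _ μ x'⟩

/-- **p. 444 for the class (2.18) with `C^ξ`-lines** (`C^ξ` even: r15's `Cxi_neg`): the local term (3.36) of the class vanishes for a
skew internal-index map. [cite: Balaban1983Higgs3, (3.36) p.444] -/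
theorem local336U_218_class_Cxi_eq_zero (ξ : ℝ) (hξ : ξ ≠ 0) (Q : W →ₗ[ℝ] W) (hQ : ∀ u v : W, ⟪Q u, v⟫ = -⟪u, Q v⟫)
    (locs : (Fin (d + 1) → ℤ) → ℝ) (A : Fin (d + 1) → (Fin (d + 1) → ℤ) → ℝ) (φ' φ'' : (Fin (d + 1) → ℤ) → W)
    (Λ' : Finset (Fin (d + 1) → ℤ)) :
    local336U ξ (gamma218 ξ (convKer (Cxi (d + 1) ξ)) (convKer (Cxi (d + 1) ξ))) Q locs A φ' φ'' Λ' +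
      local336U ξ (gamma218Perm ξ (convKer (Cxi (d + 1) ξ)) (convKer (Cxi (d + 1) ξ))) Q locs A φ'' φ' Λ' = 0 :=
  local336U_218_class_convKer_eq_zero ξ hξ _ _ (Cxi_neg ξ) (Cxi_neg ξ) Q hQ locs A φ' φ'' Λ'

/-- **p. 444 for the class (2.18) with the zero-field lattice propagators `G_k(ηℤ^{d+1}, 0)`** of p26's `B3GkZeroLattice.GkLat` on
BOTH lines (scalar line with the window parameters `(a, m²)`, vector line read as the same type of kernel with its own parameters
`(a₃, m₃²)` — the model-instance reading of p39 g10): symmetric kernels (`GkLat_comm`), so the class vanishes for a skew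
internal-index map; the stage of the print BEFORE the replacement by `C^ξ`. [cite: Balaban1983Higgs3, (3.36) p.444] -/
theorem local336U_218_class_GkLat_eq_zero (η : ℝ) (hη : η ≠ 0) (ℓ k : ℕ) (a m2 a₃ m2₃ : ℝ) (Q : W →ₗ[ℝ] W)
    (hQ : ∀ u v : W, ⟪Q u, v⟫ = -⟪u, Q v⟫) (locs : (Fin (d + 1) → ℤ) → ℝ) (A : Fin (d + 1) → (Fin (d + 1) → ℤ) → ℝ)
    (φ' φ'' : (Fin (d + 1) → ℤ) → W) (Λ' : Finset (Fin (d + 1) → ℤ)) :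
    local336U η (gamma218 η (GkLat ℓ k a m2) (GkLat ℓ k a₃ m2₃)) Q locs A φ' φ'' Λ' +
      local336U η (gamma218Perm η (GkLat ℓ k a m2) (GkLat ℓ k a₃ m2₃)) Q locs A φ'' φ' Λ' = 0 :=
  local336U_218_class_eq_zero η hη _ _ (fun x y => GkLat_comm x y) (fun x y => GkLat_comm x y) Q hQ locs A φ' φ'' Λ'

/-- **p. 444 for the graph (2.21c) with every line `C^ξ`** (`ξ > 0`, any dimension): `Σ_{y,y″}ξ^{2d}Γ″_μ(y,y′,y″) = 0`, NO hypothesis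
left — *"by translation invariance … a derivative of a constant"*. [cite: Balaban1983Higgs3, (3.36) p.444] -/
theorem coeff336Z_221c_Cxi_eq_zero {ξ : ℝ} (hξ : 0 < ξ) (μ : Fin (d + 1)) (x' : Fin (d + 1) → ℤ) :
    coeff336Z ξ (gamma221c ξ (convKer (Cxi (d + 1) ξ)) (convKer (Cxi (d + 1) ξ)) (convKer (Cxi (d + 1) ξ))) μ x' = 0 :=
  coeff336Z_221c_convKer_eq_zero ξ hξ.ne' (summable_Cxi hξ) (summable_Cxi hξ) (summable_Cxi hξ) μ x'

/-- kernel: the permuted graph (2.21c) with `C^ξ`-lines vanishes. [cite: Balaban1983Higgs3, (3.36) p.444] -/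
theorem coeff336Z_221cPerm_Cxi_eq_zero {ξ : ℝ} (hξ : 0 < ξ) (μ : Fin (d + 1)) (x' : Fin (d + 1) → ℤ) :
    coeff336Z ξ (gamma221cPerm ξ (convKer (Cxi (d + 1) ξ)) (convKer (Cxi (d + 1) ξ)) (convKer (Cxi (d + 1) ξ))) μ x' = 0 :=
  coeff336Z_221cPerm_convKer_eq_zero ξ hξ.ne' (summable_Cxi hξ) (summable_Cxi hξ) (summable_Cxi hξ) μ x'

end Instances

/-! ## §6 (2.21b)+(2.21g) with the lines `G^ξ_k(0)` on `ξℤ³` — the stage of p. 444 BEFORE the replacement by `C^ξ` -/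

section GxiLInstance

open B3CxiUniformBound (supNorm)
open B3Eq316ResolventZeroLattice (GxiL xiOf xiOf_pos xiOf_le_one summable_profile_row)
open B3Eq316DifferenceKernelBounds (prof prof_nonneg prof_succ_le prof_sub_comm exists_laws)

/-- kernel: `P_q ≤ ξ^{−q}` (`ξ·max(1,|u|_∞) ≥ ξ`, `e^{−δξ|u|} ≤ 1`). [cite: Balaban1983Higgs3, (3.16) p.437] -/
private theorem prof_le_inv_pow {ξ δ : ℝ} (hξ : 0 < ξ) (hδ : 0 ≤ δ) (q : ℕ) (u : ZSite 3) : prof ξ δ q u ≤ (ξ ^ q)⁻¹ := by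
  unfold prof
  have h1 : ξ ≤ ξ * max 1 (supNorm u : ℝ) := le_mul_of_one_le_right hξ.le (le_max_left _ _)
  have h2 : ((ξ * max 1 (supNorm u : ℝ)) ^ q)⁻¹ ≤ (ξ ^ q)⁻¹ :=
    inv_anti₀ (pow_pos hξ q) (pow_le_pow_left₀ hξ.le h1 q)
  have h3 : Real.exp (-(δ * (ξ * (supNorm u : ℝ)))) ≤ 1 := by
    rw [Real.exp_le_one_iff, neg_nonpos]
    positivity
  calc ((ξ * max 1 (supNorm u : ℝ)) ^ q)⁻¹ * Real.exp (-(δ * (ξ * (supNorm u : ℝ))))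
      ≤ (ξ ^ q)⁻¹ * 1 := mul_le_mul h2 h3 (Real.exp_nonneg _) (by positivity)
    _ = (ξ ^ q)⁻¹ := mul_one _

/-- kernel: the profiles `P_q`, `q ≤ 2`, are summable rows (p39 g8/g9's `tsum_profile_le`/`summable_profile_row`).
[cite: Balaban1983Higgs3, (3.16) p.437] -/
private theorem summable_prof_sub {ξ δ : ℝ} (hξ : 0 < ξ) (hξ1 : ξ ≤ 1) (hδ : 0 < δ) (hδ1 : δ ≤ 1) {q : ℕ} (hq : q ≤ 2)
    (y : ZSite 3) : Summable fun z : ZSite 3 => prof ξ δ q (y - z) :=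
  summable_profile_row hξ hξ1 hδ hδ1 hq y

/-- kernel: the profile `P_q`, `q ≤ 2`, is summable. [cite: Balaban1983Higgs3, (3.16) p.437] -/
private theorem summable_prof {ξ δ : ℝ} (hξ : 0 < ξ) (hξ1 : ξ ≤ 1) (hδ : 0 < δ) (hδ1 : δ ≤ 1) {q : ℕ} (hq : q ≤ 2) :
    Summable fun u : ZSite 3 => prof ξ δ q u := by
  refine (summable_prof_sub hξ hξ1 hδ hδ1 hq 0).congr fun z => ?_
  rw [prof_sub_comm, sub_zero]

/-- kernel: the profile `P₃` is summable (`P₃ ≤ ξ^{−1}P₂`). [cite: Balaban1983Higgs3, (3.16) p.437] -/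
private theorem summable_prof_three {ξ δ : ℝ} (hξ : 0 < ξ) (hξ1 : ξ ≤ 1) (hδ : 0 < δ) (hδ1 : δ ≤ 1) :
    Summable fun u : ZSite 3 => prof ξ δ 3 u :=
  Summable.of_nonneg_of_le (fun u => prof_nonneg hξ.le δ 3 u) (fun u => prof_succ_le hξ δ 2 u)
    ((summable_prof hξ hξ1 hδ hδ1 (le_refl 2)).mul_left ξ⁻¹)

variable {ℓ : ℕ}

/-- kernel: under the p. 437 laws of `G^ξ_k(0)` (p39 g9's `exists_laws`: `|(∂_{μ′}G∂^*_μ)| ≤ C P₃^δ`, `|G₃| ≤ C₃ P₁^{δ₃} ≤ C₃ξ^{−1}`)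
the bubble is dominated by a summable translation-invariant profile: `|B(z,w)| ≤ 3C·P₃^δ(z − w)·C₃ξ^{−1}`.
[cite: Balaban1983Higgs3, (3.9) p.435] -/
private theorem abs_bubbleZ_le_of_laws {ξ δ δ₃ C C₃ : ℝ} (hξ : 0 < ξ) (hδ₃ : 0 ≤ δ₃) (hC₃ : 0 ≤ C₃) {G G₃ : KernelZ 2}
    (hG2 : ∀ (μ' μ : Fin (2 + 1)) (x y : Fin (2 + 1) → ℤ), |d2KernelZ ξ⁻¹ μ' μ G x y| ≤ C * prof ξ δ 3 (x - y))
    (hG₃ : ∀ y z : Fin (2 + 1) → ℤ, |G₃ y z| ≤ C₃ * prof ξ δ₃ 1 (y - z)) (z w : Fin (2 + 1) → ℤ) :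
    |bubbleZ ξ G G₃ z w| ≤ 3 * (C * prof ξ δ 3 (z - w)) * (C₃ * ξ⁻¹) := by
  simp only [bubbleZ]
  rw [abs_mul]
  have hsum : |∑ ν : Fin (2 + 1), dKernelZ ξ⁻¹ ν G z w| ≤ 3 * (C * prof ξ δ 3 (z - w)) := by
    refine (Finset.abs_sum_le_sum_abs _ _).trans ?_
    calc ∑ ν : Fin (2 + 1), |dKernelZ ξ⁻¹ ν G z w| ≤ ∑ _ν : Fin (2 + 1), C * prof ξ δ 3 (z - w) :=
          Finset.sum_le_sum fun ν _ => hG2 ν ν z w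
      _ = 3 * (C * prof ξ δ 3 (z - w)) := by
          rw [Finset.sum_const, Finset.card_univ, Fintype.card_fin, nsmul_eq_mul]
          norm_num
  have h3 : |G₃ z w| ≤ C₃ * ξ⁻¹ :=
    (hG₃ z w).trans (mul_le_mul_of_nonneg_left (by simpa only [pow_one] using prof_le_inv_pow hξ hδ₃ 1 (z - w)) hC₃)
  have h0 : 0 ≤ 3 * (C * prof ξ δ 3 (z - w)) := (abs_nonneg _).trans hsum
  exact mul_le_mul hsum h3 (abs_nonneg _) h0

/-- **p. 444 for the graphs (2.21b)+(2.21g) with the lines `G^ξ_k(0)` ON THE INFINITE LATTICE `ξℤ³`** — the zero-field propagator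
`(−Δ^ξ + m² + a_kP_k)^{−1}` of (3.16) (p03/p39's `GxiL`, `ξ = L^{−k}`) on the two scalar lines (parameters `(a, m²)`) and, read as a
scalar-type kernel with its own parameters `(a₃, m₃²)`, on the vector line (the model-instance reading of p39 g10's `exists_tri19_bound`):
for every `k ≥ 1`, `a, a₃ > 0`, `m², m₃² ≥ 0`, direction `μ` and gathering vertex `y′`,
`Σ_{y,y″}ξ^{2d}(Γ′_{(2.21b)} + Γ′_{(2.21g)})(y,y′,y″) = 0` — NO hypothesis left: the Fubini summability follows from the p. 437 kernel laws
(p39 g9's `B3Eq316DifferenceKernelBounds.exists_laws`). [cite: Balaban1983Higgs3, (3.36) p.444] -/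
theorem coeff336Z_221b_add_221g_GxiL (hℓ : 1 ≤ ℓ) {k : ℕ} (hk : 1 ≤ k) {a m2 a₃ m2₃ : ℝ} (ha : 0 < a) (hm : 0 ≤ m2)
    (ha₃ : 0 < a₃) (hm₃ : 0 ≤ m2₃) (μ : Fin (2 + 1)) (y' : Fin (2 + 1) → ℤ) :
    coeff336Z (xiOf ℓ k) (gamma221b (d := 2) (xiOf ℓ k) (GxiL ℓ k a m2) (GxiL ℓ k a m2) (GxiL ℓ k a₃ m2₃)) μ y' +
      coeff336Z (xiOf ℓ k) (gamma221g (d := 2) (xiOf ℓ k) (GxiL ℓ k a m2) (GxiL ℓ k a m2) (GxiL ℓ k a₃ m2₃)) μ y' = 0 := by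
  obtain ⟨δ, C, hδ, hδh, hC, hlaw⟩ := exists_laws hℓ a a m2 ha
  obtain ⟨-, hG1, -, hG2, -⟩ := hlaw k hk a m2 le_rfl le_rfl hm le_rfl
  obtain ⟨δ₃, C₃, hδ₃, hδ₃h, hC₃, hlaw₃⟩ := exists_laws hℓ a₃ a₃ m2₃ ha₃
  obtain ⟨hG₃, -⟩ := hlaw₃ k hk a₃ m2₃ le_rfl le_rfl hm₃ le_rfl
  have hξ : 0 < xiOf ℓ k := xiOf_pos ℓ k
  have hξ1 : xiOf ℓ k ≤ 1 := xiOf_le_one ℓ k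
  have hδ1 : δ ≤ 1 := hδh.trans (by norm_num)
  refine coeff336Z_221b_add_221g (xiOf ℓ k) hξ.ne' _ _ _ μ y' ?_
  have hf : Summable fun u : ZSite 3 => C * prof (xiOf ℓ k) δ 2 u := (summable_prof hξ hξ1 hδ hδ1 (le_refl 2)).mul_left C
  have hg : Summable fun w : ZSite 3 => 3 * (C * prof (xiOf ℓ k) δ 3 w) * (C₃ * (xiOf ℓ k)⁻¹) :=
    (((summable_prof_three hξ hξ1 hδ hδ1).mul_left C).mul_left 3).mul_right _
  refine Summable.of_norm_bounded (summable_shear hf hg y') fun p => ?_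
  rw [Real.norm_eq_abs, abs_mul]
  have h1 : |dFstKernelZ (xiOf ℓ k)⁻¹ μ (GxiL ℓ k a m2) y' p.1| ≤ C * prof (xiOf ℓ k) δ 2 (y' - p.1) := hG1 μ y' p.1
  have h2 := abs_bubbleZ_le_of_laws hξ hδ₃.le (zero_le_one.trans hC₃) hG2 hG₃ p.1 p.2
  exact mul_le_mul h1 h2 (abs_nonneg _) ((abs_nonneg _).trans h1)

/-- kernel: the permuted graphs (2.21b), (2.21g) with `G^ξ_k(0)`-lines vanish individually (summed difference quotients; the
summability from the same laws). [cite: Balaban1983Higgs3, (3.36) p.444] -/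
theorem coeff336Z_221bgPerm_GxiL_eq_zero (hℓ : 1 ≤ ℓ) {k : ℕ} (hk : 1 ≤ k) {a m2 a₃ m2₃ : ℝ} (ha : 0 < a) (hm : 0 ≤ m2)
    (ha₃ : 0 < a₃) (hm₃ : 0 ≤ m2₃) (μ : Fin (2 + 1)) (y' : Fin (2 + 1) → ℤ) :
    coeff336Z (xiOf ℓ k) (gamma221bPerm (d := 2) (xiOf ℓ k) (GxiL ℓ k a m2) (GxiL ℓ k a m2) (GxiL ℓ k a₃ m2₃)) μ y' = 0 ∧
      coeff336Z (xiOf ℓ k) (gamma221gPerm (d := 2) (xiOf ℓ k) (GxiL ℓ k a m2) (GxiL ℓ k a m2) (GxiL ℓ k a₃ m2₃)) μ y' = 0 := by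
  obtain ⟨δ, C, hδ, hδh, hC, hlaw⟩ := exists_laws hℓ a a m2 ha
  obtain ⟨hG, -, -, hG2, -⟩ := hlaw k hk a m2 le_rfl le_rfl hm le_rfl
  obtain ⟨δ₃, C₃, hδ₃, hδ₃h, hC₃, hlaw₃⟩ := exists_laws hℓ a₃ a₃ m2₃ ha₃
  obtain ⟨hG₃, -⟩ := hlaw₃ k hk a₃ m2₃ le_rfl le_rfl hm₃ le_rfl
  have hξ : 0 < xiOf ℓ k := xiOf_pos ℓ k
  have hξ1 : xiOf ℓ k ≤ 1 := xiOf_le_one ℓ k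
  have hδ1 : δ ≤ 1 := hδh.trans (by norm_num)
  have hC0 : 0 ≤ C := zero_le_one.trans hC
  -- the rows / columns of `G` are summable
  have hrow : ∀ x : ZSite 3, Summable fun z : ZSite 3 => GxiL ℓ k a m2 x z := fun x =>
    Summable.of_norm_bounded ((summable_prof_sub hξ hξ1 hδ hδ1 (by norm_num : 1 ≤ 2) x).mul_left C) fun z => by
      rw [Real.norm_eq_abs]; exact hG x z
  have hcol : Summable fun x : ZSite 3 => GxiL ℓ k a m2 x y' :=
    Summable.of_norm_bounded ((summable_prof_sub hξ hξ1 hδ hδ1 (by norm_num : 1 ≤ 2) y').mul_left C) fun x => by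
      rw [Real.norm_eq_abs, prof_sub_comm]; exact hG x y'
  have hB := abs_bubbleZ_le_of_laws hξ hδ₃.le (zero_le_one.trans hC₃) hG2 hG₃
  refine ⟨coeff336Z_221bPerm_eq_zero (xiOf ℓ k) hξ.ne' _ _ _ μ y' (fun x => ?_) ?_,
    coeff336Z_221gPerm_eq_zero (xiOf ℓ k) hξ.ne' _ _ _ μ y' hcol⟩
  · -- `z ↦ G(x,z)·B(z,y′)`: summable row × bounded bubble
    refine summable_of_mul_bdd (3 * (C * ((xiOf ℓ k) ^ 3)⁻¹) * (C₃ * (xiOf ℓ k)⁻¹)) (hrow x) fun z => (hB z y').trans ?_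
    gcongr
    exact prof_le_inv_pow hξ hδ.le 3 _
  · -- `x ↦ Σ_z ξ³ G(x,z)B(z,y′)`: from the summable product family `(x,z) ↦ ξ³G(x,z)B(z,y′)` (sheared profiles)
    have hf : Summable fun u : ZSite 3 => C * prof (xiOf ℓ k) δ 1 u := (summable_prof hξ hξ1 hδ hδ1 (by norm_num : 1 ≤ 2)).mul_left C
    have hg : Summable fun w : ZSite 3 => 3 * (C * prof (xiOf ℓ k) δ 3 w) * (C₃ * (xiOf ℓ k)⁻¹) :=
      (((summable_prof_three hξ hξ1 hδ hδ1).mul_left C).mul_left 3).mul_right _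
    have hF0 : Summable fun p : ZSite 3 × ZSite 3 =>
        GxiL ℓ k a m2 p.1 p.2 * bubbleZ (xiOf ℓ k) (GxiL ℓ k a m2) (GxiL ℓ k a₃ m2₃) p.2 y' := by
      refine Summable.of_norm_bounded (summable_shear₂ hf hg y') fun p => ?_
      rw [Real.norm_eq_abs, abs_mul]
      exact mul_le_mul (hG p.1 p.2) (hB p.2 y') (abs_nonneg _) ((abs_nonneg _).trans (hG p.1 p.2))
    have hF : Summable fun p : ZSite 3 × ZSite 3 =>
        xiOf ℓ k ^ (2 + 1) * (GxiL ℓ k a m2 p.1 p.2 * bubbleZ (xiOf ℓ k) (GxiL ℓ k a m2) (GxiL ℓ k a₃ m2₃) p.2 y') :=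
      hF0.mul_left _
    exact hF.prod

end GxiLInstance

/-! # PART II (p32 gen 30, p351979) — see the second module docstring above -/

open Finset Filter
open scoped Topology
open B3Eq322ZeroLattice (d1KernelZ)
open B3CxiPropagator (summable_Cxi Cxi_nonneg abs_Cxi_le)

/-! ## §1 The factor `Σ_{x,x″} η^{2d} Γ′_μ(x,x′,x″)` of (3.36) and the vertex delta -/

/-- The vertex delta `η^{−d}δ_{x,x′}` of the normal form (3.33) for graphs whose external vector leg and one external scalar leg sit
at the same vertex ((2.18), (2.19), (2.21)): a kernel density w.r.t. `Σ_x η^d`. [cite: Balaban1983Higgs3, (3.33) p.443] -/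
def vtxZ (η : ℝ) (x x' : Fin (d + 1) → ℤ) : ℝ := if x = x' then (η ^ (d + 1))⁻¹ else 0

/-- **The factor `Σ_{x,x″} η^{2d} Γ′_μ(x,x′,x″)` of (3.36)** p. 444 — *"with the summations unrestricted"*: the iterated lattice sums
over all of `ℤ^{d+1}` (`tsum`), for the scalar part `Γ` of the kernel, at the vertex `x′` and the direction `μ` — PART II's name for
PART I's `coeff336Z` (the same double sum; kept as an abbreviation so that the declarations of p351979 keep their statements).
[cite: Balaban1983Higgs3, (3.36) p.444] -/
abbrev locFactorZ (η : ℝ) (Γ : SKernel3Z d) (μ : Fin (d + 1)) (x' : Fin (d + 1) → ℤ) : ℝ :=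
  coeff336Z η Γ μ x'

/-- kernel: `η^{2d}·η^{−d} = η^d`. [folklore] -/
private theorem pow_two_mul_mul_inv {η : ℝ} (hη : η ≠ 0) : η ^ (2 * (d + 1)) * (η ^ (d + 1))⁻¹ = η ^ (d + 1) := by
  rw [two_mul, pow_add, mul_assoc, mul_inv_cancel₀ (pow_ne_zero _ hη), mul_one]

/-- kernel: `η^{2d}·(η^{−d}K) = η^d K`. [folklore] -/
private theorem pow_two_mul_mul_inv_mul {η : ℝ} (hη : η ≠ 0) (K : ℝ) :
    η ^ (2 * (d + 1)) * ((η ^ (d + 1))⁻¹ * K) = η ^ (d + 1) * K := by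
  rw [← mul_assoc, pow_two_mul_mul_inv hη]

/-- kernel: when the vector leg shares its vertex with the leg `φ′` (`Γ_μ(x,x′,x″) = η^{−d}δ_{x,x′}·K(x,x″)`) the `x`-sum of the
factor collapses: `Σ_{x,x″}η^{2d}Γ = Σ_{x″}η^d K(x′,x″)` (no convergence needed). [cite: Balaban1983Higgs3, (3.36) p.444] -/
theorem locFactorZ_of_vtx_left {η : ℝ} (hη : η ≠ 0) {Γ : SKernel3Z d} {μ : Fin (d + 1)} {x' : Fin (d + 1) → ℤ}
    (K : (Fin (d + 1) → ℤ) → (Fin (d + 1) → ℤ) → ℝ) (hΓ : ∀ x x'', Γ μ x x' x'' = vtxZ η x x' * K x x'') :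
    locFactorZ η Γ μ x' = ∑' x'' : Fin (d + 1) → ℤ, η ^ (d + 1) * K x' x'' := by
  unfold locFactorZ coeff336Z
  have h1 : ∀ x : Fin (d + 1) → ℤ, ∑' x'' : Fin (d + 1) → ℤ, η ^ (2 * (d + 1)) * Γ μ x x' x'' =
      if x = x' then ∑' x'' : Fin (d + 1) → ℤ, η ^ (d + 1) * K x x'' else 0 := by
    intro x
    split_ifs with hx
    · refine tsum_congr fun x'' => ?_
      rw [hΓ, vtxZ, if_pos hx, ← mul_assoc, pow_two_mul_mul_inv hη]
    · have h0 : ∀ x'', η ^ (2 * (d + 1)) * Γ μ x x' x'' = 0 := fun x'' => by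
        rw [hΓ, vtxZ, if_neg hx, zero_mul, mul_zero]
      simp only [h0, tsum_zero]
  simp only [h1]
  exact tsum_ite_eq x' _

/-- kernel: when the vector leg shares its vertex with the leg `φ″` (`Γ_μ(x,x′,x″) = η^{−d}δ_{x,x″}·K(x)`, the line running from
`x = x″` to `x′`) the `x″`-sum collapses: `Σ_{x,x″}η^{2d}Γ = Σ_x η^d K(x)`. [cite: Balaban1983Higgs3, (3.36) p.444] -/
theorem locFactorZ_of_vtx_right {η : ℝ} (hη : η ≠ 0) {Γ : SKernel3Z d} {μ : Fin (d + 1)} {x' : Fin (d + 1) → ℤ}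
    (K : (Fin (d + 1) → ℤ) → ℝ) (hΓ : ∀ x x'', Γ μ x x' x'' = vtxZ η x x'' * K x) :
    locFactorZ η Γ μ x' = ∑' x : Fin (d + 1) → ℤ, η ^ (d + 1) * K x := by
  unfold locFactorZ coeff336Z
  refine tsum_congr fun x => ?_
  have h1 : ∀ x'' : Fin (d + 1) → ℤ, η ^ (2 * (d + 1)) * Γ μ x x' x'' = if x = x'' then η ^ (d + 1) * K x else 0 := by
    intro x''
    rw [hΓ, vtxZ]
    split_ifs with hx
    · rw [← mul_assoc, pow_two_mul_mul_inv hη]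
    · rw [zero_mul, mul_zero]
  simp only [h1]
  exact tsum_ite_eq' x _

/-- kernel: the factor is additive in the kernel when both summands have convergent factors (inner sums summable for every `x`,
outer sums summable). [cite: Balaban1983Higgs3, (3.36) p.444] -/
theorem locFactorZ_add {η : ℝ} {Γ₁ Γ₂ : SKernel3Z d} {μ : Fin (d + 1)} {x' : Fin (d + 1) → ℤ}
    (h1 : ∀ x, Summable fun x'' : Fin (d + 1) → ℤ => η ^ (2 * (d + 1)) * Γ₁ μ x x' x'')
    (h2 : ∀ x, Summable fun x'' : Fin (d + 1) → ℤ => η ^ (2 * (d + 1)) * Γ₂ μ x x' x'')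
    (h1' : Summable fun x : Fin (d + 1) → ℤ => ∑' x'' : Fin (d + 1) → ℤ, η ^ (2 * (d + 1)) * Γ₁ μ x x' x'')
    (h2' : Summable fun x : Fin (d + 1) → ℤ => ∑' x'' : Fin (d + 1) → ℤ, η ^ (2 * (d + 1)) * Γ₂ μ x x' x'') :
    locFactorZ η (fun ν x y x'' => Γ₁ ν x y x'' + Γ₂ ν x y x'') μ x' = locFactorZ η Γ₁ μ x' + locFactorZ η Γ₂ μ x' := by
  unfold locFactorZ coeff336Z
  rw [← h1'.tsum_add h2']
  refine tsum_congr fun x => ?_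
  rw [← (h1 x).tsum_add (h2 x)]
  exact tsum_congr fun x'' => by ring

/-! ## §2 The class (2.18): *"the same expressions but with the opposite signs"* -/

section Graphs218F

/-- **The first graph of (2.18)** p. 429 as a three-point kernel in the normal form (3.33), scalar part: the external vector leg
`A_μ` and the scalar leg `φ′` at the same vertex `x = x′` (a vertex (1.8) with `n + n′ = 2`: both its vector legs on the bond at
`x′` in the direction `μ`, its differentiated scalar leg internal), the vertex of `φ″` at `x″` (a vertex (1.8) with `n + n′ = 1`,
differentiated leg internal, bond direction `= μ` through the vector line); lines: the scalar propagator differentiated at both ends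
`(∂^η_μ G_s ∂^{η*}_μ)(x′,x″)` (p26's `dKernelZ`) and the vector propagator `G_v(x′,x″)`:
`Γ^{(2.18)a}_μ(x,x′,x″) = η^{−d}δ_{x,x′}·(∂^η_μG_s∂^{η*}_μ)(x′,x″)G_v(x′,x″)`. [cite: Balaban1983Higgs3, (2.18) p.429] -/
def gamma218aZ (η : ℝ) (Gs Gv : KernelZ d) : SKernel3Z d :=
  fun μ x x' x'' => vtxZ η x x' * (dKernelZ η⁻¹ μ Gs x' x'' * Gv x' x'')

/-- **The second graph of (2.18)** (the first with the external scalar legs permuted — the classes are *"symmetric with respect to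
permutation of external scalar field legs"*, p. 429): `A_μ` and `φ″` at the same vertex `x = x″`, `φ′` at `x′`, the line pair running
from `x` to `x′`: `Γ^{(2.18)b}_μ(x,x′,x″) = η^{−d}δ_{x,x″}·(∂^η_μG_s∂^{η*}_μ)(x,x′)G_v(x,x′)`. [cite: Balaban1983Higgs3, (2.18) p.429] -/
def gamma218bZ (η : ℝ) (Gs Gv : KernelZ d) : SKernel3Z d :=
  fun μ x x' x'' => vtxZ η x x'' * (dKernelZ η⁻¹ μ Gs x x' * Gv x x')

/-- **The class (2.18)** in the normal form (3.33) `φ′(x′)·Γ_μ φ″(x″)`, scalar part: `Γ^{(2.18)} = Γ^{(2.18)a} − Γ^{(2.18)b}`.  The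
relative sign is print's *"the opposite signs"* (p. 444) and comes from the antisymmetry of the charge matrix `q`: the first graph
pairs `⟨q²φ′(x′), qφ″(x″)⟩ = ⟨φ′(x′), q³φ″(x″)⟩`, the second `⟨q²φ″(x″), qφ′(x′)⟩ = −⟨φ′(x′), q³φ″(x″)⟩` (`inner_pairing218a/b`
below); the common operator `q³` and the common real constant of the class are factored out. [cite: Balaban1983Higgs3, (2.18) p.429; p.444] -/
def gamma218Z (η : ℝ) (Gs Gv : KernelZ d) : SKernel3Z d :=
  fun μ x x' x'' => gamma218aZ η Gs Gv μ x x' x'' - gamma218bZ η Gs Gv μ x x' x''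

variable {W : Type*} [NormedAddCommGroup W] [InnerProductSpace ℝ W]

/-- kernel (the sign of the first graph of (2.18)): for an antisymmetric charge matrix `q`, the vertex pairings `⟨q²φ′, qφ″⟩` of the
first graph read `⟨φ′, q³φ″⟩` in the normal form (3.33). [cite: Balaban1983Higgs3, (1.8) p.413; (3.33) p.443] -/
theorem inner_pairing218a (q : W →ₗ[ℝ] W) (hq : ∀ u v : W, ⟪q u, v⟫ = -⟪u, q v⟫) (a b : W) :
    ⟪q (q a), q b⟫ = ⟪a, q (q (q b))⟫ := by
  rw [hq, hq, neg_neg]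

/-- kernel (the sign of the second graph of (2.18)): with the scalar legs permuted the pairing `⟨q²φ″, qφ′⟩` reads `−⟨φ′, q³φ″⟩` —
*"the same expressions but with the opposite signs"*. [cite: Balaban1983Higgs3, (1.8) p.413; p.444] -/
theorem inner_pairing218b (q : W →ₗ[ℝ] W) (hq : ∀ u v : W, ⟪q u, v⟫ = -⟪u, q v⟫) (a b : W) :
    ⟪q (q b), q a⟫ = -⟪a, q (q (q b))⟫ := by
  rw [real_inner_comm, hq]

variable {η : ℝ} {Gs Gv : KernelZ d} {μ : Fin (d + 1)} {x' : Fin (d + 1) → ℤ}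

/-- kernel: the factor of the first graph of (2.18): `Σ_{x″} η^d (∂^η_μG_s∂^{η*}_μ)(x′,x″)G_v(x′,x″)`. [cite: Balaban1983Higgs3, (2.18) p.429; (3.36) p.444] -/
theorem locFactorZ_gamma218aZ (hη : η ≠ 0) :
    locFactorZ η (gamma218aZ η Gs Gv) μ x' =
      ∑' x'' : Fin (d + 1) → ℤ, η ^ (d + 1) * (dKernelZ η⁻¹ μ Gs x' x'' * Gv x' x'') :=
  locFactorZ_of_vtx_left hη (fun _ x'' => dKernelZ η⁻¹ μ Gs x' x'' * Gv x' x'') fun _ _ => rfl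

/-- kernel: the factor of the second graph of (2.18): `Σ_x η^d (∂^η_μG_s∂^{η*}_μ)(x,x′)G_v(x,x′)`. [cite: Balaban1983Higgs3, (2.18) p.429; (3.36) p.444] -/
theorem locFactorZ_gamma218bZ (hη : η ≠ 0) :
    locFactorZ η (gamma218bZ η Gs Gv) μ x' =
      ∑' x : Fin (d + 1) → ℤ, η ^ (d + 1) * (dKernelZ η⁻¹ μ Gs x x' * Gv x x') :=
  locFactorZ_of_vtx_right hη (fun x => dKernelZ η⁻¹ μ Gs x x' * Gv x x') fun _ _ => rfl

/-- kernel: the doubly differentiated kernel of a symmetric propagator is symmetric. [cite: Balaban1983Higgs3, (3.9) p.435] -/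
theorem dKernelZ_comm_of_symm (c : ℝ) (ν : Fin (d + 1)) {G : KernelZ d} (hG : ∀ x y, G x y = G y x)
    (x y : Fin (d + 1) → ℤ) : dKernelZ c ν G x y = dKernelZ c ν G y x := by
  simp only [dKernelZ]
  rw [hG (x + _) (y + _), hG (x + _) y, hG x (y + _), hG x y]
  ring

/-- **p. 444, the graphs (2.18): *"they correspond to the same expressions"*** — for SYMMETRIC propagators `G_s`, `G_v` (the
zero-field propagators `G^η_{j₀}(0)`, `G^η_{j₀}` of the resummed class are symmetric) the factors `Σ_{x,x″}η^{2d}Γ′_μ` of the two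
graphs of (2.18) are EQUAL, term by term; no convergence and no translation invariance is needed.
[cite: Balaban1983Higgs3, p.444 (the sentence on the graphs (2.18))] -/
theorem locFactorZ_gamma218aZ_eq_gamma218bZ (hη : η ≠ 0) (hGs : ∀ x y, Gs x y = Gs y x) (hGv : ∀ x y, Gv x y = Gv y x) :
    locFactorZ η (gamma218aZ η Gs Gv) μ x' = locFactorZ η (gamma218bZ η Gs Gv) μ x' := by
  rw [locFactorZ_gamma218aZ hη, locFactorZ_gamma218bZ hη]
  exact tsum_congr fun u => by rw [dKernelZ_comm_of_symm _ _ hGs x' u, hGv x' u]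

/-- **p. 444, verbatim: *"It vanishes also for the graphs (2.18) because they correspond to the same expressions but with the
opposite signs."*** — PROVED for the class kernel `Γ^{(2.18)} = Γ^{(2.18)a} − Γ^{(2.18)b}`: for symmetric propagators whose line pair
`x″ ↦ (∂^η_μG_s∂^{η*}_μ)(x′,x″)G_v(x′,x″)` is summable over `ℤ^{d+1}`, `Σ_{x,x″}η^{2d}Γ^{(2.18)}_μ(x,x′,x″) = 0` for every `x′`, `μ`.
[cite: Balaban1983Higgs3, p.444 (the sentence on the graphs (2.18))] -/
theorem locFactorZ_gamma218Z_eq_zero (hη : η ≠ 0) (hGs : ∀ x y, Gs x y = Gs y x) (hGv : ∀ x y, Gv x y = Gv y x)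
    (hrow : Summable fun x'' : Fin (d + 1) → ℤ => dKernelZ η⁻¹ μ Gs x' x'' * Gv x' x'') :
    locFactorZ η (gamma218Z η Gs Gv) μ x' = 0 := by
  have hcol : Summable fun x : Fin (d + 1) → ℤ => dKernelZ η⁻¹ μ Gs x x' * Gv x x' :=
    hrow.congr fun u => by rw [dKernelZ_comm_of_symm _ _ hGs x' u, hGv x' u]
  -- the factor of the class is the difference of the two factors
  have hsplit : locFactorZ η (gamma218Z η Gs Gv) μ x' =
      locFactorZ η (gamma218aZ η Gs Gv) μ x' + locFactorZ η (fun ν x y x'' => -gamma218bZ η Gs Gv ν x y x'') μ x' := by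
    have h := locFactorZ_add (η := η) (μ := μ) (x' := x') (Γ₁ := gamma218aZ η Gs Gv)
      (Γ₂ := fun ν x y x'' => -gamma218bZ η Gs Gv ν x y x'') ?_ ?_ ?_ ?_
    · have hdef : gamma218Z η Gs Gv = fun ν x y x'' => gamma218aZ η Gs Gv ν x y x'' + -gamma218bZ η Gs Gv ν x y x'' := by
        funext ν x y x''; rw [gamma218Z, sub_eq_add_neg]
      rw [hdef]; exact h
    · intro x
      by_cases hx : x = x'
      · refine (hrow.mul_left (η ^ (2 * (d + 1)) * (η ^ (d + 1))⁻¹)).congr fun x'' => ?_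
        subst hx
        simp only [gamma218aZ, vtxZ, if_true]
        ring
      · refine summable_zero.congr fun x'' => ?_
        simp only [gamma218aZ, vtxZ, if_neg hx, zero_mul, mul_zero]
    · intro x
      refine summable_of_ne_finset_zero (s := {x}) fun x'' hx'' => ?_
      rw [Finset.mem_singleton] at hx''
      simp only [gamma218bZ, vtxZ, if_neg (Ne.symm hx''), zero_mul, neg_zero, mul_zero]
    · refine summable_of_ne_finset_zero (s := {x'}) fun x hx => ?_
      rw [Finset.mem_singleton] at hx
      have h0 : ∀ x'', η ^ (2 * (d + 1)) * gamma218aZ η Gs Gv μ x x' x'' = 0 := fun x'' => by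
        simp only [gamma218aZ, vtxZ, if_neg hx, zero_mul, mul_zero]
      simp only [h0, tsum_zero]
    · have hK : ∀ x, ∑' x'' : Fin (d + 1) → ℤ, η ^ (2 * (d + 1)) * -gamma218bZ η Gs Gv μ x x' x'' =
          -(η ^ (d + 1) * (dKernelZ η⁻¹ μ Gs x x' * Gv x x')) := by
        intro x
        have h1 : ∀ x'' : Fin (d + 1) → ℤ, η ^ (2 * (d + 1)) * -gamma218bZ η Gs Gv μ x x' x'' =
            if x = x'' then -(η ^ (d + 1) * (dKernelZ η⁻¹ μ Gs x x' * Gv x x')) else 0 := by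
          intro x''
          simp only [gamma218bZ, vtxZ]
          split_ifs with h
          · rw [mul_neg, pow_two_mul_mul_inv_mul hη]
          · ring
        simp only [h1]
        exact tsum_ite_eq' x _
      simp only [hK]
      exact (hcol.mul_left (η ^ (d + 1))).neg
  rw [hsplit, locFactorZ_gamma218aZ_eq_gamma218bZ hη hGs hGv, locFactorZ_gamma218bZ hη]
  have hneg : locFactorZ η (fun ν x y x'' => -gamma218bZ η Gs Gv ν x y x'') μ x' =
      ∑' x : Fin (d + 1) → ℤ, η ^ (d + 1) * -(dKernelZ η⁻¹ μ Gs x x' * Gv x x') :=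
    locFactorZ_of_vtx_right hη (fun x => -(dKernelZ η⁻¹ μ Gs x x' * Gv x x')) fun x x'' => by
      simp only [gamma218bZ]; ring
  have h2 : ∑' x : Fin (d + 1) → ℤ, η ^ (d + 1) * -(dKernelZ η⁻¹ μ Gs x x' * Gv x x') =
      -∑' x : Fin (d + 1) → ℤ, η ^ (d + 1) * (dKernelZ η⁻¹ μ Gs x x' * Gv x x') := by
    rw [← tsum_neg]; exact tsum_congr fun x => by ring
  rw [hneg, h2, add_neg_cancel]

end Graphs218F

/-! ## §3 The graphs (2.21b) and (2.21g): *"with the proper renormalization mass counterterm"* -/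

section Graphs221bgF

/-- **The graph (2.21b)** p. 430 as a three-point kernel in the normal form (3.33), scalar part: the external vector leg `A_μ` and the
leg `φ′` at the vertex `x = x′` (a vertex (1.8), `n + n′ = 1`, its differentiated leg the internal line towards the inner vertex `z`:
`(∂^η_μG₁)(x′,z)`, p40's `d1KernelZ`), at `z` a second vertex (1.8) whose undifferentiated leg receives that line and whose
differentiated leg opens the loop, closed at the vertex of `φ″` at `x″` — the loop is the scalar self-energy subgraph of (3.6)/(3.9)
(the fourth picture of (3.18)): `Σ(z,x″) = Σ_ν(∂^η_νG₂∂^{η*}_ν)(z,x″)·G₃(z,x″)`, p26's `coeff39Z` with unit localizations (*"moving all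
localization functions to the corresponding vertex"*, p. 444):
`Γ^{(2.21)b}_μ(x,x′,x″) = η^{−d}δ_{x,x′}·Σ_z η^d (∂^η_μG₁)(x′,z)Σ(z,x″)` (inner vertex summed over all of `ℤ^{d+1}`).
[cite: Balaban1983Higgs3, (2.21) p.430; (3.9) p.435] -/
def gamma221bZ (η : ℝ) (G₁ G₂ G₃ : KernelZ d) : SKernel3Z d :=
  fun μ x x' x'' => vtxZ η x x' *
    ∑' z : Fin (d + 1) → ℤ, η ^ (d + 1) * (d1KernelZ η⁻¹ μ G₁ x' z * coeff39Z η G₂ G₃ 1 1 z x'')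

/-- **The renormalization mass counterterm of the self-energy subgraph of (2.21b)** — p. 438, verbatim: *"If Σ(x,x′) is an expression
corresponding to any such graph, then we have a graph with mass renormalization counterterm of the form −Σ_{x′}η^dΣ(x,x′)"*; p. 430:
*"so we take one counterterm for each graph"*: `δm²(w) = Σ_{x″} η^d Σ(w,x″)` with the summation unrestricted (the coefficient of the
counterterm term of (3.9), p26's `B3Ineq313Lattice.counterTerm39Z`, at unit localizations). [cite: Balaban1983Higgs3, p.438 (before (3.19)); (2.21) p.430] -/
def massCT39Z (η : ℝ) (G₂ G₃ : KernelZ d) (w : Fin (d + 1) → ℤ) : ℝ :=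
  ∑' x'' : Fin (d + 1) → ℤ, η ^ (d + 1) * coeff39Z η G₂ G₃ 1 1 w x''

/-- **The graph (2.21g)** p. 430 (the mass-counterterm vertex `δm²` of (1.7) on the line) as a three-point kernel, scalar part, for a
counterterm function `ct` at the vertex of `φ″`: `Γ^{(2.21)g}_μ(x,x′,x″) = η^{−d}δ_{x,x′}·(∂^η_μG₁)(x′,x″)·ct(x″)`.
[cite: Balaban1983Higgs3, (2.21) p.430; (1.7) p.413] -/
def gamma221gZ (η : ℝ) (G₁ : KernelZ d) (ct : (Fin (d + 1) → ℤ) → ℝ) : SKernel3Z d :=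
  fun μ x x' x'' => vtxZ η x x' * (d1KernelZ η⁻¹ μ G₁ x' x'' * ct x'')

variable {η : ℝ} {G₁ G₂ G₃ : KernelZ d} {μ : Fin (d + 1)} {x' : Fin (d + 1) → ℤ}

/-- kernel: the factor of (2.21b): `Σ_{x″}η^d Σ_z η^d (∂^η_μG₁)(x′,z)Σ(z,x″)`. [cite: Balaban1983Higgs3, (2.21) p.430; (3.36) p.444] -/
theorem locFactorZ_gamma221bZ (hη : η ≠ 0) :
    locFactorZ η (gamma221bZ η G₁ G₂ G₃) μ x' = ∑' x'' : Fin (d + 1) → ℤ, η ^ (d + 1) *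
      ∑' z : Fin (d + 1) → ℤ, η ^ (d + 1) * (d1KernelZ η⁻¹ μ G₁ x' z * coeff39Z η G₂ G₃ 1 1 z x'') :=
  locFactorZ_of_vtx_left hη
    (fun _ x'' => ∑' z : Fin (d + 1) → ℤ, η ^ (d + 1) * (d1KernelZ η⁻¹ μ G₁ x' z * coeff39Z η G₂ G₃ 1 1 z x''))
    fun _ _ => rfl

/-- kernel: the factor of (2.21g): `Σ_{x″}η^d (∂^η_μG₁)(x′,x″)ct(x″)`. [cite: Balaban1983Higgs3, (2.21) p.430; (3.36) p.444] -/
theorem locFactorZ_gamma221gZ (hη : η ≠ 0) (ct : (Fin (d + 1) → ℤ) → ℝ) :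
    locFactorZ η (gamma221gZ η G₁ ct) μ x' =
      ∑' x'' : Fin (d + 1) → ℤ, η ^ (d + 1) * (d1KernelZ η⁻¹ μ G₁ x' x'' * ct x'') :=
  locFactorZ_of_vtx_left hη (fun _ x'' => d1KernelZ η⁻¹ μ G₁ x' x'' * ct x'') fun _ _ => rfl

/-- **p. 444, verbatim: *"Now we can analyze the factor Σ_{x,x″} η^{2d}Γ′_μ(x,x′,x″) for all the renormalized classes. It is easily
seen that it vanishes for the graphs (2.21b) and (2.21g) with the proper renormalization mass counterterm."*** — PROVED: with the
counterterm of p. 438 for the self-energy subgraph of (2.21b), `ct = −δm²`, `δm²(w) = Σ_{x″}η^dΣ(w,x″)` (`massCT39Z`), the factors of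
(2.21b) and (2.21g) cancel, `Σ_{x,x″}η^{2d}Γ^{(2.21)b}_μ + Σ_{x,x″}η^{2d}Γ^{(2.21)g}_μ = 0` at every vertex `x′` and direction `μ`, for ANY
propagators `G₁`, `G₂`, `G₃` whose double family `(z,x″) ↦ (∂^η_μG₁)(x′,z)Σ(z,x″)` is summable (the exchange of the `z`- and
`x″`-sums); no symmetry and no translation invariance is used — as in print, where this sentence precedes the passage to the scale
`ξ` and to `C^ξ`. [cite: Balaban1983Higgs3, p.444 (the sentence on the graphs (2.21b), (2.21g)); p.438] -/
theorem locFactorZ_gamma221bZ_add_gamma221gZ (hη : η ≠ 0)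
    (hF : Summable fun p : (Fin (d + 1) → ℤ) × (Fin (d + 1) → ℤ) =>
      d1KernelZ η⁻¹ μ G₁ x' p.1 * coeff39Z η G₂ G₃ 1 1 p.1 p.2) :
    locFactorZ η (gamma221bZ η G₁ G₂ G₃) μ x' +
      locFactorZ η (gamma221gZ η G₁ fun w => -massCT39Z η G₂ G₃ w) μ x' = 0 := by
  rw [locFactorZ_gamma221bZ hη, locFactorZ_gamma221gZ hη]
  set c : ℝ := η ^ (d + 1) * η ^ (d + 1) with hc
  have hF' : Summable (Function.uncurry fun z x'' : Fin (d + 1) → ℤ =>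
      c * (d1KernelZ η⁻¹ μ G₁ x' z * coeff39Z η G₂ G₃ 1 1 z x'')) :=
    hF.mul_left c
  have h1 : (∑' x'' : Fin (d + 1) → ℤ, η ^ (d + 1) *
        ∑' z : Fin (d + 1) → ℤ, η ^ (d + 1) * (d1KernelZ η⁻¹ μ G₁ x' z * coeff39Z η G₂ G₃ 1 1 z x'')) =
      ∑' x'' : Fin (d + 1) → ℤ, ∑' z : Fin (d + 1) → ℤ,
        c * (d1KernelZ η⁻¹ μ G₁ x' z * coeff39Z η G₂ G₃ 1 1 z x'') := by
    refine tsum_congr fun x'' => ?_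
    rw [← tsum_mul_left]
    exact tsum_congr fun z => by rw [hc]; ring
  have h2 : (∑' x'' : Fin (d + 1) → ℤ, η ^ (d + 1) *
        (d1KernelZ η⁻¹ μ G₁ x' x'' * -massCT39Z η G₂ G₃ x'')) =
      -∑' z : Fin (d + 1) → ℤ, ∑' x'' : Fin (d + 1) → ℤ,
        c * (d1KernelZ η⁻¹ μ G₁ x' z * coeff39Z η G₂ G₃ 1 1 z x'') := by
    rw [← tsum_neg]
    refine tsum_congr fun z => ?_
    have hz : (∑' x'' : Fin (d + 1) → ℤ, c * (d1KernelZ η⁻¹ μ G₁ x' z * coeff39Z η G₂ G₃ 1 1 z x'')) =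
        (c * d1KernelZ η⁻¹ μ G₁ x' z) * ∑' x'' : Fin (d + 1) → ℤ, coeff39Z η G₂ G₃ 1 1 z x'' := by
      rw [← tsum_mul_left]; exact tsum_congr fun x'' => by ring
    rw [massCT39Z, tsum_mul_left (a := η ^ (d + 1)) (f := fun u => coeff39Z η G₂ G₃ 1 1 z u), hz, hc]
    ring
  rw [h1, h2, hF'.tsum_comm]
  exact add_neg_cancel _

/-- kernel: the same cancellation for the kernel of the pair, `Γ^{(2.21)b} + Γ^{(2.21)g}` (with `ct = −δm²`), when in addition each
inner `x″`-sum converges. [cite: Balaban1983Higgs3, p.444 (the sentence on the graphs (2.21b), (2.21g))] -/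
theorem locFactorZ_gamma221bZ_gamma221gZ_eq_zero (hη : η ≠ 0)
    (hF : Summable fun p : (Fin (d + 1) → ℤ) × (Fin (d + 1) → ℤ) =>
      d1KernelZ η⁻¹ μ G₁ x' p.1 * coeff39Z η G₂ G₃ 1 1 p.1 p.2) :
    locFactorZ η (fun ν x y x'' => gamma221bZ η G₁ G₂ G₃ ν x y x'' +
      gamma221gZ η G₁ (fun w => -massCT39Z η G₂ G₃ w) ν x y x'') μ x' = 0 := by
  -- the kernel of the pair is again of the vertex-delta form; collapse the `x`-sum and split the convergent `x″`-sum
  have hb : Summable fun x'' : Fin (d + 1) → ℤ => η ^ (d + 1) *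
      ∑' z : Fin (d + 1) → ℤ, η ^ (d + 1) * (d1KernelZ η⁻¹ μ G₁ x' z * coeff39Z η G₂ G₃ 1 1 z x'') :=
    ((hF.mul_left (η ^ (d + 1))).prod_symm.prod).mul_left (η ^ (d + 1))
  have hg : Summable fun x'' : Fin (d + 1) → ℤ => η ^ (d + 1) *
      (d1KernelZ η⁻¹ μ G₁ x' x'' * -massCT39Z η G₂ G₃ x'') := by
    refine (((hF.mul_left (η ^ (d + 1))).prod).mul_left (-(η ^ (d + 1)))).congr fun z => ?_
    dsimp only
    have hz : (∑' u : Fin (d + 1) → ℤ, η ^ (d + 1) * (d1KernelZ η⁻¹ μ G₁ x' z * coeff39Z η G₂ G₃ 1 1 z u)) =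
        (η ^ (d + 1) * d1KernelZ η⁻¹ μ G₁ x' z) * ∑' u : Fin (d + 1) → ℤ, coeff39Z η G₂ G₃ 1 1 z u := by
      rw [← tsum_mul_left]; exact tsum_congr fun u => by ring
    rw [hz, massCT39Z, tsum_mul_left (a := η ^ (d + 1)) (f := fun u => coeff39Z η G₂ G₃ 1 1 z u)]
    ring
  rw [locFactorZ_of_vtx_left hη (fun _ x'' =>
      (∑' z : Fin (d + 1) → ℤ, η ^ (d + 1) * (d1KernelZ η⁻¹ μ G₁ x' z * coeff39Z η G₂ G₃ 1 1 z x'')) +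
        d1KernelZ η⁻¹ μ G₁ x' x'' * -massCT39Z η G₂ G₃ x'') fun x x'' => by
      simp only [gamma221bZ, gamma221gZ]; ring]
  have hsplit : (∑' x'' : Fin (d + 1) → ℤ, η ^ (d + 1) *
      ((∑' z : Fin (d + 1) → ℤ, η ^ (d + 1) * (d1KernelZ η⁻¹ μ G₁ x' z * coeff39Z η G₂ G₃ 1 1 z x'')) +
        d1KernelZ η⁻¹ μ G₁ x' x'' * -massCT39Z η G₂ G₃ x'')) =
      locFactorZ η (gamma221bZ η G₁ G₂ G₃) μ x' +
        locFactorZ η (gamma221gZ η G₁ fun w => -massCT39Z η G₂ G₃ w) μ x' := by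
    rw [locFactorZ_gamma221bZ hη, locFactorZ_gamma221gZ hη, ← hb.tsum_add hg]
    exact tsum_congr fun x'' => by ring
  rw [hsplit]
  exact locFactorZ_gamma221bZ_add_gamma221gZ hη hF

end Graphs221bgF

/-! ## §4 The graph (2.21c): *"by translation invariance … a derivative of a constant"* -/

section Graph221cF

/-- **The graph (2.21c)** p. 430 as a three-point kernel in the normal form (3.33), scalar part: as (2.21b) but with the inner vertex's
derivative on the INCOMING line and only one derivative on the loop — `A_μ`, `φ′` at `x = x′` (vertex (1.8), differentiated leg the
line to the inner vertex `z`), at `z` a vertex (1.8) with bond direction `ν` whose differentiated leg is that same line,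
`(∂^η_μG₁∂^{η*}_ν)(x′,z)` (p39's `d2KernelZ`), and whose undifferentiated leg opens the loop; the loop closes at the vertex of `φ″` at
`x″` (vertex (1.8), bond direction `ν` through the vector line, differentiated leg on the loop): scalar line `(G₂∂^{η*}_ν)(z,x″)` (p39's
`dAdjKernelZ`) and vector line `G₃(z,x″)`:
`Γ^{(2.21)c}_μ(x,x′,x″) = η^{−d}δ_{x,x′}·Σ_z η^d Σ_ν (∂^η_μG₁∂^{η*}_ν)(x′,z)(G₂∂^{η*}_ν)(z,x″)G₃(z,x″)`.
[cite: Balaban1983Higgs3, (2.21) p.430] -/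
def gamma221cZ (η : ℝ) (G₁ G₂ G₃ : KernelZ d) : SKernel3Z d :=
  fun μ x x' x'' => vtxZ η x x' * ∑' z : Fin (d + 1) → ℤ, η ^ (d + 1) *
    ∑ ν : Fin (d + 1), d2KernelZ η⁻¹ μ ν G₁ x' z * (dAdjKernelZ η⁻¹ ν G₂ z x'' * G₃ z x'')

variable {η : ℝ} {G₁ G₂ G₃ : KernelZ d} {μ : Fin (d + 1)} {x' : Fin (d + 1) → ℤ}

/-- kernel: the factor of (2.21c): `Σ_{x″}η^dΣ_zη^dΣ_ν(∂^η_μG₁∂^{η*}_ν)(x′,z)(G₂∂^{η*}_ν)(z,x″)G₃(z,x″)`.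
[cite: Balaban1983Higgs3, (2.21) p.430; (3.36) p.444] -/
theorem locFactorZ_gamma221cZ (hη : η ≠ 0) :
    locFactorZ η (gamma221cZ η G₁ G₂ G₃) μ x' = ∑' x'' : Fin (d + 1) → ℤ, η ^ (d + 1) *
      ∑' z : Fin (d + 1) → ℤ, η ^ (d + 1) *
        ∑ ν : Fin (d + 1), d2KernelZ η⁻¹ μ ν G₁ x' z * (dAdjKernelZ η⁻¹ ν G₂ z x'' * G₃ z x'') :=
  locFactorZ_of_vtx_left hη (fun _ x'' => ∑' z : Fin (d + 1) → ℤ, η ^ (d + 1) *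
    ∑ ν : Fin (d + 1), d2KernelZ η⁻¹ μ ν G₁ x' z * (dAdjKernelZ η⁻¹ ν G₂ z x'' * G₃ z x'')) fun _ _ => rfl

/-- kernel (translation invariance of the loop): for propagators that are functions of the difference, `G₂(z,u) = F₂(u − z)`,
`G₃(z,u) = F₃(u − z)`, the loop sum `Σ_{x″}(G₂∂^{η*}_ν)(z,x″)G₃(z,x″)` does not depend on the vertex `z`.
[cite: Balaban1983Higgs3, p.444 (the sentence on the graph (2.21c))] -/
theorem tsum_loop221c_translate {F₂ F₃ : (Fin (d + 1) → ℤ) → ℝ} (h₂ : ∀ z u, G₂ z u = F₂ (u - z))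
    (h₃ : ∀ z u, G₃ z u = F₃ (u - z)) (c : ℝ) (ν : Fin (d + 1)) (z : Fin (d + 1) → ℤ) :
    ∑' x'' : Fin (d + 1) → ℤ, dAdjKernelZ c ν G₂ z x'' * G₃ z x'' =
      ∑' u : Fin (d + 1) → ℤ, c * (F₂ (u + Pi.single ν 1) - F₂ u) * F₃ u := by
  rw [← Equiv.tsum_eq (Equiv.addRight z)]
  refine tsum_congr fun u => ?_
  simp only [Equiv.coe_addRight, dAdjKernelZ, h₂, h₃, add_sub_cancel_right]
  rw [show u + z + Pi.single ν 1 - z = u + Pi.single ν 1 by abel]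

/-- kernel (*"a derivative of a constant"*): for a propagator that is a summable function of the difference, `G₁(x,z) = F₁(z − x)`, the
`z`-sum of the mixed second difference `(∂^η_μG₁∂^{η*}_ν)(x′,z)` vanishes — it is `η^{−1}` times the difference of the two translated
sums `Σ_z η^d(∂^η_νF₁)(z − x′ − e_μ)` and `Σ_z η^d(∂^η_νF₁)(z − x′)`, each zero by r15's `tsum_pdiffZ_translate_eq_zero`.
[cite: Balaban1983Higgs3, p.444 (the sentence on the graph (2.21c))] -/
theorem tsum_d2KernelZ_translate_eq_zero {F₁ : (Fin (d + 1) → ℤ) → ℝ} (h₁ : ∀ x z, G₁ x z = F₁ (z - x)) (hF₁ : Summable F₁)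
    (η : ℝ) (μ ν : Fin (d + 1)) (x' : Fin (d + 1) → ℤ) :
    ∑' z : Fin (d + 1) → ℤ, η ^ (d + 1) * d2KernelZ η⁻¹ μ ν G₁ x' z = 0 := by
  -- pointwise: η^d(∂_μG₁∂*_ν)(x′,z) = η⁻¹[η^d(∂_νF₁)(z − (x′+e_μ)) − η^d(∂_νF₁)(z − x′)]
  have hpt : ∀ z : Fin (d + 1) → ℤ, η ^ (d + 1) * d2KernelZ η⁻¹ μ ν G₁ x' z =
      η⁻¹ * (η ^ (d + 1) * pdiffZ η⁻¹ ν F₁ (z - (x' + Pi.single μ 1))) -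
        η⁻¹ * (η ^ (d + 1) * pdiffZ η⁻¹ ν F₁ (z - x')) := by
    intro z
    have e1 : G₁ (x' + Pi.single μ 1) (z + Pi.single ν 1) = F₁ (z - (x' + Pi.single μ 1) + Pi.single ν 1) := by
      rw [h₁]; congr 1; abel
    have e2 : G₁ (x' + Pi.single μ 1) z = F₁ (z - (x' + Pi.single μ 1)) := h₁ _ _
    have e3 : G₁ x' (z + Pi.single ν 1) = F₁ (z - x' + Pi.single ν 1) := by
      rw [h₁]; congr 1; abel
    have e4 : G₁ x' z = F₁ (z - x') := h₁ _ _
    -- the four values of the propagator as real numbers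
    generalize hA : F₁ (z - (x' + Pi.single μ 1) + Pi.single ν 1) = A at e1
    generalize hB : F₁ (z - (x' + Pi.single μ 1)) = B at e2
    generalize hC : F₁ (z - x' + Pi.single ν 1) = C at e3
    generalize hD : F₁ (z - x') = D at e4
    simp only [d2KernelZ, pdiffZ, unitVec, e1, e2, e3, e4, hA, hB, hC, hD]
    ring
  have hs : ∀ w : Fin (d + 1) → ℤ, Summable fun z : Fin (d + 1) → ℤ => η ^ (d + 1) * pdiffZ η⁻¹ ν F₁ (z - w) := by
    intro w
    have hsh : Summable fun u : Fin (d + 1) → ℤ => F₁ (u + Pi.single ν 1) :=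
      (Equiv.addRight (Pi.single ν (1 : ℤ) : Fin (d + 1) → ℤ)).summable_iff.mpr hF₁
    have hd : Summable fun u : Fin (d + 1) → ℤ => η ^ (d + 1) * pdiffZ η⁻¹ ν F₁ u := by
      refine ((hsh.sub hF₁).mul_left (η ^ (d + 1) * η⁻¹)).congr fun u => ?_
      simp only [pdiffZ, unitVec]; ring
    exact (Equiv.subRight w).summable_iff.mpr hd
  rw [tsum_congr hpt, ((hs (x' + Pi.single μ 1)).mul_left η⁻¹).tsum_sub ((hs x').mul_left η⁻¹),
    tsum_mul_left (a := η⁻¹), tsum_mul_left (a := η⁻¹),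
    tsum_pdiffZ_translate_eq_zero η η⁻¹ ν F₁ hF₁ (x' + Pi.single μ 1),
    tsum_pdiffZ_translate_eq_zero η η⁻¹ ν F₁ hF₁ x', mul_zero, sub_self]

/-- **p. 444, verbatim: *"For the graph (2.21c) it equals 0 also because by translation invariance it can be written as a derivative
of a constant."*** — PROVED for the kernel `Γ^{(2.21)c}`: if the three propagators are functions of the difference of their arguments
(translation invariance — in print this is asserted after the passage to the scale `ξ` and the replacement of `G^η_{j₀}(0)`, `G^η_{j₀}` by
`C^ξ`; the instance for `C^ξ` is `locFactorZ_gamma221cZ_cxi_eq_zero` below), the profile of `G₁` is summable and the double families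
`(z,x″) ↦ (∂^η_μG₁∂^{η*}_ν)(x′,z)(G₂∂^{η*}_ν)(z,x″)G₃(z,x″)` are summable, then `Σ_{x,x″}η^{2d}Γ^{(2.21)c}_μ(x,x′,x″) = 0` for every `x′`, `μ`:
the loop sum is a constant `S_ν` (translation invariance, `tsum_loop221c_translate`) and the remaining `z`-sum
`Σ_z η^d(∂^η_μG₁∂^{η*}_ν)(x′,z)` is a derivative of a constant (`tsum_d2KernelZ_translate_eq_zero`, via r15's
`B3Sect3TriangleGraphs.tsum_pdiffZ_translate_eq_zero`). [cite: Balaban1983Higgs3, p.444 (the sentence on the graph (2.21c))] -/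
theorem locFactorZ_gamma221cZ_eq_zero (hη : η ≠ 0) {F₁ F₂ F₃ : (Fin (d + 1) → ℤ) → ℝ}
    (h₁ : ∀ x z, G₁ x z = F₁ (z - x)) (hF₁ : Summable F₁)
    (h₂ : ∀ z u, G₂ z u = F₂ (u - z)) (h₃ : ∀ z u, G₃ z u = F₃ (u - z))
    (hF : ∀ ν, Summable fun p : (Fin (d + 1) → ℤ) × (Fin (d + 1) → ℤ) =>
      d2KernelZ η⁻¹ μ ν G₁ x' p.1 * (dAdjKernelZ η⁻¹ ν G₂ p.1 p.2 * G₃ p.1 p.2)) :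
    locFactorZ η (gamma221cZ η G₁ G₂ G₃) μ x' = 0 := by
  rw [locFactorZ_gamma221cZ hη]
  set c : ℝ := η ^ (d + 1) * η ^ (d + 1) with hc
  -- the summable double families, one for each loop direction ν
  have hT : ∀ ν, Summable (Function.uncurry fun z x'' : Fin (d + 1) → ℤ =>
      c * (d2KernelZ η⁻¹ μ ν G₁ x' z * (dAdjKernelZ η⁻¹ ν G₂ z x'' * G₃ z x''))) := fun ν => (hF ν).mul_left c
  -- the fibres and the marginals of the double families, in the form the rewriting lemmas need
  have hTz : ∀ (ν : Fin (d + 1)) (x'' : Fin (d + 1) → ℤ), Summable fun z : Fin (d + 1) → ℤ =>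
      c * (d2KernelZ η⁻¹ μ ν G₁ x' z * (dAdjKernelZ η⁻¹ ν G₂ z x'' * G₃ z x'')) :=
    fun ν x'' => (hT ν).prod_symm.prod_factor x''
  have hTx : ∀ ν : Fin (d + 1), Summable fun x'' : Fin (d + 1) → ℤ => ∑' z : Fin (d + 1) → ℤ,
      c * (d2KernelZ η⁻¹ μ ν G₁ x' z * (dAdjKernelZ η⁻¹ ν G₂ z x'' * G₃ z x'')) :=
    fun ν => (hT ν).prod_symm.prod
  -- Step A: bring the finite ν-sum outside both lattice sums
  have hinner : ∀ x'' : Fin (d + 1) → ℤ, η ^ (d + 1) * (∑' z : Fin (d + 1) → ℤ, η ^ (d + 1) *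
      ∑ ν : Fin (d + 1), d2KernelZ η⁻¹ μ ν G₁ x' z * (dAdjKernelZ η⁻¹ ν G₂ z x'' * G₃ z x'')) =
      ∑ ν : Fin (d + 1), ∑' z : Fin (d + 1) → ℤ,
        c * (d2KernelZ η⁻¹ μ ν G₁ x' z * (dAdjKernelZ η⁻¹ ν G₂ z x'' * G₃ z x'')) := by
    intro x''
    rw [← tsum_mul_left, ← Summable.tsum_finsetSum (fun ν _ => hTz ν x'')]
    refine tsum_congr fun z => ?_
    rw [Finset.mul_sum, Finset.mul_sum]
    exact Finset.sum_congr rfl fun ν _ => by rw [hc]; ring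
  rw [tsum_congr hinner, Summable.tsum_finsetSum (fun ν _ => hTx ν)]
  refine Finset.sum_eq_zero fun ν _ => ?_
  -- Step B: exchange the two lattice sums, evaluate the loop (a constant) and the derivative of a constant
  have hswap : (∑' x'' : Fin (d + 1) → ℤ, ∑' z : Fin (d + 1) → ℤ,
      c * (d2KernelZ η⁻¹ μ ν G₁ x' z * (dAdjKernelZ η⁻¹ ν G₂ z x'' * G₃ z x''))) =
      ∑' z : Fin (d + 1) → ℤ, ∑' x'' : Fin (d + 1) → ℤ,
        c * (d2KernelZ η⁻¹ μ ν G₁ x' z * (dAdjKernelZ η⁻¹ ν G₂ z x'' * G₃ z x'')) := (hT ν).tsum_comm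
  have hz : ∀ z : Fin (d + 1) → ℤ, ∑' x'' : Fin (d + 1) → ℤ,
      c * (d2KernelZ η⁻¹ μ ν G₁ x' z * (dAdjKernelZ η⁻¹ ν G₂ z x'' * G₃ z x'')) =
      (η ^ (d + 1) * d2KernelZ η⁻¹ μ ν G₁ x' z) *
        (η ^ (d + 1) * ∑' u : Fin (d + 1) → ℤ, η⁻¹ * (F₂ (u + Pi.single ν 1) - F₂ u) * F₃ u) := by
    intro z
    rw [← tsum_loop221c_translate h₂ h₃ η⁻¹ ν z, ← tsum_mul_left, ← tsum_mul_left]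
    exact tsum_congr fun x'' => by rw [hc]; ring
  rw [hswap, tsum_congr hz, tsum_mul_right, tsum_d2KernelZ_translate_eq_zero h₁ hF₁ η μ ν x', zero_mul]

end Graph221cF

/-! ## §5 Instances: the three statements for the propagator `C^ξ` on `ξℤ^{d+1}` (all slots `C^ξ`), hypothesis-free -/

section InstancesCxi

/-- The two-variable (convolution) kernel of a function of the difference on `ℤ^{d+1}`, `(x,x′) ↦ F(x − x′)` — the general-dimension
twin of p39's `B3Eq337ZeroLattice.convK` (`ℤ³`); for `F = C^ξ` (r15's `B3Sect3VectorSelfEnergy.Cxi`) it is the propagator `C^ξ` of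
p. 444 *"Now we replace the propagators G^η_{j₀}(0), G^η_{j₀} by C^ξ"* as a two-variable kernel. [cite: Balaban1983Higgs3, (3.37) p.444] -/
def convKZ (F : (Fin (d + 1) → ℤ) → ℝ) : KernelZ d := fun x x' => F (x - x')

variable {F : (Fin (d + 1) → ℤ) → ℝ}

/-- kernel: an even profile gives a symmetric kernel. [cite: Balaban1983Higgs3, (3.27) p.441] -/
theorem convKZ_comm (hF : ∀ u, F (-u) = F u) (x y : Fin (d + 1) → ℤ) : convKZ F x y = convKZ F y x := by
  unfold convKZ; rw [← hF, neg_sub]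

/-- kernel: an even profile read from the second variable: `convKZ F x z = F(z − x)`. [cite: Balaban1983Higgs3, (3.27) p.441] -/
theorem convKZ_eq_sub (hF : ∀ u, F (-u) = F u) (x z : Fin (d + 1) → ℤ) : convKZ F x z = F (z - x) := by
  unfold convKZ; rw [← hF, neg_sub]

/-- kernel: translates and reflections of a summable profile are summable. [folklore] -/
private theorem summable_sub_left (hF : Summable F) (v : Fin (d + 1) → ℤ) : Summable fun a : Fin (d + 1) → ℤ => F (v - a) :=
  (Equiv.subLeft v).summable_iff.2 hF

/-- kernel (Fubini majorant): for summable non-negative profiles `A`, `B` the sheared product `(z,u) ↦ A(z − x′)B(u − z)` is summable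
on `ℤ^{d+1} × ℤ^{d+1}`. [folklore] -/
private theorem summable_shear_sub {A B : (Fin (d + 1) → ℤ) → ℝ} (hA : Summable A) (hB : Summable B) (hA0 : ∀ a, 0 ≤ A a)
    (hB0 : ∀ b, 0 ≤ B b) (x' : Fin (d + 1) → ℤ) :
    Summable fun p : (Fin (d + 1) → ℤ) × (Fin (d + 1) → ℤ) => A (p.1 - x') * B (p.2 - p.1) := by
  let e : (Fin (d + 1) → ℤ) × (Fin (d + 1) → ℤ) ≃ (Fin (d + 1) → ℤ) × (Fin (d + 1) → ℤ) :=
    { toFun := fun p => (p.1 - x', p.2 - p.1)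
      invFun := fun q => (q.1 + x', q.2 + (q.1 + x'))
      left_inv := fun p => by ext <;> simp
      right_inv := fun q => by ext <;> simp }
  have h := hA.mul_of_nonneg hB (fun a => hA0 a) (fun b => hB0 b)
  exact (e.summable_iff (f := fun q : (Fin (d + 1) → ℤ) × (Fin (d + 1) → ℤ) => A q.1 * B q.2)).2 h

variable {ξ : ℝ}

/-- kernel: the bound `|C^ξ| ≤ ξ^{−(d+1)}` at a translated argument (p39's `B3CxiPropagator.abs_Cxi_le`). [cite: Balaban1983Higgs3, (3.16) p.437] -/
private theorem cxi_le_bound (hξ : 0 < ξ) (u : Fin (d + 1) → ℤ) : Cxi (d + 1) ξ u ≤ ξ⁻¹ ^ (d + 1) :=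
  (le_abs_self _).trans (abs_Cxi_le hξ u)

/-- **p. 444, the graphs (2.18), for `C^ξ`** — with both propagator slots the propagator `C^ξ` of p. 444 on `ξℤ^{d+1}` (any `d`, any
`ξ > 0`) the factor of the class (2.18) vanishes, no hypothesis left: `Σ_{x,x″}ξ^{2d}Γ^{(2.18)}_μ[C^ξ,C^ξ](x,x′,x″) = 0`.
[cite: Balaban1983Higgs3, p.444 (the sentence on the graphs (2.18))] -/
theorem locFactorZ_gamma218Z_cxi_eq_zero (hξ : 0 < ξ) (μ : Fin (d + 1)) (x' : Fin (d + 1) → ℤ) :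
    locFactorZ ξ (gamma218Z ξ (convKZ (Cxi (d + 1) ξ)) (convKZ (Cxi (d + 1) ξ))) μ x' = 0 := by
  have hev : ∀ u : Fin (d + 1) → ℤ, Cxi (d + 1) ξ (-u) = Cxi (d + 1) ξ u := fun u => Cxi_neg ξ u
  refine locFactorZ_gamma218Z_eq_zero hξ.ne' (convKZ_comm hev) (convKZ_comm hev) ?_
  -- the row `u ↦ (∂_μC∂*_μ)(x′,u)C(x′,u)` is summable: the second difference is bounded by `4ξ^{−2}ξ^{−(d+1)}`
  have hs : Summable fun u : Fin (d + 1) → ℤ => ξ⁻¹ ^ 2 * (4 * ξ⁻¹ ^ (d + 1)) * Cxi (d + 1) ξ (x' - u) :=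
    (summable_sub_left (summable_Cxi hξ) x').mul_left _
  refine Summable.of_norm_bounded hs fun u => ?_
  rw [Real.norm_eq_abs, abs_mul]
  have hC0 : 0 ≤ Cxi (d + 1) ξ (x' - u) := Cxi_nonneg hξ _
  have h2 : |dKernelZ ξ⁻¹ μ (convKZ (Cxi (d + 1) ξ)) x' u| ≤ ξ⁻¹ ^ 2 * (4 * ξ⁻¹ ^ (d + 1)) := by
    simp only [dKernelZ, convKZ]
    rw [abs_mul, abs_of_nonneg (by positivity : (0 : ℝ) ≤ ξ⁻¹ ^ 2)]
    refine mul_le_mul_of_nonneg_left ?_ (by positivity)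
    have b1 := cxi_le_bound hξ (x' + Pi.single μ 1 - (u + Pi.single μ 1))
    have b2 := cxi_le_bound hξ (x' + Pi.single μ 1 - u)
    have b3 := cxi_le_bound hξ (x' - (u + Pi.single μ 1))
    have b4 := cxi_le_bound hξ (x' - u)
    have c1 := Cxi_nonneg hξ (x' + Pi.single μ 1 - (u + Pi.single μ 1))
    have c2 := Cxi_nonneg hξ (x' + Pi.single μ 1 - u)
    have c3 := Cxi_nonneg hξ (x' - (u + Pi.single μ 1))
    rw [abs_le]; constructor <;> linarith
  calc |dKernelZ ξ⁻¹ μ (convKZ (Cxi (d + 1) ξ)) x' u| * |convKZ (Cxi (d + 1) ξ) x' u|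
      ≤ ξ⁻¹ ^ 2 * (4 * ξ⁻¹ ^ (d + 1)) * |convKZ (Cxi (d + 1) ξ) x' u| :=
        mul_le_mul_of_nonneg_right h2 (abs_nonneg _)
    _ = ξ⁻¹ ^ 2 * (4 * ξ⁻¹ ^ (d + 1)) * Cxi (d + 1) ξ (x' - u) := by rw [convKZ, abs_of_nonneg hC0]

/-- **p. 444, the graphs (2.21b) and (2.21g), for `C^ξ`** — with all three propagator slots `C^ξ` on `ξℤ^{d+1}` (any `d`, `ξ > 0`) and
the counterterm `−δm²`, `δm²(w) = Σ_{x″}ξ^dΣ[C^ξ](w,x″)`, the factor of the pair vanishes, no hypothesis left.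
[cite: Balaban1983Higgs3, p.444 (the sentence on the graphs (2.21b), (2.21g)); p.438] -/
theorem locFactorZ_gamma221bZ_gamma221gZ_cxi_eq_zero (hξ : 0 < ξ) (μ : Fin (d + 1)) (x' : Fin (d + 1) → ℤ) :
    locFactorZ ξ (fun ν x y x'' =>
      gamma221bZ ξ (convKZ (Cxi (d + 1) ξ)) (convKZ (Cxi (d + 1) ξ)) (convKZ (Cxi (d + 1) ξ)) ν x y x'' +
        gamma221gZ ξ (convKZ (Cxi (d + 1) ξ))
          (fun w => -massCT39Z ξ (convKZ (Cxi (d + 1) ξ)) (convKZ (Cxi (d + 1) ξ)) w) ν x y x'') μ x' = 0 := by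
  refine locFactorZ_gamma221bZ_gamma221gZ_eq_zero hξ.ne' ?_
  -- Fubini majorant: |(∂_μC)(x′,z)| ≤ ξ⁻¹(C(e_μ − (z−x′)) + C(−(z−x′))), |Σ[C](z,u)| ≤ (d+1)·4ξ^{−2}ξ^{−(d+1)}·C(−(u−z))
  have hC0 : ∀ u, 0 ≤ Cxi (d + 1) ξ u := fun u => Cxi_nonneg hξ u
  have hCs : Summable (Cxi (d + 1) ξ) := summable_Cxi hξ
  set A : (Fin (d + 1) → ℤ) → ℝ := fun a => ξ⁻¹ * (Cxi (d + 1) ξ (Pi.single μ 1 - a) + Cxi (d + 1) ξ (-a)) with hA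
  set B : (Fin (d + 1) → ℤ) → ℝ := fun b =>
    ((d + 1 : ℕ) : ℝ) * (ξ⁻¹ ^ 2 * (4 * ξ⁻¹ ^ (d + 1))) * Cxi (d + 1) ξ (-b) with hB
  have hA0 : ∀ a, 0 ≤ A a := fun a => by
    rw [hA]; exact mul_nonneg (inv_nonneg.2 hξ.le) (add_nonneg (hC0 _) (hC0 _))
  have hB0 : ∀ b, 0 ≤ B b := fun b => by rw [hB]; exact mul_nonneg (by positivity) (hC0 _)
  have hrefl : Summable fun a : Fin (d + 1) → ℤ => Cxi (d + 1) ξ (-a) :=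
    (summable_sub_left hCs 0).congr fun a => by rw [zero_sub]
  have hAs : Summable A := ((summable_sub_left hCs _).add hrefl).mul_left _
  have hBs : Summable B := hrefl.mul_left _
  refine Summable.of_norm_bounded (summable_shear_sub hAs hBs hA0 hB0 x') fun p => ?_
  rw [Real.norm_eq_abs, abs_mul]
  refine mul_le_mul ?_ ?_ (abs_nonneg _) (hA0 _)
  · -- the differentiated line
    simp only [d1KernelZ, convKZ, hA]
    rw [abs_mul, abs_of_nonneg (inv_nonneg.2 hξ.le)]
    refine mul_le_mul_of_nonneg_left ?_ (inv_nonneg.2 hξ.le)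
    rw [show x' + Pi.single μ 1 - p.1 = Pi.single μ 1 - (p.1 - x') by abel, show x' - p.1 = -(p.1 - x') by abel]
    have c1 := hC0 (Pi.single μ 1 - (p.1 - x'))
    have c2 := hC0 (-(p.1 - x'))
    rw [abs_le]; constructor <;> linarith
  · -- the self-energy loop of (3.9) with unit localizations
    simp only [coeff39Z, Pi.one_apply, mul_one, hB]
    rw [abs_mul]
    refine mul_le_mul ?_ ?_ (abs_nonneg _) (by positivity)
    · have hν : ∀ ν ∈ (Finset.univ : Finset (Fin (d + 1))),
          |dKernelZ ξ⁻¹ ν (convKZ (Cxi (d + 1) ξ)) p.1 p.2| ≤ ξ⁻¹ ^ 2 * (4 * ξ⁻¹ ^ (d + 1)) := by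
        intro ν _
        simp only [dKernelZ, convKZ]
        rw [abs_mul, abs_of_nonneg (by positivity : (0 : ℝ) ≤ ξ⁻¹ ^ 2)]
        refine mul_le_mul_of_nonneg_left ?_ (by positivity)
        have b1 := cxi_le_bound hξ (p.1 + Pi.single ν 1 - (p.2 + Pi.single ν 1))
        have b2 := cxi_le_bound hξ (p.1 + Pi.single ν 1 - p.2)
        have b3 := cxi_le_bound hξ (p.1 - (p.2 + Pi.single ν 1))
        have b4 := cxi_le_bound hξ (p.1 - p.2)
        have c1 := hC0 (p.1 + Pi.single ν 1 - (p.2 + Pi.single ν 1))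
        have c2 := hC0 (p.1 + Pi.single ν 1 - p.2)
        have c3 := hC0 (p.1 - (p.2 + Pi.single ν 1))
        have c4 := hC0 (p.1 - p.2)
        rw [abs_le]; constructor <;> linarith
      calc |∑ ν : Fin (d + 1), dKernelZ ξ⁻¹ ν (convKZ (Cxi (d + 1) ξ)) p.1 p.2|
          ≤ ∑ ν : Fin (d + 1), |dKernelZ ξ⁻¹ ν (convKZ (Cxi (d + 1) ξ)) p.1 p.2| := Finset.abs_sum_le_sum_abs _ _
        _ ≤ ∑ _ν : Fin (d + 1), ξ⁻¹ ^ 2 * (4 * ξ⁻¹ ^ (d + 1)) := Finset.sum_le_sum hν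
        _ = ((d + 1 : ℕ) : ℝ) * (ξ⁻¹ ^ 2 * (4 * ξ⁻¹ ^ (d + 1))) := by
          rw [Finset.sum_const, Finset.card_univ, Fintype.card_fin, nsmul_eq_mul]
    · rw [convKZ, show p.1 - p.2 = -(p.2 - p.1) by abel, abs_of_nonneg (hC0 _)]

/-- **p. 444, the graph (2.21c), for `C^ξ`, verbatim: *"For the graph (2.21c) it equals 0 also because by translation invariance it
can be written as a derivative of a constant."*** — with all three propagator slots the propagator `C^ξ` of p. 444 on `ξℤ^{d+1}` (any
`d`, any `ξ > 0`), no hypothesis left: `Σ_{x,x″}ξ^{2d}Γ^{(2.21)c}_μ[C^ξ,C^ξ,C^ξ](x,x′,x″) = 0` (translation invariance of `C^ξ`, its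
summability `B3CxiPropagator.summable_Cxi`, its evenness `Cxi_neg`). [cite: Balaban1983Higgs3, p.444 (the sentence on the graph (2.21c))] -/
theorem locFactorZ_gamma221cZ_cxi_eq_zero (hξ : 0 < ξ) (μ : Fin (d + 1)) (x' : Fin (d + 1) → ℤ) :
    locFactorZ ξ (gamma221cZ ξ (convKZ (Cxi (d + 1) ξ)) (convKZ (Cxi (d + 1) ξ)) (convKZ (Cxi (d + 1) ξ))) μ x' = 0 := by
  have hev : ∀ u : Fin (d + 1) → ℤ, Cxi (d + 1) ξ (-u) = Cxi (d + 1) ξ u := fun u => Cxi_neg ξ u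
  have hC0 : ∀ u, 0 ≤ Cxi (d + 1) ξ u := fun u => Cxi_nonneg hξ u
  have hCs : Summable (Cxi (d + 1) ξ) := summable_Cxi hξ
  refine locFactorZ_gamma221cZ_eq_zero hξ.ne' (F₁ := Cxi (d + 1) ξ) (F₂ := Cxi (d + 1) ξ) (F₃ := Cxi (d + 1) ξ)
    (convKZ_eq_sub hev) hCs (convKZ_eq_sub hev) (convKZ_eq_sub hev) fun ν => ?_
  -- Fubini majorant: four translates of C for the mixed second difference, two for the loop derivative, `C ≤ ξ^{−(d+1)}` on the loop
  set A : (Fin (d + 1) → ℤ) → ℝ := fun a => ξ⁻¹ ^ 2 *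
    (Cxi (d + 1) ξ (Pi.single μ 1 - Pi.single ν 1 - a) + Cxi (d + 1) ξ (Pi.single μ 1 - a) +
      Cxi (d + 1) ξ (-Pi.single ν 1 - a) + Cxi (d + 1) ξ (-a)) with hA
  set B : (Fin (d + 1) → ℤ) → ℝ := fun b =>
    ξ⁻¹ * (Cxi (d + 1) ξ (-Pi.single ν 1 - b) + Cxi (d + 1) ξ (-b)) * ξ⁻¹ ^ (d + 1) with hB
  have hA0 : ∀ a, 0 ≤ A a := fun a => by
    have c1 := hC0 (Pi.single μ 1 - Pi.single ν 1 - a)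
    have c2 := hC0 (Pi.single μ 1 - a)
    have c3 := hC0 (-Pi.single ν 1 - a)
    have c4 := hC0 (-a)
    rw [hA]; exact mul_nonneg (by positivity) (by linarith)
  have hB0 : ∀ b, 0 ≤ B b := fun b => by
    rw [hB]; exact mul_nonneg (mul_nonneg (inv_nonneg.2 hξ.le) (add_nonneg (hC0 _) (hC0 _))) (by positivity)
  have hrefl : Summable fun a : Fin (d + 1) → ℤ => Cxi (d + 1) ξ (-a) :=
    (summable_sub_left hCs 0).congr fun a => by rw [zero_sub]
  have hAs : Summable A :=
    ((((summable_sub_left hCs _).add (summable_sub_left hCs _)).add (summable_sub_left hCs _)).add hrefl).mul_left _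
  have hBs : Summable B := (((summable_sub_left hCs _).add hrefl).mul_left _).mul_right _
  refine Summable.of_norm_bounded (summable_shear_sub hAs hBs hA0 hB0 x') fun p => ?_
  rw [Real.norm_eq_abs, abs_mul]
  refine mul_le_mul ?_ ?_ (abs_nonneg _) (hA0 _)
  · simp only [d2KernelZ, convKZ, hA]
    rw [abs_mul, abs_of_nonneg (by positivity : (0 : ℝ) ≤ ξ⁻¹ ^ 2)]
    refine mul_le_mul_of_nonneg_left ?_ (by positivity)
    rw [show x' + Pi.single μ 1 - (p.1 + Pi.single ν 1) = Pi.single μ 1 - Pi.single ν 1 - (p.1 - x') by abel,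
      show x' + Pi.single μ 1 - p.1 = Pi.single μ 1 - (p.1 - x') by abel,
      show x' - (p.1 + Pi.single ν 1) = -Pi.single ν 1 - (p.1 - x') by abel,
      show x' - p.1 = -(p.1 - x') by abel]
    have c1 := hC0 (Pi.single μ 1 - Pi.single ν 1 - (p.1 - x'))
    have c2 := hC0 (Pi.single μ 1 - (p.1 - x'))
    have c3 := hC0 (-Pi.single ν 1 - (p.1 - x'))
    have c4 := hC0 (-(p.1 - x'))
    rw [abs_le]; constructor <;> linarith
  · simp only [dAdjKernelZ, convKZ, hB]
    rw [abs_mul, abs_mul, abs_of_nonneg (inv_nonneg.2 hξ.le)]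
    refine mul_le_mul ?_ ?_ (abs_nonneg _) (mul_nonneg (inv_nonneg.2 hξ.le) (add_nonneg (hC0 _) (hC0 _)))
    · refine mul_le_mul_of_nonneg_left ?_ (inv_nonneg.2 hξ.le)
      rw [show p.1 - (p.2 + Pi.single ν 1) = -Pi.single ν 1 - (p.2 - p.1) by abel,
        show p.1 - p.2 = -(p.2 - p.1) by abel]
      have c1 := hC0 (-Pi.single ν 1 - (p.2 - p.1))
      have c2 := hC0 (-(p.2 - p.1))
      rw [abs_le]; constructor <;> linarith
    · rw [abs_of_nonneg (hC0 _)]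
      exact cxi_le_bound hξ _

end InstancesCxi

/-! ## §6 Instances on the `η`-lattice: *"the same expressions"* for the pieces `G^η_{(j)}(0)` and the resummed `G^η_{j₀}(0)` -/

section InstancesEta

open B3Ineq314ZeroLattice (gpieceZ)
open B3Ineq210ZeroLattice (pieceLat_comm)
open B3Eq330EtaZeroLattice (GetaL GetaL_comm)

/-- **p. 444, the graphs (2.18), for the pieces of `G_k(0)` on `ηℤ^{d+1}`** — with the scalar line a piece `G^η_{(j)}(0)` and the
vector line a piece `G^η_{(j′)}` of p26's FILE C (`B3Ineq314ZeroLattice.gpieceZ`, symmetric by `B3Ineq210ZeroLattice.pieceLat_comm`),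
the factors of the two graphs of (2.18) are the same expression, for every `η ≠ 0`, with no further hypothesis.
[cite: Balaban1983Higgs3, p.444 (the sentence on the graphs (2.18)); (2.6) p.424] -/
theorem locFactorZ_gamma218aZ_eq_gamma218bZ_gpieceZ (ℓ k j j' : ℕ) (a m2 a' m2' : ℝ) {η : ℝ} (hη : η ≠ 0)
    (μ : Fin (d + 1)) (x' : Fin (d + 1) → ℤ) :
    locFactorZ η (gamma218aZ η (gpieceZ ℓ k j a m2) (gpieceZ ℓ k j' a' m2')) μ x' =
      locFactorZ η (gamma218bZ η (gpieceZ ℓ k j a m2) (gpieceZ ℓ k j' a' m2')) μ x' :=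
  locFactorZ_gamma218aZ_eq_gamma218bZ hη (fun x y => by simp only [gpieceZ, pieceLat_comm x y])
    (fun x y => by simp only [gpieceZ, pieceLat_comm x y])

/-- **p. 444, the graphs (2.18), for the resummed propagators `G^η_{j₀}(0)`, `G^η_{j₀′}` on `ηℤ³`** (p39's
`B3Eq330EtaZeroLattice.GetaL`, symmetric by `GetaL_comm`; *"we get the expressions of the same type but with propagators G^η_{j₀}(0),
G^η_{j₀}"*, p. 444): the factors of the two graphs of (2.18) are the same expression (`d = 3`, every `η ≠ 0`, no further hypothesis).
[cite: Balaban1983Higgs3, p.444 (the sentences on (3.36) and on the graphs (2.18))] -/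
theorem locFactorZ_gamma218aZ_eq_gamma218bZ_GetaL (ℓ j₀ j₀' k : ℕ) (a m2 a' m2' : ℝ) {η : ℝ} (hη : η ≠ 0)
    (μ : Fin 3) (x' : Fin 3 → ℤ) :
    locFactorZ (d := 2) η (gamma218aZ η (GetaL ℓ j₀ k a m2) (GetaL ℓ j₀' k a' m2')) μ x' =
      locFactorZ (d := 2) η (gamma218bZ η (GetaL ℓ j₀ k a m2) (GetaL ℓ j₀' k a' m2')) μ x' :=
  locFactorZ_gamma218aZ_eq_gamma218bZ hη (fun x y => by rw [GetaL_comm]) (fun x y => by rw [GetaL_comm])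

end InstancesEta

/-! ## §7 The local term (3.36) with unrestricted inner sums, and its vanishing for these classes -/

section Local336

variable {W : Type*} [NormedAddCommGroup W] [InnerProductSpace ℝ W]

/-- **(3.36)** p. 444 with its inner summations over `x`, `x″` UNRESTRICTED (over all of `ℤ^{d+1}`) and the kernel `Γ′_μ = Γs_μ • T_μ`
(scalar part `Γs`, charge-matrix factor `T_μ` on the internal indices):
`Σ_{x′∈Λ′} η^d Σ_μ locs(x′)A_μ(x′) φ′(x′)·(Σ_{x,x″}η^{2d}Γ′_μ(x,x′,x″)) φ″(x′)` — the companion of p39's finite-set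
`B3Eq334ZeroLattice.local336Z`, *"a product of the values of all the localization functions at the point x′"* = `locs x′`.
[cite: Balaban1983Higgs3, (3.36) p.444] -/
def local336InfZ (η : ℝ) (Γs : SKernel3Z d) (T : Fin (d + 1) → W →ₗ[ℝ] W) (locs : (Fin (d + 1) → ℤ) → ℝ)
    (A : Fin (d + 1) → (Fin (d + 1) → ℤ) → ℝ) (φ' φ'' : (Fin (d + 1) → ℤ) → W) (Λ' : Finset (Fin (d + 1) → ℤ)) : ℝ :=
  ∑ x' ∈ Λ', η ^ (d + 1) * ∑ μ : Fin (d + 1), locs x' * A μ x' * ⟪φ' x', (locFactorZ η Γs μ x' • T μ) (φ'' x')⟫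

variable {η : ℝ} {Γs : SKernel3Z d} {T : Fin (d + 1) → W →ₗ[ℝ] W} {locs : (Fin (d + 1) → ℤ) → ℝ}
  {A : Fin (d + 1) → (Fin (d + 1) → ℤ) → ℝ} {φ' φ'' : (Fin (d + 1) → ℤ) → W} {Λ' : Finset (Fin (d + 1) → ℤ)}

/-- kernel: the expression (3.36) vanishes as soon as the factor `Σ_{x,x″}η^{2d}Γ′_μ(x,x′,x″)` vanishes at every vertex `x′` of the
localization set and every direction `μ`. [cite: Balaban1983Higgs3, (3.36) p.444] -/
theorem local336InfZ_eq_zero (h : ∀ μ, ∀ x' ∈ Λ', locFactorZ η Γs μ x' = 0) :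
    local336InfZ η Γs T locs A φ' φ'' Λ' = 0 := by
  refine Finset.sum_eq_zero fun x' hx' => ?_
  rw [Finset.sum_eq_zero fun μ _ => ?_, mul_zero]
  rw [h μ x' hx', zero_smul, LinearMap.zero_apply, inner_zero_right, mul_zero]

variable {ξ : ℝ}

/-- **The expression (3.36) of the class (2.18) with the propagators `C^ξ` vanishes** (p. 444), for every charge-matrix factor, all
localizations and legs. [cite: Balaban1983Higgs3, (3.36) p.444; p.444 (the sentence on the graphs (2.18))] -/
theorem local336InfZ_gamma218Z_cxi (hξ : 0 < ξ) :
    local336InfZ ξ (gamma218Z ξ (convKZ (Cxi (d + 1) ξ)) (convKZ (Cxi (d + 1) ξ))) T locs A φ' φ'' Λ' = 0 :=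
  local336InfZ_eq_zero fun μ x' _ => locFactorZ_gamma218Z_cxi_eq_zero hξ μ x'

/-- **The expression (3.36) of the pair (2.21b) + (2.21g) (proper counterterm) with the propagators `C^ξ` vanishes** (p. 444).
[cite: Balaban1983Higgs3, (3.36) p.444; p.444 (the sentence on the graphs (2.21b), (2.21g))] -/
theorem local336InfZ_gamma221bZ_gamma221gZ_cxi (hξ : 0 < ξ) :
    local336InfZ ξ (fun ν x y x'' =>
      gamma221bZ ξ (convKZ (Cxi (d + 1) ξ)) (convKZ (Cxi (d + 1) ξ)) (convKZ (Cxi (d + 1) ξ)) ν x y x'' +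
        gamma221gZ ξ (convKZ (Cxi (d + 1) ξ))
          (fun w => -massCT39Z ξ (convKZ (Cxi (d + 1) ξ)) (convKZ (Cxi (d + 1) ξ)) w) ν x y x'') T locs A φ' φ'' Λ' = 0 :=
  local336InfZ_eq_zero fun μ x' _ => locFactorZ_gamma221bZ_gamma221gZ_cxi_eq_zero hξ μ x'

/-- **The expression (3.36) of the graph (2.21c) with the propagators `C^ξ` vanishes** (p. 444).
[cite: Balaban1983Higgs3, (3.36) p.444; p.444 (the sentence on the graph (2.21c))] -/
theorem local336InfZ_gamma221cZ_cxi (hξ : 0 < ξ) :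
    local336InfZ ξ (gamma221cZ ξ (convKZ (Cxi (d + 1) ξ)) (convKZ (Cxi (d + 1) ξ)) (convKZ (Cxi (d + 1) ξ)))
      T locs A φ' φ'' Λ' = 0 :=
  local336InfZ_eq_zero fun μ x' _ => locFactorZ_gamma221cZ_cxi_eq_zero hξ μ x'

end Local336

/-! ## §8 Bridge to p39's FILE 1 (`B3Eq334ZeroLattice`): the operator-valued kernels and the finite-set (3.36) -/

section Bridge334

open B3Eq334ZeroLattice (Kernel3Z local334Z local336Z)

variable {W : Type*} [NormedAddCommGroup W] [InnerProductSpace ℝ W]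

/-- The operator-valued three-point kernel of p39's `B3Eq334ZeroLattice.Kernel3Z` assembled from a scalar part `Γs` and the charge-matrix
factor `T_μ` on the internal indices: `Γ′_μ(x,x′,x″) = Γs_μ(x,x′,x″)·T_μ` (the shape of all the kernels of this file; cf. p39's
`triKernelZ`). [cite: Balaban1983Higgs3, (3.33) p.443] -/
def opKernel3Z (Γs : SKernel3Z d) (T : Fin (d + 1) → W →ₗ[ℝ] W) : Kernel3Z d W :=
  fun μ x x' x'' => Γs μ x x' x'' • T μ

variable {η : ℝ} {Γs : SKernel3Z d} {T : Fin (d + 1) → W →ₗ[ℝ] W} {locs : (Fin (d + 1) → ℤ) → ℝ}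
  {A : Fin (d + 1) → (Fin (d + 1) → ℤ) → ℝ} {φ' φ'' : (Fin (d + 1) → ℤ) → W}

/-- kernel: p39's finite-set (3.36) `local336Z` of such a kernel, in closed form — the finite double sum
`Σ_{x∈Λ}Σ_{x″∈Λ″}η^{2d}Γs_μ(x,x′,x″)` times `⟨φ′(x′), T_μφ″(x′)⟩`. [cite: Balaban1983Higgs3, (3.36) p.444] -/
theorem local336Z_opKernel3Z (Λ Λ' Λ'' : Finset (Fin (d + 1) → ℤ)) :
    local336Z η (opKernel3Z Γs T) locs A φ' φ'' Λ Λ' Λ'' =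
      ∑ x' ∈ Λ', η ^ (d + 1) * ∑ μ : Fin (d + 1), locs x' * A μ x' *
        ((∑ x ∈ Λ, ∑ x'' ∈ Λ'', η ^ (2 * (d + 1)) * Γs μ x x' x'') * ⟪φ' x', T μ (φ'' x')⟫) := by
  simp only [local336Z, local334Z, opKernel3Z, smul_smul, ← Finset.sum_smul, LinearMap.smul_apply,
    real_inner_smul_right]

/-- kernel: the unrestricted (3.36) of this file in the same closed form. [cite: Balaban1983Higgs3, (3.36) p.444] -/
theorem local336InfZ_eq (Λ' : Finset (Fin (d + 1) → ℤ)) :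
    local336InfZ η Γs T locs A φ' φ'' Λ' =
      ∑ x' ∈ Λ', η ^ (d + 1) * ∑ μ : Fin (d + 1), locs x' * A μ x' *
        (locFactorZ η Γs μ x' * ⟪φ' x', T μ (φ'' x')⟫) := by
  simp only [local336InfZ, LinearMap.smul_apply, real_inner_smul_right]

/-- **The finite-set (3.36) of p39's FILE 1 converges to the unrestricted (3.36)** as the two inner localization sets `Λ ∋ x`,
`Λ″ ∋ x″` exhaust `ℤ^{d+1}` (*"with the summations unrestricted"*, p. 444), whenever the double families
`(x,x″) ↦ η^{2d}Γs_μ(x,x′,x″)` are summable at the vertices `x′ ∈ Λ′`; so for the classes of this file the limit is `0`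
(`local336InfZ_gamma218Z_cxi`, `local336InfZ_gamma221bZ_gamma221gZ_cxi`, `local336InfZ_gamma221cZ_cxi`).
[cite: Balaban1983Higgs3, (3.36) p.444] -/
theorem tendsto_local336Z_opKernel3Z {Λ' : Finset (Fin (d + 1) → ℤ)}
    (hs : ∀ μ, ∀ x' ∈ Λ', Summable fun p : (Fin (d + 1) → ℤ) × (Fin (d + 1) → ℤ) => η ^ (2 * (d + 1)) * Γs μ p.1 x' p.2) :
    Tendsto (fun ΛΛ : Finset (Fin (d + 1) → ℤ) × Finset (Fin (d + 1) → ℤ) =>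
        local336Z η (opKernel3Z Γs T) locs A φ' φ'' ΛΛ.1 Λ' ΛΛ.2)
      atTop (𝓝 (local336InfZ η Γs T locs A φ' φ'' Λ')) := by
  simp only [local336Z_opKernel3Z, local336InfZ_eq]
  refine tendsto_finsetSum _ fun x' hx' => Tendsto.const_mul _ (tendsto_finsetSum _ fun μ _ => ?_)
  refine Tendsto.const_mul _ (Tendsto.mul_const _ ?_)
  -- the rectangle partial sums of a summable double family converge to its sum, which is the iterated sum
  have hsum := hs μ x' hx'
  have hlim : Tendsto (fun s : Finset ((Fin (d + 1) → ℤ) × (Fin (d + 1) → ℤ)) =>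
      ∑ p ∈ s, η ^ (2 * (d + 1)) * Γs μ p.1 x' p.2) atTop
      (𝓝 (∑' p : (Fin (d + 1) → ℤ) × (Fin (d + 1) → ℤ), η ^ (2 * (d + 1)) * Γs μ p.1 x' p.2)) :=
    hsum.hasSum
  rw [locFactorZ, coeff336Z, ← hsum.tsum_prod]
  refine (hlim.comp tendsto_finsetProd_atTop).congr fun ΛΛ => ?_
  simp only [Function.comp_apply]
  exact Finset.sum_product' ΛΛ.1 ΛΛ.2 (fun x x'' => η ^ (2 * (d + 1)) * Γs μ x x' x'')

end Bridge334

/-! ## §9 (v1.1, append-only) Instances for the resummed propagators `G^η_{j₀}(0)` on `ηℤ³` (p39's `GetaL`):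
the class (2.18) and the pair (2.21b)+(2.21g), hypotheses discharged -/

section InstancesGetaL

open B3Eq330EtaZeroLattice (GetaL GetaL_comm scale330 scale330_pos)
open B3Eq316ResolventZeroLattice (GxiL xiOf xiOf_pos xiOf_le_one summable_abs_GxiL abs_le_tsum_abs exists_GxiL_profile
  summable_profile_row summable_bdd_mul)
open B3CxiUniformBound (supNorm)

/-- **p. 444, the class (2.18), for the resummed propagators `G^η_{j₀}(0)`, `G^η_{j₀′}` on `ηℤ³`** (*"we get the expressions of the
same type but with propagators G^η_{j₀}(0), G^η_{j₀}"*; p39's `B3Eq330EtaZeroLattice.GetaL`, `L = ℓ + 1 ≥ 2`, `j₀, j₀′ ≥ 1`, parameters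
`a > 0`, `m² ≥ 0`): the factor of the class (2.18) VANISHES, the row-summability hypothesis of `locFactorZ_gamma218Z_eq_zero` discharged
(symmetry `GetaL_comm`; the second difference of `G^η_{j₀}(0)` is bounded along a row — its rows are absolutely summable,
`summable_abs_GxiL` — and the row of `G^η_{j₀′}` is absolutely summable). [cite: Balaban1983Higgs3, p.444 (the sentence on the graphs (2.18))] -/
theorem locFactorZ_gamma218Z_GetaL_eq_zero {ℓ j₀ j₀' : ℕ} (hℓ : 1 ≤ ℓ) (hj₀ : 1 ≤ j₀) (hj₀' : 1 ≤ j₀') (k : ℕ)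
    {a m2 a' m2' : ℝ} (ha : 0 < a) (hm : 0 ≤ m2) (ha' : 0 < a') (hm' : 0 ≤ m2') {η : ℝ} (hη : η ≠ 0)
    (μ : Fin 3) (x' : Fin 3 → ℤ) :
    locFactorZ (d := 2) η (gamma218Z η (GetaL ℓ j₀ k a m2) (GetaL ℓ j₀' k a' m2')) μ x' = 0 := by
  refine locFactorZ_gamma218Z_eq_zero hη (fun x y => by rw [GetaL_comm]) (fun x y => by rw [GetaL_comm]) ?_
  have hT : ∀ y : ZSite 3, Summable fun w : ZSite 3 => |GxiL ℓ j₀ a m2 y w| := fun y => summable_abs_GxiL hℓ hj₀ ha hm y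
  have hs0 : 0 < scale330 ℓ j₀ k := scale330_pos ℓ j₀ k
  have hGle : ∀ y w : ZSite 3, |GetaL ℓ j₀ k a m2 y w| ≤ (scale330 ℓ j₀ k)⁻¹ * ∑' v : ZSite 3, |GxiL ℓ j₀ a m2 y v| := by
    intro y w
    rw [GetaL, abs_mul, abs_of_pos (inv_pos.2 hs0)]
    exact mul_le_mul_of_nonneg_left (abs_le_tsum_abs (hT y) w) (inv_nonneg.2 hs0.le)
  refine summable_bdd_mul (B := η⁻¹ ^ 2 * ((scale330 ℓ j₀ k)⁻¹ * ∑' v : ZSite 3, |GxiL ℓ j₀ a m2 (x' + Pi.single μ 1) v| +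
      (scale330 ℓ j₀ k)⁻¹ * ∑' v : ZSite 3, |GxiL ℓ j₀ a m2 (x' + Pi.single μ 1) v| +
      (scale330 ℓ j₀ k)⁻¹ * ∑' v : ZSite 3, |GxiL ℓ j₀ a m2 x' v| +
      (scale330 ℓ j₀ k)⁻¹ * ∑' v : ZSite 3, |GxiL ℓ j₀ a m2 x' v|)) (fun z => ?_) ?_
  · simp only [dKernelZ]
    rw [abs_mul, abs_of_nonneg (by positivity : (0 : ℝ) ≤ η⁻¹ ^ 2)]
    refine mul_le_mul_of_nonneg_left ?_ (by positivity)
    have h1 := hGle (x' + Pi.single μ 1) (z + Pi.single μ 1)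
    have h2 := hGle (x' + Pi.single μ 1) z
    have h3 := hGle x' (z + Pi.single μ 1)
    have h4 := hGle x' z
    rw [abs_le] at h1 h2 h3 h4 ⊢
    constructor <;> linarith [h1.1, h1.2, h2.1, h2.2, h3.1, h3.2, h4.1, h4.2]
  · have h := (summable_abs_GxiL hℓ hj₀' ha' hm' x').mul_left |(scale330 ℓ j₀' k)⁻¹|
    refine h.congr fun z => ?_
    rw [GetaL, abs_mul]

/-- kernel: the printed profile `P^δ_1(u) = (ξ max(1,|u|_∞))^{−1}e^{−δξ|u|_∞}` of the laws of `G^ξ_{j₀}(0)` is at most `ξ^{−1}`.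
[cite: Balaban1983Higgs3, (3.16) p.437] -/
private theorem profile_one_le {ξ δ : ℝ} (hξ : 0 < ξ) (hδ : 0 ≤ δ) (u : ZSite 3) :
    ((ξ * max 1 (supNorm u : ℝ)) ^ 1)⁻¹ * Real.exp (-(δ * (ξ * (supNorm u : ℝ)))) ≤ ξ⁻¹ := by
  have hS : 0 ≤ (supNorm u : ℝ) := Nat.cast_nonneg _
  have h1 : ((ξ * max 1 (supNorm u : ℝ)) ^ 1)⁻¹ ≤ ξ⁻¹ := by
    rw [pow_one]
    exact inv_anti₀ hξ (le_mul_of_one_le_right hξ.le (le_max_left _ _))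
  have h2 : Real.exp (-(δ * (ξ * (supNorm u : ℝ)))) ≤ 1 := by
    rw [Real.exp_le_one_iff]; nlinarith [mul_nonneg hδ (mul_nonneg hξ.le hS)]
  calc ((ξ * max 1 (supNorm u : ℝ)) ^ 1)⁻¹ * Real.exp (-(δ * (ξ * (supNorm u : ℝ))))
      ≤ ξ⁻¹ * 1 := mul_le_mul h1 h2 (Real.exp_pos _).le (inv_nonneg.2 hξ.le)
    _ = ξ⁻¹ := mul_one _

/-- **p. 444, the graphs (2.21b) and (2.21g), for the resummed propagators on `ηℤ³`** — all three slots p39's `GetaL ℓ j₀ k aᵢ mᵢ²`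
(`L ≥ 2`, `j₀ ≥ 1`, `aᵢ > 0`, `mᵢ² ≥ 0`; independent parameters for the three lines), counterterm `−δm²` of p. 438: the factor of the
pair VANISHES, the Fubini hypothesis of `locFactorZ_gamma221bZ_gamma221gZ_eq_zero` discharged from the kernel laws of `G^ξ_{j₀}(0)` on the
infinite lattice (`B3Eq316ResolventZeroLattice.exists_GxiL_profile`: `|G| ≤ C·P^δ_1`, rows of the profile summable).
[cite: Balaban1983Higgs3, p.444 (the sentence on the graphs (2.21b), (2.21g)); p.438; (3.16) p.437] -/
theorem locFactorZ_gamma221bZ_gamma221gZ_GetaL_eq_zero {ℓ j₀ : ℕ} (hℓ : 1 ≤ ℓ) (hj₀ : 1 ≤ j₀) (k : ℕ)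
    {a₁ m₁ a₂ m₂ a₃ m₃ : ℝ} (ha₁ : 0 < a₁) (hm₁ : 0 ≤ m₁) (ha₂ : 0 < a₂) (hm₂ : 0 ≤ m₂) (ha₃ : 0 < a₃) (hm₃ : 0 ≤ m₃)
    {η : ℝ} (hη : η ≠ 0) (μ : Fin 3) (x' : Fin 3 → ℤ) :
    locFactorZ (d := 2) η (fun ν x y x'' =>
      gamma221bZ η (GetaL ℓ j₀ k a₁ m₁) (GetaL ℓ j₀ k a₂ m₂) (GetaL ℓ j₀ k a₃ m₃) ν x y x'' +
        gamma221gZ η (GetaL ℓ j₀ k a₁ m₁)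
          (fun w => -massCT39Z η (GetaL ℓ j₀ k a₂ m₂) (GetaL ℓ j₀ k a₃ m₃) w) ν x y x'') μ x' = 0 := by
  refine locFactorZ_gamma221bZ_gamma221gZ_eq_zero hη ?_
  -- the kernel laws of G^ξ_{j₀}(0) for the three parameter sets (first clause: |G(y,z)| ≤ C·P^δ_1(y − z))
  obtain ⟨δ₁, C₁, hδ₁, hδ₁h, hC₁, h₁⟩ := exists_GxiL_profile hℓ a₁ a₁ m₁ ha₁
  obtain ⟨hG₁, -, -⟩ := h₁ j₀ hj₀ a₁ m₁ le_rfl le_rfl hm₁ le_rfl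
  obtain ⟨δ₂, C₂, hδ₂, hδ₂h, hC₂, h₂⟩ := exists_GxiL_profile hℓ a₂ a₂ m₂ ha₂
  obtain ⟨hG₂, -, -⟩ := h₂ j₀ hj₀ a₂ m₂ le_rfl le_rfl hm₂ le_rfl
  obtain ⟨δ₃, C₃, hδ₃, hδ₃h, hC₃, h₃⟩ := exists_GxiL_profile hℓ a₃ a₃ m₃ ha₃
  obtain ⟨hG₃, -, -⟩ := h₃ j₀ hj₀ a₃ m₃ le_rfl le_rfl hm₃ le_rfl
  have hξ : 0 < xiOf ℓ j₀ := xiOf_pos ℓ j₀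
  have hξ1 : xiOf ℓ j₀ ≤ 1 := xiOf_le_one ℓ j₀
  have hs0 : 0 < scale330 ℓ j₀ k := scale330_pos ℓ j₀ k
  -- abbreviations: the profile of rate δ and the scale factors
  set P₁ : ZSite 3 → ℝ := fun u => ((xiOf ℓ j₀ * max 1 (supNorm u : ℝ)) ^ 1)⁻¹ *
    Real.exp (-(δ₁ * (xiOf ℓ j₀ * (supNorm u : ℝ)))) with hP₁
  set P₃ : ZSite 3 → ℝ := fun u => ((xiOf ℓ j₀ * max 1 (supNorm u : ℝ)) ^ 1)⁻¹ *
    Real.exp (-(δ₃ * (xiOf ℓ j₀ * (supNorm u : ℝ)))) with hP₃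
  have hP₁0 : ∀ u, 0 ≤ P₁ u := fun u => by rw [hP₁]; positivity
  have hP₃0 : ∀ u, 0 ≤ P₃ u := fun u => by rw [hP₃]; positivity
  -- pointwise laws in `GetaL` currency
  have hL₁ : ∀ y z : ZSite 3, |GetaL ℓ j₀ k a₁ m₁ y z| ≤ (scale330 ℓ j₀ k)⁻¹ * (C₁ * P₁ (y - z)) := by
    intro y z
    rw [GetaL, abs_mul, abs_of_pos (inv_pos.2 hs0)]
    exact mul_le_mul_of_nonneg_left (by simpa only [hP₁] using hG₁ y z) (inv_nonneg.2 hs0.le)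
  have hL₂ : ∀ y z : ZSite 3, |GetaL ℓ j₀ k a₂ m₂ y z| ≤ (scale330 ℓ j₀ k)⁻¹ * (C₂ * (xiOf ℓ j₀)⁻¹) := by
    intro y z
    rw [GetaL, abs_mul, abs_of_pos (inv_pos.2 hs0)]
    refine mul_le_mul_of_nonneg_left ((hG₂ y z).trans ?_) (inv_nonneg.2 hs0.le)
    exact mul_le_mul_of_nonneg_left (profile_one_le hξ hδ₂.le _) hC₂.le
  have hL₃ : ∀ y z : ZSite 3, |GetaL ℓ j₀ k a₃ m₃ y z| ≤ (scale330 ℓ j₀ k)⁻¹ * (C₃ * P₃ (y - z)) := by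
    intro y z
    rw [GetaL, abs_mul, abs_of_pos (inv_pos.2 hs0)]
    exact mul_le_mul_of_nonneg_left (by simpa only [hP₃] using hG₃ y z) (inv_nonneg.2 hs0.le)
  -- the majorants A(z − x′), B(u − z)
  set cA : ℝ := |η⁻¹| * ((scale330 ℓ j₀ k)⁻¹ * C₁) with hcA
  set K₂ : ℝ := (scale330 ℓ j₀ k)⁻¹ * (C₂ * (xiOf ℓ j₀)⁻¹) with hK₂
  set cB : ℝ := (3 : ℝ) * (η⁻¹ ^ 2 * (4 * K₂)) * ((scale330 ℓ j₀ k)⁻¹ * C₃) with hcB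
  have hcA0 : 0 ≤ cA := by rw [hcA]; positivity
  have hK₂0 : 0 ≤ K₂ := by rw [hK₂]; positivity
  have hcB0 : 0 ≤ cB := by rw [hcB]; positivity
  set A : ZSite 3 → ℝ := fun v => cA * (P₁ (Pi.single μ 1 - v) + P₁ (-v)) with hA
  set B : ZSite 3 → ℝ := fun b => cB * P₃ (-b) with hB
  have hA0 : ∀ v, 0 ≤ A v := fun v => by rw [hA]; exact mul_nonneg hcA0 (add_nonneg (hP₁0 _) (hP₁0 _))
  have hB0 : ∀ b, 0 ≤ B b := fun b => by rw [hB]; exact mul_nonneg hcB0 (hP₃0 _)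
  have hrow₁ : ∀ y : ZSite 3, Summable fun v : ZSite 3 => P₁ (y - v) := fun y => by
    simpa only [hP₁] using summable_profile_row hξ hξ1 hδ₁ (hδ₁h.trans (by norm_num)) (q := 1) (by norm_num) y
  have hrow₃ : ∀ y : ZSite 3, Summable fun v : ZSite 3 => P₃ (y - v) := fun y => by
    simpa only [hP₃] using summable_profile_row hξ hξ1 hδ₃ (hδ₃h.trans (by norm_num)) (q := 1) (by norm_num) y
  have hAs : Summable A :=
    ((hrow₁ (Pi.single μ 1)).add ((hrow₁ 0).congr fun v => by rw [zero_sub])).mul_left cA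
  have hBs : Summable B := ((hrow₃ 0).congr fun b => by rw [zero_sub]).mul_left cB
  refine Summable.of_norm_bounded (summable_shear_sub (d := 2) hAs hBs hA0 hB0 x') fun p => ?_
  rw [Real.norm_eq_abs, abs_mul]
  refine mul_le_mul ?_ ?_ (abs_nonneg _) (hA0 _)
  · -- the differentiated line (∂^η_μ G₁)(x′, z)
    simp only [d1KernelZ, hA]
    rw [abs_mul, hcA]
    have h1 := hL₁ (x' + Pi.single μ 1) p.1
    have h2 := hL₁ x' p.1
    rw [show x' + Pi.single μ 1 - p.1 = Pi.single μ 1 - (p.1 - x') by abel] at h1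
    rw [show x' - p.1 = -(p.1 - x') by abel] at h2
    calc |η⁻¹| * |GetaL ℓ j₀ k a₁ m₁ (x' + Pi.single μ 1) p.1 - GetaL ℓ j₀ k a₁ m₁ x' p.1|
        ≤ |η⁻¹| * ((scale330 ℓ j₀ k)⁻¹ * (C₁ * P₁ (Pi.single μ 1 - (p.1 - x'))) +
            (scale330 ℓ j₀ k)⁻¹ * (C₁ * P₁ (-(p.1 - x')))) :=
          mul_le_mul_of_nonneg_left ((abs_sub _ _).trans (add_le_add h1 h2)) (abs_nonneg _)
      _ = |η⁻¹| * ((scale330 ℓ j₀ k)⁻¹ * C₁) * (P₁ (Pi.single μ 1 - (p.1 - x')) + P₁ (-(p.1 - x'))) := by ring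
  · -- the self-energy loop Σ(z,u) = (Σ_ν (∂_νG₂∂*_ν)(z,u))·G₃(z,u)
    simp only [coeff39Z, Pi.one_apply, mul_one, hB]
    rw [abs_mul, hcB]
    have hν : ∀ ν ∈ (Finset.univ : Finset (Fin 3)), |dKernelZ η⁻¹ ν (GetaL ℓ j₀ k a₂ m₂) p.1 p.2| ≤ η⁻¹ ^ 2 * (4 * K₂) := by
      intro ν _
      simp only [dKernelZ]
      rw [abs_mul, abs_of_nonneg (by positivity : (0 : ℝ) ≤ η⁻¹ ^ 2)]
      refine mul_le_mul_of_nonneg_left ?_ (by positivity)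
      have b1 := hL₂ (p.1 + Pi.single ν 1) (p.2 + Pi.single ν 1)
      have b2 := hL₂ (p.1 + Pi.single ν 1) p.2
      have b3 := hL₂ p.1 (p.2 + Pi.single ν 1)
      have b4 := hL₂ p.1 p.2
      rw [abs_le] at b1 b2 b3 b4 ⊢
      constructor <;> linarith [b1.1, b1.2, b2.1, b2.2, b3.1, b3.2, b4.1, b4.2]
    have hsum : |∑ ν : Fin 3, dKernelZ η⁻¹ ν (GetaL ℓ j₀ k a₂ m₂) p.1 p.2| ≤ 3 * (η⁻¹ ^ 2 * (4 * K₂)) := by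
      calc |∑ ν : Fin 3, dKernelZ η⁻¹ ν (GetaL ℓ j₀ k a₂ m₂) p.1 p.2|
          ≤ ∑ ν : Fin 3, |dKernelZ η⁻¹ ν (GetaL ℓ j₀ k a₂ m₂) p.1 p.2| := Finset.abs_sum_le_sum_abs _ _
        _ ≤ ∑ _ν : Fin 3, η⁻¹ ^ 2 * (4 * K₂) := Finset.sum_le_sum hν
        _ = 3 * (η⁻¹ ^ 2 * (4 * K₂)) := by rw [Finset.sum_const, Finset.card_univ, Fintype.card_fin, nsmul_eq_mul]; norm_num
    have h3 := hL₃ p.1 p.2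
    rw [show p.1 - p.2 = -(p.2 - p.1) by abel] at h3
    calc |∑ ν : Fin 3, dKernelZ η⁻¹ ν (GetaL ℓ j₀ k a₂ m₂) p.1 p.2| * |GetaL ℓ j₀ k a₃ m₃ p.1 p.2|
        ≤ (3 * (η⁻¹ ^ 2 * (4 * K₂))) * ((scale330 ℓ j₀ k)⁻¹ * (C₃ * P₃ (-(p.2 - p.1)))) :=
          mul_le_mul hsum h3 (abs_nonneg _) (by positivity)
      _ = 3 * (η⁻¹ ^ 2 * (4 * K₂)) * ((scale330 ℓ j₀ k)⁻¹ * C₃) * P₃ (-(p.2 - p.1)) := by ring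

end InstancesGetaL

end

end Literature.MathematicalPhysics.QuantumFieldTheory.Balaban1983to89.B3GammaPrimeVanishing
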